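import Summits.AtomisticToContinuum.HydrodynamicLimit.Theses.ImplosionDichotomy
import Literature.MathematicalPhysics.KineticTheory.HardSphereEulerLLN
import Literature.MathematicalPhysics.KineticTheory.HardSphereEulerDim
import Literature.Analysis.FluidPDE.HardSphereAlexander
import Literature.Analysis.FunctionSpaces.TorusCalculusProofs
import Literature.Analysis.FunctionSpaces.TorusSpaceTime
import Summits.AtomisticToContinuum.HydrodynamicLimit.Theorems.ImplosionDichotomyHsEosLowDensity
import Summits.AtomisticToContinuum.HydrodynamicLimit.Theorems.PolynomialCompression.Negative.SmoothPressure
import Summits.AtomisticToContinuum.HydrodynamicLimit.Theorems.PolynomialCompression.Negative.Energy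
-- after landing: import Summits.AtomisticToContinuum.HydrodynamicLimit.Theorems.DenseExcursion.Negative.EntropyEnvelope

/-!
# Disproof of `DenseExcursion` — findings (cdisprove standing adversary; v7 = gen-4 extension of v6.4)

Crux `Summit.AtomisticToContinuum.HydrodynamicLimit.Theses.ImplosionDichotomy.DenseExcursion`
(stmt-AtomisticToContinuum-12586, route ImplosionDichotomy, rank 2, the NEGATION PROGRAMME):
`∃ η > 0` and continuous positive profiles `(a₀, θ₀, u₀)` such that along SOME sequence `σ → 0` an
ADMISSIBLE (t = 0 fields = LLN limit of the local Gibbs laws, through every hard-sphere flow family)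
classical hard-sphere-Euler solution reaches PACKING `η ≤ ρ_t(x) σ³` somewhere on its interval of classical
existence.

VERDICT SO FAR (gen 4, 2026-08-16): **RESISTS** (no kill, no cheap proof; the EOS wall of §8.2 is DOWN since `hsEosLowDensity_proof` — see §14 for what that certifies). Everything below is `lean check`ed; sorry-free unless a
docstring says NEAR-MISS; standard axioms. PROVENANCE: the gen-1 file (v1–v4, 28 theorems, gate evidence
2026-08-15T22:19Z–23:25Z) is NOT mounted in later jails and was never published to the tree; this v5 re-derives its
recorded content (item notes) on the vocabulary of the sibling `Cruxes/PolynomialCompression/Disproof.lean`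
(§0–§2 are that file's §0–§3, adapted) and EXTENDS it (§3 onwards).

FINDINGS (section map):
* §0 vocabulary (`Flows`, `TiedThrough`, `Admissible`, flow-free `Tied`, `ReachesPacking η`;
  `denseExcursion_iff` is `Iff.rfl`).
* §1 the `t = 0` tie is FLOW-INDEPENDENT (`tiedThrough_iff_tied`, `admissible_iff_tied`; flows exist for
  `σ < 1/2` by Alexander, `flows_nonempty`) and only sees the time-0 slices.
* §2 STATICS, UNCONDITIONAL (tree LLN `localGibbs_lln_holds`): limits in probability are unique; DATA PINNING
  `admissible_iff_data`: admissible ⇔ `ρ 0 = rhoLim (profileOf a₀) σ ∧ u 0 = u₀ ∧ θ 0 = θ₀`; quantitative statics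
  `rhoLim < (2e+1)M`, `|rhoLim − β| ≤ 16e²v₁M²σ³` (`β = a₀/∫a₀`), `∫ rhoLim = 1`.
* §3 THE CRUX WITHOUT PARTICLES: `denseExcursion_iff_pde` — DE is a deterministic PDE statement about ONE explicit
  data family `(rhoLim (profileOf a₀) σ, u₀, θ₀)`, `σ → 0`.
* §4 THE DICHOTOMY: `denseExcursion_iff_not_diluteSelfConsistency` (DE ↔ ¬ rank-3 crux, stmt-3091), so the two
  cruxes are ONE decision problem; `ReachesPacking` is antitone in `η` (DE is its own `η → 0⁺` germ).
* §5 LADDER: `DenseExcursion → PolynomialCompression` (every `κ < 3`; filed rank-4 crux is implied).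
* §6 LOAD-BEARING MAP (for ∃-cruxes: "constraint C dropped ⇒ statement PROVABLE", so any disproof must use C):
  tie dropped ⇒ TRUE by constant states (`denseExcursionUntied_holds`); the three balance laws dropped (tie, joint
  smoothness, positivity kept) ⇒ TRUE by `ρ = e^{Lt}` (`denseExcursionNoPDE_holds`). Hence a disproof lives in
  the Euler balance laws acting on pinned data — i.e. in a σ-uniform a-priori density estimate.
* §7 STRENGTHENINGS REFUTED UNCONDITIONALLY: packing `η` AT `t = 0` is impossible (`not_denseExcursionAtTimeZero`,
  pinned data are `< (2e+1)M`); MASS IS CONSERVED along every classical hard-sphere-Euler solution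
  (`integral_density_eq`, EOS-free) and admissible mass is `1`, so the dense set `{x | η ≤ ρσ³}` has volume
  `≤ σ³/η` (`volume_denseSet_le`) and packing `η` EVERYWHERE at some time is impossible
  (`not_denseExcursionEverywhere`): any witness is a point-like concentration carrying volume `O(σ³)`.
* §8 WHY IT RESISTS (docstring `why_it_resists`): the EOS wall (`hsCompressibility = 1 + η·deriv(limsup …)`,
  nothing provable on `(0, 512)` in the tree), the PDE content (σ-uniform `L∞` density control at the first
  singularity of 3-D compressible Euler for the implosion data class), the numerics on record, the literature.
* §9 the `∀σ` form implies the crux (`denseExcursion_of_allSmallSigma`); disprover's notes on the four round-1 cards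
  (`notes_on_cards`: RACE numerically dead at every computed profile; the entropy part of `K₁`; the Kidder map is not
  a torus symmetry and `DenseExcursionMovingProfile` is vacuous-by-concentration; soft side may bounce).
* §10 conditional infrastructure behind the EOS wall: `integral_totalEnergy_eq` (energy conservation GIVEN smooth
  energy-flux slices — dischargeable once `Z` is smooth on `[0,η]`), unconditional at `σ = 0`
  (`integral_totalEnergy_eq_ideal`).
* §11 (gen 3) THE COMPRESSION BUDGET — second EOS-free a-priori estimate: a MAXIMUM PRINCIPLE for the continuity
  equation (`density_le_max_mul_exp`: `-K ≤ div u` on `[0,t] × 𝕋³` ⇒ `ρ(t,·) ≤ max ρ(0,·) e^{Kt}`, every `σ`, every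
  pressure law) ⇒ admissible packing `< (2e+1)Mσ³e^{Kt}` (`density_lt_of_divergence_ge`) ⇒ two strengthenings
  REFUTED UNCONDITIONALLY: `not_denseExcursionBoundedCompression` (σ-uniform bound on `(div u)₋` up to the excursion)
  and `not_denseExcursionLipschitzVelocity` (σ-uniform `‖Du‖ ≤ M`, the continuation regime of the line's
  `HsEulerWellPosedness`): every witness needs `sup_{s≤t}‖(div u_σ)₋‖∞ · t ≥ 3 log σ⁻¹ + O(1)` from FIXED `u₀`.
* §12 (gen 3) TARGETS — the four stubs of the registered skeleton `Lines/r2-one-mode-two-conditions.lean`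
  (docblock `targets_r2_line`): conventions of `Delta1/Delta2/linW/linS` re-derived independently (CORRECT; symmetry
  modes `Λ = 0`, `Λ = r` certified as algebraic identities `linW_translation_mode`, `linW_gauge_mode`); junk audit of
  `EosRelated`, `HsEulerWellPosedness`, `ImplodesWithProfile`, `TunedImplosion` (no cheap kill; notes for the lead);
  STUB 1 REDUCED to one deterministic EOS identity for `rhoLim` (`stub_admissibleData_iff_eosIdentity`);
  PICKED line `kidder-knob-melnikov` (docblock `targets_kidder_line`): `stub_projectiveCovariance` VERIFIED EXACTLY by
  rational automatic differentiation of the typed `EulerZAt`/dual maps (evidence `projcov_check.py`), `stub_tiedStatics`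
  consistent with `clusterCoeff = (σ³)ᵏ/k!·bE k`, `KnobFamily` interface constraint `Rc ≤ (1 + bLo·T)/2` (torus
  wrap-around of the `kidder` ball), `stub_knobTracking` = the crux content (no cheap kill).
* §13 (gen 3) THE ATHERMAL SCALING SYMMETRY (EOS-free, every `σ`): `athermal_scaling` —
  `(ρ, u, θ)(t,x) ↦ (ρ, μu, μ²θ)(μt, x)` maps classical hard-sphere-Euler solutions to classical solutions (constant
  factors pass the junk-valued torus operators unconditionally); the crux's body for given profiles is invariant under
  `(u₀, θ₀) ↦ (μu₀, μ²θ₀)` (`reachesPackingWith_athermal_scaling`): the profile space is foliated, nothing else scales.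

* §14 (gen 4) THE EOS WALL IS DOWN — THE ENTROPY BUDGET: with `HsEosLowDensity` PROVED in the tree, entropy transport
  `∂ₜs = −u·∇s` (`s = (3/2)log θ − log ρ − F(ρσ³)`) + a transport min/max principle ⇒ HOT SPOTS (`θ³ ≥ cρ²` for admissible
  solutions below the EOS threshold: packing `η` only at `θ ≳ σ⁻²`, `p ≳ σ⁻⁵`), dense volume `≤ Cσ⁵/η^{5/3}`, energy
  conservation unconditional below `η₀`, and a THIRD strengthening REFUTED (`¬ DenseExcursionBoundedTemperature`); gen-4
  census (`gen4_census`): why `K₂(b₀) ≠ 0` kills neither line nor crux; r2-stub audit note (`P₃`-crossing profiles).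

LANDED as negative knowledge (`Theorems/DenseExcursion/Negative/`, `--supports` this item, all ACCEPTED 2026-08-15):
`Untied.lean` (p70699, §6), `Everywhere.lean` (p70755, §7), `AtTimeZero.lean` (p70819, §7), `Dichotomy.lean` (p71075, §4–§5,
stated as `¬(DE ∧ DSC)`, `DE ↔ ¬DSC`, `¬(DE ∧ ¬PC)`), `Degenerate.lean` (p71115, §6); gen 3 (2026-08-16): `CompressionBudget.lean`
(p72046, §11: `density_le_max_mul_exp`, `denseExcursion_false_boundedCompression`, `denseExcursion_false_lipschitzVelocity`),
`AthermalScaling.lean` (p73138, §13: `athermal_scaling`, `reachesPackingWith_athermal_scaling`) — self-contained, importable;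
gen 4 (2026-08-16): `EntropyTransport.lean` (`entropy_transport`, `transport_min/max_principle`, `exists_ent_zero_le/le_zero`),
`EntropyBudget.lean` (`hot_core`, `denseExcursion_false_boundedTemperature`) and `EntropyEnvelope.lean` (`volume_denseSet_le_pow_five`,
`mass_denseSet_le_sq`) — proposed in sequence (each imports the previous; all rc0 as one file, work/EntropyE.lean); ids in the
crux item's evidence notes; imported here (§14 restatements) once landed.
-/

noncomputable section

namespace Summit.AtomisticToContinuum.HydrodynamicLimit.Cruxes.DenseExcursion.Disproof

open MeasureTheory Filter Set Topology
open scoped ENNReal InnerProductSpace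
open Literature.MathematicalPhysics.KineticTheory Literature.Analysis.FluidPDE
open Literature.Analysis.FunctionSpaces
open Summit.AtomisticToContinuum.HydrodynamicLimit.Theses.ImplosionDichotomy

/-! ## §0 Vocabulary: flows, the `t = 0` tie, admissibility, `ReachesPacking` -/

/-- A family of hard-sphere flows, one for each particle number `N + 1`, at reduced density `σ`
(the type quantified by `∀ Φ` in every item of the route). -/
abbrev Flows (σ : ℝ) :=
  (N : ℕ) → HardSphereFlow (Torus.geometry (Fin 3)) (hsDiameter σ N) (N + 1)

/-- The `t = 0` tie THROUGH ONE flow family `Φ`: the local Gibbs empirical fields at time `0`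
converge in probability to `(ρ, ρu, E)(0)`. -/
def TiedThrough (σ : ℝ) (a₀ : T3 → ℝ) (u₀ : T3 → V3) (θ₀ : T3 → ℝ) (Φ : Flows σ)
    (ρ : ℝ → T3 → ℝ) (u : ℝ → T3 → V3) (θ : ℝ → T3 → ℝ) : Prop :=
  TendstoHydroFieldsAt (fun N => localGibbsLaw σ a₀ u₀ θ₀ N (Φ N)) Φ ρ u θ 0

/-- ADMISSIBILITY of Euler fields `(ρ, u, θ)` for the profiles `(a₀, u₀, θ₀)` at reduced density `σ`: the
`t = 0` tie through EVERY flow family (verbatim the `∀ Φ, TendstoHydroFieldsAt … 0` clause of `DenseExcursion`). -/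
def Admissible (σ : ℝ) (a₀ : T3 → ℝ) (u₀ : T3 → V3) (θ₀ : T3 → ℝ)
    (ρ : ℝ → T3 → ℝ) (u : ℝ → T3 → V3) (θ : ℝ → T3 → ℝ) : Prop :=
  ∀ Φ : Flows σ, TiedThrough σ a₀ u₀ θ₀ Φ ρ u θ

/-- The flow-free `t = 0` tie: the same three convergences in probability, for the flow-free local Gibbs MEASURE
`localGibbsMeasure` and the UNMOVED configuration `z` (no `Φ`, no `flow 0`). -/
def Tied (σ : ℝ) (a₀ : T3 → ℝ) (u₀ : T3 → V3) (θ₀ : T3 → ℝ)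
    (ρ : ℝ → T3 → ℝ) (u : ℝ → T3 → V3) (θ : ℝ → T3 → ℝ) : Prop :=
  ∀ χ : T3 → ℝ, Continuous χ → ∀ δ > (0 : ℝ),
    Tendsto (fun N => localGibbsMeasure σ a₀ u₀ θ₀ N
      {z | δ < |empiricalDensityField z χ - ∫ x, χ x * ρ 0 x|}) atTop (𝓝 0) ∧
    Tendsto (fun N => localGibbsMeasure σ a₀ u₀ θ₀ N
      {z | δ < ‖empiricalMomentumField z χ - ∫ x, (χ x * ρ 0 x) • u 0 x‖}) atTop (𝓝 0) ∧
    Tendsto (fun N => localGibbsMeasure σ a₀ u₀ θ₀ N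
      {z | δ < |empiricalEnergyField z χ -
        ∫ x, χ x * totalEnergyDensity (ρ 0 x) (u 0 x) (θ 0 x)|}) atTop (𝓝 0)

/-- `ReachesPacking η`: the crux AT A GIVEN packing level `η` — continuous positive profiles, and along SOME
sequence `σ → 0` an admissible classical hard-sphere-Euler solution with `η ≤ ρ_t(x) σ³` somewhere on `[0,T)`.
`DenseExcursion ↔ ∃ η > 0, ReachesPacking η` definitionally. -/
def ReachesPacking (η : ℝ) : Prop :=
  ∃ (a₀ θ₀ : T3 → ℝ) (u₀ : T3 → V3), Continuous a₀ ∧ Continuous θ₀ ∧ Continuous u₀ ∧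
    (∀ x, 0 < a₀ x) ∧ (∀ x, 0 < θ₀ x) ∧ ∀ σ₀ : ℝ, 0 < σ₀ → ∃ σ : ℝ, 0 < σ ∧ σ < σ₀ ∧
      ∃ (T : ℝ) (ρ θ : ℝ → T3 → ℝ) (u : ℝ → T3 → V3), IsHardSphereEulerSolution σ T ρ u θ ∧
        Admissible σ a₀ u₀ θ₀ ρ u θ ∧ ∃ t ∈ Ico 0 T, ∃ x, η ≤ ρ t x * σ ^ 3

/-- The crux, unfolded: `DenseExcursion ↔ ∃ η > 0, ReachesPacking η` (definitional). -/
theorem denseExcursion_iff : DenseExcursion ↔ ∃ η : ℝ, 0 < η ∧ ReachesPacking η :=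
  Iff.rfl

/-! ## §1 The `t = 0` tie is flow-independent (Alexander's theorem only supplies inhabitants) -/

/-- Flow families exist at every reduced density `0 < σ < 1/2` (Alexander's theorem on `𝕋³`,
`HardSphereFlow.nonempty_torus_holds`, with `hsDiameter σ N ≤ σ < 1/2`). -/
theorem flows_nonempty {σ : ℝ} (hσ : 0 < σ) (hσ2 : σ < 1 / 2) : Nonempty (Flows σ) :=
  ⟨fun N => Classical.choice (HardSphereFlow.nonempty_torus_holds (d := Fin 3)
    (hsDiameter_pos hσ N) ((hsDiameter_le hσ.le N).trans_lt (hσ2.trans_eq (by norm_num)))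
    (N + 1))⟩

/-- **The tie through any one flow family is the flow-free tie** (`Φ_0 = id` Liouville-a.e. on the good set,
the local Gibbs law is absolutely continuous and equals `localGibbsMeasure` for every flow:
`localGibbsLaw_preimage_flow_zero`). No hypothesis on `σ` or the profiles. -/
theorem tiedThrough_iff_tied {σ : ℝ} {a₀ θ₀ : T3 → ℝ} {u₀ : T3 → V3} (Φ : Flows σ)
    {ρ θ : ℝ → T3 → ℝ} {u : ℝ → T3 → V3} :
    TiedThrough σ a₀ u₀ θ₀ Φ ρ u θ ↔ Tied σ a₀ u₀ θ₀ ρ u θ := by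
  unfold TiedThrough TendstoHydroFieldsAt Tied
  have key : ∀ (N : ℕ) (p : Config (N + 1) (Fin 3) T3 → Prop),
      localGibbsLaw σ a₀ u₀ θ₀ N (Φ N) {z | p ((Φ N).flow 0 z)} =
        localGibbsMeasure σ a₀ u₀ θ₀ N {z | p z} :=
    fun N p => localGibbsLaw_preimage_flow_zero σ a₀ u₀ θ₀ N (Φ N) {z | p z}
  refine forall_congr' fun χ => forall_congr' fun _ => forall_congr' fun δ =>
    forall_congr' fun _ => ?_
  have h1 : (fun N => localGibbsLaw σ a₀ u₀ θ₀ N (Φ N)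
      {z | δ < |empiricalDensityField ((Φ N).flow 0 z) χ - ∫ x, χ x * ρ 0 x|}) =
      fun N => localGibbsMeasure σ a₀ u₀ θ₀ N
        {z | δ < |empiricalDensityField z χ - ∫ x, χ x * ρ 0 x|} :=
    funext fun N => key N fun z => δ < |empiricalDensityField z χ - ∫ x, χ x * ρ 0 x|
  have h2 : (fun N => localGibbsLaw σ a₀ u₀ θ₀ N (Φ N)
      {z | δ < ‖empiricalMomentumField ((Φ N).flow 0 z) χ - ∫ x, (χ x * ρ 0 x) • u 0 x‖}) =
      fun N => localGibbsMeasure σ a₀ u₀ θ₀ N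
        {z | δ < ‖empiricalMomentumField z χ - ∫ x, (χ x * ρ 0 x) • u 0 x‖} :=
    funext fun N => key N fun z => δ < ‖empiricalMomentumField z χ - ∫ x, (χ x * ρ 0 x) • u 0 x‖
  have h3 : (fun N => localGibbsLaw σ a₀ u₀ θ₀ N (Φ N)
      {z | δ < |empiricalEnergyField ((Φ N).flow 0 z) χ -
        ∫ x, χ x * totalEnergyDensity (ρ 0 x) (u 0 x) (θ 0 x)|}) =
      fun N => localGibbsMeasure σ a₀ u₀ θ₀ N
        {z | δ < |empiricalEnergyField z χ -
          ∫ x, χ x * totalEnergyDensity (ρ 0 x) (u 0 x) (θ 0 x)|} :=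
    funext fun N => key N fun z => δ < |empiricalEnergyField z χ -
      ∫ x, χ x * totalEnergyDensity (ρ 0 x) (u 0 x) (θ 0 x)|
  rw [h1, h2, h3]

/-- Admissibility (tie through ALL flows) follows from the tie through ONE flow family. -/
theorem admissible_of_tiedThrough {σ : ℝ} {a₀ θ₀ : T3 → ℝ} {u₀ : T3 → V3} (Φ : Flows σ)
    {ρ θ : ℝ → T3 → ℝ} {u : ℝ → T3 → V3} (h : TiedThrough σ a₀ u₀ θ₀ Φ ρ u θ) :
    Admissible σ a₀ u₀ θ₀ ρ u θ :=
  fun Ψ => (tiedThrough_iff_tied Ψ).2 ((tiedThrough_iff_tied Φ).1 h)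

/-- Admissibility is the flow-free tie, as soon as one flow family exists (`0 < σ < 1/2`). -/
theorem admissible_iff_tied {σ : ℝ} {a₀ θ₀ : T3 → ℝ} {u₀ : T3 → V3} (hne : Nonempty (Flows σ))
    {ρ θ : ℝ → T3 → ℝ} {u : ℝ → T3 → V3} :
    Admissible σ a₀ u₀ θ₀ ρ u θ ↔ Tied σ a₀ u₀ θ₀ ρ u θ :=
  ⟨fun h => (tiedThrough_iff_tied hne.some).1 (h hne.some),
    fun h Φ => (tiedThrough_iff_tied Φ).2 h⟩

/-- The tie only sees the time-`0` slices of the fields. -/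
theorem tied_congr_zero {σ : ℝ} {a₀ θ₀ : T3 → ℝ} {u₀ : T3 → V3}
    {ρ θ ρ' θ' : ℝ → T3 → ℝ} {u u' : ℝ → T3 → V3}
    (hρ : ρ 0 = ρ' 0) (hu : u 0 = u' 0) (hθ : θ 0 = θ' 0) :
    Tied σ a₀ u₀ θ₀ ρ u θ ↔ Tied σ a₀ u₀ θ₀ ρ' u' θ' := by
  unfold Tied
  rw [hρ, hu, hθ]

/-- Admissibility only sees the time-`0` slices of the fields. -/
theorem admissible_congr_zero {σ : ℝ} {a₀ θ₀ : T3 → ℝ} {u₀ : T3 → V3}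
    {ρ θ ρ' θ' : ℝ → T3 → ℝ} {u u' : ℝ → T3 → V3}
    (hρ : ρ 0 = ρ' 0) (hu : u 0 = u' 0) (hθ : θ 0 = θ' 0) :
    Admissible σ a₀ u₀ θ₀ ρ u θ ↔ Admissible σ a₀ u₀ θ₀ ρ' u' θ' :=
  forall_congr' fun Φ => (tiedThrough_iff_tied Φ).trans
    ((tied_congr_zero hρ hu hθ).trans (tiedThrough_iff_tied Φ).symm)

/-! ## §2 Statics: limits in probability are unique, the LLN density is `rhoLim`, data pinning -/

/-- **Limits in probability are unique** (for eventually-probability laws): if the laws of `F N` concentrate at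
`a` and at `b` then `a = b` (cover `univ` by the two deviation events at `δ = ‖a - b‖/3`). -/
theorem eq_of_tendsto_measure_lt {Ω : ℕ → Type*} [∀ N, MeasurableSpace (Ω N)]
    {P : (N : ℕ) → Measure (Ω N)} (hP : ∀ᶠ N in atTop, IsProbabilityMeasure (P N))
    {E : Type*} [NormedAddCommGroup E] {F : (N : ℕ) → Ω N → E} {a b : E}
    (ha : ∀ δ > (0 : ℝ), Tendsto (fun N => P N {z | δ < ‖F N z - a‖}) atTop (𝓝 0))
    (hb : ∀ δ > (0 : ℝ), Tendsto (fun N => P N {z | δ < ‖F N z - b‖}) atTop (𝓝 0)) : a = b := by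
  by_contra hab
  have hd : 0 < ‖a - b‖ := norm_pos_iff.2 (sub_ne_zero.2 hab)
  set δ := ‖a - b‖ / 3 with hδ
  have hδ0 : 0 < δ := by positivity
  have hcover : ∀ N, (univ : Set (Ω N)) ⊆ {z | δ < ‖F N z - a‖} ∪ {z | δ < ‖F N z - b‖} := by
    intro N z _
    by_contra hz
    simp only [Set.mem_union, Set.mem_setOf_eq, not_or, not_lt] at hz
    have : ‖a - b‖ ≤ ‖F N z - a‖ + ‖F N z - b‖ := by
      calc ‖a - b‖ = ‖(F N z - b) - (F N z - a)‖ := by congr 1; abel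
        _ ≤ ‖F N z - b‖ + ‖F N z - a‖ := norm_sub_le _ _
        _ = ‖F N z - a‖ + ‖F N z - b‖ := add_comm _ _
    linarith [hz.1, hz.2]
  have hle : ∀ᶠ N in atTop,
      (1 : ℝ≥0∞) ≤ P N {z | δ < ‖F N z - a‖} + P N {z | δ < ‖F N z - b‖} := by
    filter_upwards [hP] with N hPN
    calc (1 : ℝ≥0∞) = P N univ := measure_univ.symm
      _ ≤ P N ({z | δ < ‖F N z - a‖} ∪ {z | δ < ‖F N z - b‖}) := measure_mono (hcover N)
      _ ≤ _ := measure_union_le _ _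
  have hlim : Tendsto (fun N => P N {z | δ < ‖F N z - a‖} + P N {z | δ < ‖F N z - b‖})
      atTop (𝓝 0) := by
    simpa using (ha δ hδ0).add (hb δ hδ0)
  have h10 : (1 : ℝ≥0∞) ≤ 0 := ge_of_tendsto hlim hle
  exact absurd h10 (by simp)

/-- Real-valued version of `eq_of_tendsto_measure_lt` (deviation events written with `|·|`). -/
theorem eq_of_tendsto_measure_lt_abs {Ω : ℕ → Type*} [∀ N, MeasurableSpace (Ω N)]
    {P : (N : ℕ) → Measure (Ω N)} (hP : ∀ᶠ N in atTop, IsProbabilityMeasure (P N))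
    {F : (N : ℕ) → Ω N → ℝ} {a b : ℝ}
    (ha : ∀ δ > (0 : ℝ), Tendsto (fun N => P N {z | δ < |F N z - a|}) atTop (𝓝 0))
    (hb : ∀ δ > (0 : ℝ), Tendsto (fun N => P N {z | δ < |F N z - b|}) atTop (𝓝 0)) : a = b :=
  eq_of_tendsto_measure_lt (E := ℝ) hP (by simpa only [Real.norm_eq_abs] using ha)
    (by simpa only [Real.norm_eq_abs] using hb)

/-- Two continuous functions on `𝕋³` with the same integrals against every continuous test function are equal
(test with `χ = f - g`: `∫ (f-g)² = 0`, Haar measure charges open sets). -/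
theorem eq_of_forall_integral_mul_eq {f g : T3 → ℝ} (hf : Continuous f) (hg : Continuous g)
    (h : ∀ χ : T3 → ℝ, Continuous χ → ∫ x, χ x * f x = ∫ x, χ x * g x) : f = g := by
  have hw : Continuous fun x => f x - g x := hf.sub hg
  have h1 := h _ hw
  have hint : ∫ x, (f x - g x) ^ 2 = 0 := by
    have hi1 : Integrable (fun x => (f x - g x) * f x) := integrable_of_continuous_T3 (hw.mul hf)
    have hi2 : Integrable (fun x => (f x - g x) * g x) := integrable_of_continuous_T3 (hw.mul hg)
    have h2 : ∫ x, ((f x - g x) * f x - (f x - g x) * g x) = 0 := by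
      rw [integral_sub hi1 hi2, h1, sub_self]
    have e : (fun x => (f x - g x) ^ 2) = fun x => (f x - g x) * f x - (f x - g x) * g x := by
      funext x; ring
    rw [e]
    exact h2
  have hae : (fun x => (f x - g x) ^ 2) =ᵐ[volume] 0 :=
    (integral_eq_zero_iff_of_nonneg (fun x => sq_nonneg (f x - g x))
      (integrable_of_continuous_T3 (hw.pow 2))).1 hint
  have heq : (fun x => (f x - g x) ^ 2) = 0 :=
    (Continuous.ae_eq_iff_eq volume (hw.pow 2) continuous_const).1 hae
  funext x
  have hx := congrFun heq x
  simp only [Pi.zero_apply, ne_eq, OfNat.ofNat_ne_zero, not_false_eq_true, pow_eq_zero_iff] at hx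
  linarith

/-- Coordinates of a Bochner integral of a `V3`-valued function on `𝕋³`. -/
theorem integral_apply_coord {F : T3 → V3} (hF : Integrable F volume) (i : Fin 3) :
    (∫ x, F x) i = ∫ x, F x i :=
  ((EuclideanSpace.proj i : V3 →L[ℝ] ℝ).integral_comp_comm hF).symm

/-- **The density law of large numbers with the IDENTIFIED limit `rhoLim`** (the tree's
`localGibbs_densityLLN_holds` with its witness exposed): for continuous `a₀ > 0` and `0 < σ < σ₀(a₀)`, the
smallness package `SmallDensity (profileOf a₀) σ` holds, the positivity margin `4eMθ/(1-θ) < min β` holds, and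
the empirical density of the configurational canonical Gibbs measure converges in probability to
`∫ χ · rhoLim (profileOf a₀) σ` (`rhoLim P σ x = ∑_j γ_{j+1}(σ) R(σ)^{j+1} β(x)^{j+1}`, `β = a₀/∫a₀`). -/
theorem densityLLN_rhoLim {a₀ : T3 → ℝ} (ha : Continuous a₀) (ha0 : ∀ x, 0 < a₀ x) :
    ∃ σ₀ : ℝ, 0 < σ₀ ∧ ∀ σ : ℝ, 0 < σ → σ < σ₀ →
      SmallDensity (profileOf a₀ ha ha0) σ ∧
      (∀ x, 4 * Real.exp 1 * (profileOf a₀ ha ha0).M * geomRatio (profileOf a₀ ha ha0) σ /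
          (1 - geomRatio (profileOf a₀ ha ha0) σ) < (profileOf a₀ ha ha0).β x) ∧
      ∀ χ : T3 → ℝ, Continuous χ → ∀ δ > (0 : ℝ),
        Tendsto (fun N : ℕ => posGibbsMeasure a₀ (hsDiameter σ N) (N + 1)
          {x | δ < |((N + 1 : ℕ) : ℝ)⁻¹ * ∑ i, χ (x i) -
            ∫ y, χ y * rhoLim (profileOf a₀ ha ha0) σ y|}) atTop (𝓝 0) := by
  set P := profileOf a₀ ha ha0 with hP
  obtain ⟨x₀, -, hx₀⟩ := isCompact_univ.exists_isMinOn univ_nonempty P.continuous.continuousOn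
  have hβmin : ∀ y, P.β x₀ ≤ P.β y := fun y => (isMinOn_iff.mp hx₀) y (mem_univ y)
  obtain ⟨σ₀, hσ₀, hsmall⟩ := exists_smallDensity P (P.pos x₀)
  refine ⟨σ₀, hσ₀, fun σ hσ hσσ₀ => ?_⟩
  obtain ⟨h, hpos⟩ := hsmall σ hσ hσσ₀
  refine ⟨h, fun x => hpos.trans_le (hβmin x), ?_⟩
  intro χ hχ δ hδ
  obtain ⟨C, hC0, hχC⟩ := exists_forall_abs_le_of_continuous hχ
  have hχm : Measurable χ := hχ.measurable
  rw [← h.Ilim_eq_integral hχ]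
  set I := Ilim P σ χ with hI
  set V : ℕ → ℝ := fun N => (∫ x, ((((N + 1 : ℕ) : ℝ))⁻¹ * ∑ i, χ (x i) - I) ^ 2 *
      Literature.MathematicalPhysics.StatisticalMechanics.efR (Ov (hsDiameter σ N)) x Finset.univ
        ∂Measure.pi (fun _ : Fin (N + 1) => P.μ)) / XiN P σ N (N + 1) with hV
  have hVlim : Tendsto V atTop (𝓝 0) := h.tendsto_variance hχ
  have hbound : ∀ N : ℕ, posGibbsMeasure a₀ (hsDiameter σ N) (N + 1)
      {x | δ < |((N + 1 : ℕ) : ℝ)⁻¹ * ∑ i, χ (x i) - I|} ≤ ENNReal.ofReal (V N / δ ^ 2) := by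
    intro N
    have hXi := XiN_pos h.σ_pos.le h.σ_lt_half h.ovDensity_lt_one (N := N) (m := N + 1) le_rfl
    have hA : Measurable fun x : Fin (N + 1) → T3 => ((N + 1 : ℕ) : ℝ)⁻¹ * ∑ i, χ (x i) :=
      (Finset.measurable_sum _ fun i _ => hχm.comp (measurable_pi_apply i)).const_mul _
    have hAK : ∀ x : Fin (N + 1) → T3,
        |((N + 1 : ℕ) : ℝ)⁻¹ * ∑ i, χ (x i)| ≤ ((N + 1 : ℕ) : ℝ)⁻¹ * ((N + 1 : ℕ) * C) :=
      fun x => by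
        rw [abs_mul, abs_of_nonneg (by positivity)]
        exact mul_le_mul_of_nonneg_left (abs_sum_apply_le hχC x) (by positivity)
    have hXi' : 0 ≤ (Xi P (hsDiameter σ N) (N + 1) (N + 1))⁻¹ := inv_nonneg.2 hXi.le
    rw [posGibbsMeasure_eq ha ha0, Measure.smul_apply, smul_eq_mul]
    refine (mul_le_mul_right (restrict_hardCore_deviation_le P _ _ hA hAK I hδ) _).trans
      (le_of_eq ?_)
    rw [← ENNReal.ofReal_mul hXi']
    congr 1
    rw [hV]
    dsimp only
    rw [XiN, inv_mul_eq_div, div_div, div_div, mul_comm]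
  have hlim : Tendsto (fun N => ENNReal.ofReal (V N / δ ^ 2)) atTop (𝓝 0) := by
    have := ENNReal.tendsto_ofReal (hVlim.div_const (δ ^ 2))
    rwa [zero_div, ENNReal.ofReal_zero] at this
  exact tendsto_of_tendsto_of_tendsto_of_le_of_le tendsto_const_nhds hlim (fun _ => zero_le) hbound

/-- **The local-equilibrium law of large numbers with identified density.** For continuous profiles
`a₀, θ₀ > 0`, `u₀` there is `σ₁ ∈ (0, 1/2]` such that for `0 < σ < σ₁`: the statics package holds and the local
Gibbs laws are probability measures whose empirical fields at `t = 0` converge in probability to those of the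
CONSTANT-IN-TIME fields `(rhoLim (profileOf a₀) σ, u₀, θ₀)` through every flow family. -/
theorem lln_rhoLim {a₀ θ₀ : T3 → ℝ} {u₀ : T3 → V3} (ha : Continuous a₀) (hθ : Continuous θ₀)
    (hu : Continuous u₀) (ha0 : ∀ x, 0 < a₀ x) (hθ0 : ∀ x, 0 < θ₀ x) :
    ∃ σ₁ : ℝ, 0 < σ₁ ∧ σ₁ ≤ 1 / 2 ∧ ∀ σ : ℝ, 0 < σ → σ < σ₁ →
      SmallDensity (profileOf a₀ ha ha0) σ ∧
      (∀ x, 4 * Real.exp 1 * (profileOf a₀ ha ha0).M * geomRatio (profileOf a₀ ha ha0) σ /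
          (1 - geomRatio (profileOf a₀ ha ha0) σ) < (profileOf a₀ ha ha0).β x) ∧
      ∀ Φ : Flows σ, (∀ N, IsProbabilityMeasure (localGibbsLaw σ a₀ u₀ θ₀ N (Φ N))) ∧
        TiedThrough σ a₀ u₀ θ₀ Φ (fun _ => rhoLim (profileOf a₀ ha ha0) σ) (fun _ => u₀)
          (fun _ => θ₀) := by
  set P := profileOf a₀ ha ha0 with hP
  obtain ⟨σa, hσa, Ha⟩ := localGibbs_lln_holds a₀ θ₀ u₀ ha hθ hu ha0 hθ0
  obtain ⟨σb, hσb, Hb⟩ := densityLLN_rhoLim ha ha0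
  refine ⟨min (min σa σb) (1 / 2), lt_min (lt_min hσa hσb) (by norm_num), min_le_right _ _,
    fun σ hσ hσlt => ?_⟩
  have hσa' : σ < σa := lt_of_lt_of_le hσlt ((min_le_left _ _).trans (min_le_left _ _))
  have hσb' : σ < σb := lt_of_lt_of_le hσlt ((min_le_left _ _).trans (min_le_right _ _))
  have hσ2 : σ ≤ 1 / 2 := (lt_of_lt_of_le hσlt (min_le_right _ _)).le
  obtain ⟨h, hpos, hdens⟩ := Hb σ hσ hσb'
  obtain ⟨ρ₀, hρc, -, Hlln⟩ := Ha σ hσ hσa'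
  refine ⟨h, hpos, fun Φ => ⟨(Hlln Φ).1, ?_⟩⟩
  have hT : TiedThrough σ a₀ u₀ θ₀ Φ (fun _ => ρ₀) (fun _ => u₀) (fun _ => θ₀) := (Hlln Φ).2
  have hid : ρ₀ = rhoLim P σ := by
    refine eq_of_forall_integral_mul_eq hρc h.continuous_rhoLim fun χ hχ => ?_
    have hflowfree := (tiedThrough_iff_tied Φ).1 hT
    refine eq_of_tendsto_measure_lt_abs (P := fun N => localGibbsMeasure σ a₀ u₀ θ₀ N)
      (F := fun N z => empiricalDensityField z χ)
      (Eventually.of_forall fun N => isProbabilityMeasure_localGibbsMeasure ha hθ hu ha0 hθ0 hσ2 N)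
      (fun δ hδ => (hflowfree χ hχ δ hδ).1) (fun δ hδ => ?_)
    refine (tendsto_localGibbsMeasure_densityEvent (u₀ := u₀) ha hθ hu (fun x => (ha0 x).le)
      hθ0 σ hdens hχ hδ).congr fun N => ?_
    show localGibbsMeasure σ a₀ u₀ θ₀ N
        {z | δ < |((N + 1 : ℕ) : ℝ)⁻¹ * ∑ i, χ (z i).1 - ∫ y, χ y * rhoLim P σ y|} =
      localGibbsMeasure σ a₀ u₀ θ₀ N
        {z | δ < |empiricalDensityField z χ - ∫ y, χ y * rhoLim P σ y|}
    simp only [empiricalDensityField_eq_sum]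
  subst hid
  exact hT

/-- **DATA PINNING.** If continuous time-`0` slices `(ρ 0, u 0, θ 0)` satisfy the flow-free tie for the profiles
`(a₀, u₀, θ₀)` at `σ ≤ 1/2`, and the tie also holds for constant-in-time fields `(ρ₀, u₀, θ₀)` with `ρ₀`
continuous and positive (the LLN), then `ρ 0 = ρ₀`, `u 0 = u₀`, `θ 0 = θ₀`. -/
theorem data_eq_of_tied {σ : ℝ} {a₀ θ₀ : T3 → ℝ} {u₀ : T3 → V3} (ha : Continuous a₀)
    (hθ : Continuous θ₀) (hu : Continuous u₀) (ha0 : ∀ x, 0 < a₀ x) (hθ0 : ∀ x, 0 < θ₀ x)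
    (hσ2 : σ ≤ 1 / 2) {ρ₀ : T3 → ℝ} (hρ₀c : Continuous ρ₀) (hρ₀pos : ∀ x, 0 < ρ₀ x)
    (hlln : Tied σ a₀ u₀ θ₀ (fun _ => ρ₀) (fun _ => u₀) (fun _ => θ₀))
    {ρ θ : ℝ → T3 → ℝ} {u : ℝ → T3 → V3} (hρc : Continuous (ρ 0)) (huc : Continuous (u 0))
    (hθc : Continuous (θ 0)) (ht : Tied σ a₀ u₀ θ₀ ρ u θ) :
    ρ 0 = ρ₀ ∧ u 0 = u₀ ∧ θ 0 = θ₀ := by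
  have hP : ∀ᶠ N in atTop, IsProbabilityMeasure (localGibbsMeasure σ a₀ u₀ θ₀ N) :=
    Eventually.of_forall fun N => isProbabilityMeasure_localGibbsMeasure ha hθ hu ha0 hθ0 hσ2 N
  have hρ : ρ 0 = ρ₀ := by
    refine eq_of_forall_integral_mul_eq hρc hρ₀c fun χ hχ => ?_
    exact eq_of_tendsto_measure_lt_abs (F := fun N z => empiricalDensityField z χ) hP
      (fun δ hδ => (ht χ hχ δ hδ).1) (fun δ hδ => (hlln χ hχ δ hδ).1)
  have hu' : u 0 = u₀ := by
    have hvec : ∀ χ : T3 → ℝ, Continuous χ →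
        ∫ x, (χ x * ρ₀ x) • u 0 x = ∫ x, (χ x * ρ₀ x) • u₀ x := by
      intro χ hχ
      have e := eq_of_tendsto_measure_lt (E := V3) (F := fun N z => empiricalMomentumField z χ) hP
        (fun δ hδ => (ht χ hχ δ hδ).2.1) (fun δ hδ => (hlln χ hχ δ hδ).2.1)
      rw [hρ] at e
      exact e
    have hcoord : ∀ i : Fin 3, (fun x => ρ₀ x * u 0 x i) = fun x => ρ₀ x * u₀ x i := by
      intro i
      refine eq_of_forall_integral_mul_eq
        (hρ₀c.mul ((EuclideanSpace.proj i : V3 →L[ℝ] ℝ).continuous.comp huc))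
        (hρ₀c.mul ((EuclideanSpace.proj i : V3 →L[ℝ] ℝ).continuous.comp hu)) fun χ hχ => ?_
      have e := congrArg (fun v : V3 => v i) (hvec χ hχ)
      simp only at e
      rw [integral_apply_coord (F := fun x => (χ x * ρ₀ x) • u 0 x)
          (integrable_of_continuous_T3 ((hχ.mul hρ₀c).smul huc)),
        integral_apply_coord (F := fun x => (χ x * ρ₀ x) • u₀ x)
          (integrable_of_continuous_T3 ((hχ.mul hρ₀c).smul hu))] at e
      simp only [PiLp.smul_apply, smul_eq_mul] at e
      simpa only [mul_assoc] using e
    funext x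
    ext i
    have := congrFun (hcoord i) x
    exact mul_left_cancel₀ (hρ₀pos x).ne' this
  have hθ' : θ 0 = θ₀ := by
    have hE : (fun x => totalEnergyDensity (ρ₀ x) (u₀ x) (θ 0 x)) =
        fun x => totalEnergyDensity (ρ₀ x) (u₀ x) (θ₀ x) := by
      refine eq_of_forall_integral_mul_eq ?_ ?_ fun χ hχ => ?_
      · unfold totalEnergyDensity; fun_prop
      · unfold totalEnergyDensity; fun_prop
      · have e := eq_of_tendsto_measure_lt_abs (F := fun N z => empiricalEnergyField z χ) hP
          (fun δ hδ => (ht χ hχ δ hδ).2.2) (fun δ hδ => (hlln χ hχ δ hδ).2.2)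
        rw [hρ, hu'] at e
        exact e
    funext x
    have hx := congrFun hE x
    unfold totalEnergyDensity at hx
    have := mul_left_cancel₀ (hρ₀pos x).ne' hx
    linarith
  exact ⟨hρ, hu', hθ'⟩

/-- **Uniform sup bound**: `|rhoLim P σ x| ≤ 2eM/(1-θ)`, `M = sup β`, `θ = geomRatio P σ`. -/
theorem abs_rhoLim_le {P : DensityProfile} {σ : ℝ} (h : SmallDensity P σ) (x : T3) :
    |rhoLim P σ x| ≤ 2 * Real.exp 1 * P.M / (1 - geomRatio P σ) := by
  have hgeo : HasSum (fun j : ℕ => 2 * Real.exp 1 * P.M * geomRatio P σ ^ j)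
      (2 * Real.exp 1 * P.M / (1 - geomRatio P σ)) := by
    rw [div_eq_mul_inv]
    exact (hasSum_geometric_of_lt_one h.geomRatio_nonneg h.geomRatio_lt_one).mul_left _
  refine (Real.norm_eq_abs _).symm.trans_le ?_
  exact tsum_of_norm_bounded hgeo fun j => (Real.norm_eq_abs _).trans_le (h.abs_rhoLim_term_le j x)

/-- **Uniform sup bound, explicit**: `rhoLim P σ x < (2e + 1) M` for every small `σ` — the pinned initial
density of admissible data is bounded UNIFORMLY IN `σ` by a profile constant. -/
theorem rhoLim_lt {P : DensityProfile} {σ : ℝ} (h : SmallDensity P σ) (x : T3) :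
    rhoLim P σ x < (2 * Real.exp 1 + 1) * P.M := by
  have h1 := abs_rhoLim_le h x
  have hθ1 := h.geomRatio_lt_one
  have hφ := h.phi_lt_half
  have hM := P.M_pos
  have hne : (1 - geomRatio P σ) ≠ 0 := (sub_pos.2 hθ1).ne'
  have hkey : 2 * Real.exp 1 * P.M / (1 - geomRatio P σ) =
      2 * Real.exp 1 * P.M + 2 * P.M * (Real.exp 1 * geomRatio P σ / (1 - geomRatio P σ)) := by
    field_simp
    ring
  have h2 : 2 * Real.exp 1 * P.M / (1 - geomRatio P σ) < (2 * Real.exp 1 + 1) * P.M := by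
    rw [hkey]; nlinarith
  exact (le_abs_self _).trans_lt (h1.trans_lt h2)

/-- **Closeness to `R β`**: `|rhoLim P σ x - R β(x)| ≤ 2eMθ/(1-θ)` (the `j ≥ 1` tail of the series). -/
theorem abs_rhoLim_sub_ratioLimit_mul_le {P : DensityProfile} {σ : ℝ} (h : SmallDensity P σ) (x : T3) :
    |rhoLim P σ x - ratioLimit P σ * P.β x| ≤
      2 * Real.exp 1 * P.M * geomRatio P σ / (1 - geomRatio P σ) := by
  have hθ0 := h.geomRatio_nonneg
  have hsplit := (h.summable_rhoLim x).tsum_eq_zero_add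
  have h0 : clusterCoeff σ 0 * ratioLimit P σ ^ (0 + 1) * P.β x ^ (0 + 1) =
      ratioLimit P σ * P.β x := by
    have : clusterCoeff σ 0 = 1 := by
      have h1 := coefLim_one_zero (P := P) h.σ_pos
      rw [coefLim] at h1
      simpa [P.integral_eq_one] using h1
    rw [this]; ring
  have hgeo : HasSum (fun j : ℕ => 2 * Real.exp 1 * P.M * geomRatio P σ ^ (j + 1))
      (2 * Real.exp 1 * P.M * geomRatio P σ / (1 - geomRatio P σ)) := by
    have h' := (hasSum_geometric_of_lt_one hθ0 h.geomRatio_lt_one).mul_left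
      (2 * Real.exp 1 * P.M * geomRatio P σ)
    rw [div_eq_mul_inv]
    refine h'.congr_fun fun j => ?_
    rw [pow_succ]; ring
  have htail : |∑' j, clusterCoeff σ (j + 1) * ratioLimit P σ ^ (j + 1 + 1) * P.β x ^ (j + 1 + 1)| ≤
      2 * Real.exp 1 * P.M * geomRatio P σ / (1 - geomRatio P σ) := by
    refine (Real.norm_eq_abs _).symm.trans_le (tsum_of_norm_bounded hgeo fun j => ?_)
    exact (Real.norm_eq_abs _).trans_le (h.abs_rhoLim_term_le (j + 1) x)
  have heq : rhoLim P σ x - ratioLimit P σ * P.β x =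
      ∑' j, clusterCoeff σ (j + 1) * ratioLimit P σ ^ (j + 1 + 1) * P.β x ^ (j + 1 + 1) := by
    rw [rhoLim, hsplit, h0]; ring
  rw [heq]
  exact htail

/-- **The limit ratio is `1 + O(σ³)`**: `|R - 1| ≤ 2 · eθ/(1-θ)`. -/
theorem abs_ratioLimit_sub_one_le {P : DensityProfile} {σ : ℝ} (h : SmallDensity P σ) :
    |ratioLimit P σ - 1| ≤ 2 * (Real.exp 1 * geomRatio P σ / (1 - geomRatio P σ)) := by
  have hF := abs_ratioSeries_sub_one_le (P := P) h.σ_pos h.σ_lt_half h.geomRatio_lt_one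
    h.abs_ratioLimit_le
  have hspec := (ratioLimit_spec (P := P) h.σ_pos h.σ_lt_half h.geomRatio_lt_one h.phi_lt_half).2
  have hR0 := h.ratioLimit_pos
  have hR2 := h.ratioLimit_mem.2
  have heq : ratioLimit P σ - 1 = ratioLimit P σ * (1 - ratioSeries P σ (ratioLimit P σ)) := by
    rw [mul_sub, mul_one, hspec]
  rw [heq, abs_mul, abs_of_pos hR0, abs_sub_comm]
  exact mul_le_mul hR2 hF (abs_nonneg _) zero_le_two

/-- **The `O(σ³)` sup-norm statics rate**: `|rhoLim P σ x - β(x)| ≤ 16 e² v₁ M² σ³` for `SmallDensity P σ`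
(the excluded-volume data defect that every perturbative line must carry; the gen-1 bound was
`16A²σ³/(∫a₀)²` in activity units, the same quantity). -/
theorem abs_rhoLim_sub_β_le {P : DensityProfile} {σ : ℝ} (h : SmallDensity P σ) (x : T3) :
    |rhoLim P σ x - P.β x| ≤ 16 * Real.exp 1 ^ 2 * v₁ * P.M ^ 2 * σ ^ 3 := by
  have h1 := abs_rhoLim_sub_ratioLimit_mul_le h x
  have h2 := abs_ratioLimit_sub_one_le h
  have hθ1 := h.geomRatio_lt_one
  have hθ0 := h.geomRatio_nonneg
  have hφ := h.phi_lt_half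
  have hM := P.M_pos
  have hβ0 := (P.pos x).le
  have hβM := P.le_M x
  have he : 0 < Real.exp 1 := Real.exp_pos 1
  have hv := v₁_pos
  have hσ3 : 0 ≤ σ ^ 3 := pow_nonneg h.σ_pos.le 3
  set θ' := geomRatio P σ with hθ'
  set φ := Real.exp 1 * θ' / (1 - θ') with hφdef
  have hφ0 : 0 ≤ φ := div_nonneg (mul_nonneg he.le hθ0) (sub_pos.2 hθ1).le
  have hstep : |rhoLim P σ x - P.β x| ≤ 4 * P.M * φ := by
    have htri : |rhoLim P σ x - P.β x| ≤
        |rhoLim P σ x - ratioLimit P σ * P.β x| + |ratioLimit P σ - 1| * P.β x := by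
      have e : rhoLim P σ x - P.β x =
          (rhoLim P σ x - ratioLimit P σ * P.β x) + (ratioLimit P σ - 1) * P.β x := by ring
      rw [e]
      refine (abs_add_le _ _).trans ?_
      rw [abs_mul, abs_of_nonneg hβ0]
    have hA : |rhoLim P σ x - ratioLimit P σ * P.β x| ≤ 2 * P.M * φ := by
      refine h1.trans (le_of_eq ?_)
      rw [hφdef]; ring
    have hB : |ratioLimit P σ - 1| * P.β x ≤ 2 * φ * P.M :=
      mul_le_mul h2 hβM hβ0 (by positivity)
    linarith
  have h1θ : 1 / 2 < 1 - θ' := by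
    have hθe : θ' ≤ Real.exp 1 * θ' := le_mul_of_one_le_left hθ0 (by
      have := Real.add_one_le_exp (1 : ℝ); linarith)
    have hlt : θ' / (1 - θ') < 1 / 2 :=
      lt_of_le_of_lt (div_le_div_of_nonneg_right hθe (sub_pos.2 hθ1).le) hφ
    rw [div_lt_iff₀ (sub_pos.2 hθ1)] at hlt
    linarith
  have hφle : φ ≤ 2 * Real.exp 1 * θ' := by
    rw [hφdef, div_le_iff₀ (sub_pos.2 hθ1)]
    have hmul : Real.exp 1 * θ' * (1 / 2) ≤ Real.exp 1 * θ' * (1 - θ') :=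
      mul_le_mul_of_nonneg_left h1θ.le (mul_nonneg he.le hθ0)
    linarith
  have hθeq : θ' = 2 * Real.exp 1 * (P.M * v₁ * σ ^ 3) := by
    rw [hθ', geomRatio, ovDensity]
  calc |rhoLim P σ x - P.β x| ≤ 4 * P.M * φ := hstep
    _ ≤ 4 * P.M * (2 * Real.exp 1 * θ') := by gcongr
    _ = 16 * Real.exp 1 ^ 2 * v₁ * P.M ^ 2 * σ ^ 3 := by rw [hθeq]; ring

/-- **Mass normalisation**: `∫ rhoLim P σ = 1` (in the series, `I(1) = R F(R) = 1`). -/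
theorem integral_rhoLim_eq_one {P : DensityProfile} {σ : ℝ} (h : SmallDensity P σ) :
    ∫ y, rhoLim P σ y = 1 := by
  have h1 := h.Ilim_eq_integral (χ := fun _ => (1 : ℝ)) continuous_const
  simp only [one_mul] at h1
  rw [← h1, Ilim]
  have hR := (ratioLimit_spec (P := P) h.σ_pos h.σ_lt_half h.geomRatio_lt_one h.phi_lt_half).2
  rw [ratioSeries] at hR
  have e : ∑' j, coefLim P σ (fun _ => 1) j * ratioLimit P σ ^ (j + 1) =
      ratioLimit P σ * ∑' j, coefLim P σ (fun _ => 1) j * ratioLimit P σ ^ j := by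
    rw [← tsum_mul_left]
    exact tsum_congr fun j => by ring
  rw [e, hR]

/-- **ADMISSIBILITY = PINNED DATA.** For continuous profiles `a₀, θ₀ > 0`, `u₀` there is `σ₁ ∈ (0, 1/2]` such
that for `0 < σ < σ₁`: the statics package and the positivity margin (`rhoLim > 0`) hold, and ANY fields with
continuous time-`0` slices `(ρ, u, θ)` are admissible iff `ρ 0 = rhoLim (profileOf a₀) σ`, `u 0 = u₀`, `θ 0 = θ₀`. -/
theorem admissible_iff_data {a₀ θ₀ : T3 → ℝ} {u₀ : T3 → V3} (ha : Continuous a₀) (hθ : Continuous θ₀)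
    (hu : Continuous u₀) (ha0 : ∀ x, 0 < a₀ x) (hθ0 : ∀ x, 0 < θ₀ x) :
    ∃ σ₁ : ℝ, 0 < σ₁ ∧ σ₁ ≤ 1 / 2 ∧ ∀ σ : ℝ, 0 < σ → σ < σ₁ →
      SmallDensity (profileOf a₀ ha ha0) σ ∧
      (∀ x, 4 * Real.exp 1 * (profileOf a₀ ha ha0).M * geomRatio (profileOf a₀ ha ha0) σ /
          (1 - geomRatio (profileOf a₀ ha ha0) σ) < (profileOf a₀ ha ha0).β x) ∧
      ∀ (ρ θ : ℝ → T3 → ℝ) (u : ℝ → T3 → V3), Continuous (ρ 0) → Continuous (u 0) →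
        Continuous (θ 0) →
        (Admissible σ a₀ u₀ θ₀ ρ u θ ↔
          ρ 0 = rhoLim (profileOf a₀ ha ha0) σ ∧ u 0 = u₀ ∧ θ 0 = θ₀) := by
  obtain ⟨σ₁, hσ₁, hσ₁2, H⟩ := lln_rhoLim ha hθ hu ha0 hθ0
  refine ⟨σ₁, hσ₁, hσ₁2, fun σ hσ hσlt => ?_⟩
  obtain ⟨h, hpos, Hσ⟩ := H σ hσ hσlt
  have hσ2 : σ < 1 / 2 := hσlt.trans_le hσ₁2
  refine ⟨h, hpos, fun ρ θ u hρc huc hθc => ⟨fun hA => ?_, fun hD => ?_⟩⟩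
  · obtain ⟨Φ⟩ := flows_nonempty hσ hσ2
    have hlln : Tied σ a₀ u₀ θ₀ (fun _ => rhoLim (profileOf a₀ ha ha0) σ) (fun _ => u₀)
        (fun _ => θ₀) := (tiedThrough_iff_tied Φ).1 (Hσ Φ).2
    exact data_eq_of_tied ha hθ hu ha0 hθ0 hσ2.le h.continuous_rhoLim
      (fun x => h.rhoLim_pos (hpos x)) hlln hρc huc hθc ((tiedThrough_iff_tied Φ).1 (hA Φ))
  · obtain ⟨hρ, hu', hθ'⟩ := hD
    exact (admissible_congr_zero (ρ' := fun _ => rhoLim (profileOf a₀ ha ha0) σ)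
      (u' := fun _ => u₀) (θ' := fun _ => θ₀) hρ hu' hθ').2 fun Φ => (Hσ Φ).2

/-- Time-`0` slices of a classical solution on `[0, T)` with `0 < T` are continuous. -/
theorem continuous_slices_zero {σ T : ℝ} {ρ θ : ℝ → T3 → ℝ} {u : ℝ → T3 → V3}
    (hE : IsHardSphereEulerSolution σ T ρ u θ) (hT : 0 < T) :
    Continuous (ρ 0) ∧ Continuous (u 0) ∧ Continuous (θ 0) :=
  have h0 : (0 : ℝ) ∈ Ico 0 T := ⟨le_rfl, hT⟩
  ⟨(hE.smooth_density.isSmooth_slice h0).continuous, (hE.smooth_velocity.isSmooth_slice h0).continuous,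
    (hE.smooth_temperature.isSmooth_slice h0).continuous⟩

/-! ## §3 THE CRUX WITHOUT PARTICLES: an equivalent deterministic PDE statement -/

/-- **`ReachesPacking η`, de-probabilised.** No flows, no measures, no LLN: along some sequence `σ → 0`, the
classical hard-sphere-Euler solution (pressure `p = ρθ Z(ρσ³)`) with the PINNED data `(rhoLim (profileOf a₀) σ, u₀, θ₀)`
reaches packing `η` on its interval of classical existence. -/
def ReachesPackingPDE (η : ℝ) : Prop :=
  ∃ (a₀ θ₀ : T3 → ℝ) (u₀ : T3 → V3) (ha : Continuous a₀) (ha0 : ∀ x, 0 < a₀ x),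
    Continuous θ₀ ∧ Continuous u₀ ∧ (∀ x, 0 < θ₀ x) ∧
    ∀ σ₀ : ℝ, 0 < σ₀ → ∃ σ : ℝ, 0 < σ ∧ σ < σ₀ ∧
      ∃ (T : ℝ) (ρ θ : ℝ → T3 → ℝ) (u : ℝ → T3 → V3), IsHardSphereEulerSolution σ T ρ u θ ∧
        ρ 0 = rhoLim (profileOf a₀ ha ha0) σ ∧ u 0 = u₀ ∧ θ 0 = θ₀ ∧
        ∃ t ∈ Ico 0 T, ∃ x, η ≤ ρ t x * σ ^ 3

/-- `DenseExcursion`, de-probabilised: `∃ η > 0, ReachesPackingPDE η`. -/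
def DenseExcursionPDE : Prop :=
  ∃ η : ℝ, 0 < η ∧ ReachesPackingPDE η

/-- **`ReachesPacking η ↔ ReachesPackingPDE η`** (both directions shrink `σ₀` below the statics threshold
`σ₁(a₀, θ₀, u₀)` of `admissible_iff_data`; `T > 0` because `∃ t ∈ Ico 0 T`). -/
theorem reachesPacking_iff_pde (η : ℝ) : ReachesPacking η ↔ ReachesPackingPDE η := by
  constructor
  · rintro ⟨a₀, θ₀, u₀, ha, hθ, hu, ha0, hθ0, H⟩
    obtain ⟨σ₁, hσ₁, -, G⟩ := admissible_iff_data ha hθ hu ha0 hθ0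
    refine ⟨a₀, θ₀, u₀, ha, ha0, hθ, hu, hθ0, fun σ₀ hσ₀ => ?_⟩
    obtain ⟨σ, hσ, hσlt, T, ρ, θ, u, hE, hA, t, ht, x, hx⟩ := H (min σ₀ σ₁) (lt_min hσ₀ hσ₁)
    have hT : 0 < T := ht.1.trans_lt ht.2
    obtain ⟨hρc, huc, hθc⟩ := continuous_slices_zero hE hT
    obtain ⟨-, -, G'⟩ := G σ hσ (lt_of_lt_of_le hσlt (min_le_right _ _))
    obtain ⟨h1, h2, h3⟩ := (G' ρ θ u hρc huc hθc).1 hA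
    exact ⟨σ, hσ, lt_of_lt_of_le hσlt (min_le_left _ _), T, ρ, θ, u, hE, h1, h2, h3, t, ht, x, hx⟩
  · rintro ⟨a₀, θ₀, u₀, ha, ha0, hθ, hu, hθ0, H⟩
    obtain ⟨σ₁, hσ₁, -, G⟩ := admissible_iff_data ha hθ hu ha0 hθ0
    refine ⟨a₀, θ₀, u₀, ha, hθ, hu, ha0, hθ0, fun σ₀ hσ₀ => ?_⟩
    obtain ⟨σ, hσ, hσlt, T, ρ, θ, u, hE, h1, h2, h3, t, ht, x, hx⟩ := H (min σ₀ σ₁) (lt_min hσ₀ hσ₁)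
    have hT : 0 < T := ht.1.trans_lt ht.2
    obtain ⟨hρc, huc, hθc⟩ := continuous_slices_zero hE hT
    obtain ⟨-, -, G'⟩ := G σ hσ (lt_of_lt_of_le hσlt (min_le_right _ _))
    exact ⟨σ, hσ, lt_of_lt_of_le hσlt (min_le_left _ _), T, ρ, θ, u, hE,
      (G' ρ θ u hρc huc hθc).2 ⟨h1, h2, h3⟩, t, ht, x, hx⟩

/-- **THE CRUX IS A PURE PDE STATEMENT**: `DenseExcursion ↔ DenseExcursionPDE`. A proof of the crux is a statement
about ONE explicit one-parameter data family; a disproof is a σ-uniform packing bound `ρσ³ < η` for all of them. -/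
theorem denseExcursion_iff_pde : DenseExcursion ↔ DenseExcursionPDE :=
  exists_congr fun η => and_congr_right fun _ => reachesPacking_iff_pde η


/-! ## §4 THE DICHOTOMY with the rank-3 crux, and the `η`-germ -/

/-- `DenseExcursion → ¬ DiluteSelfConsistency`: a DE witness at the DSC threshold `σ₀` (shrunk below `1/2` so
that a flow family exists to instantiate DSC's `∀ Φ`, Alexander) reaches packing `η`, which DSC forbids. This is the
route's KILL template `NegGlue3091`, unconditional. -/
theorem not_diluteSelfConsistency_of_denseExcursion (h : DenseExcursion) : ¬ DiluteSelfConsistency := by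
  intro hD
  obtain ⟨η, hη, a₀, θ₀, u₀, ha, hθ, hu, ha0, hθ0, H⟩ := h
  obtain ⟨σ₀, hσ₀, D⟩ := hD η hη a₀ θ₀ u₀ ha hθ hu ha0 hθ0
  obtain ⟨σ, hσ, hσlt, T, ρ, θ, u, hE, hA, t, ht, x, hx⟩ := H (min σ₀ (1 / 2)) (lt_min hσ₀ (by norm_num))
  obtain ⟨Φ⟩ := flows_nonempty hσ (lt_of_lt_of_le hσlt (min_le_right _ _))
  exact absurd (D σ hσ (lt_of_lt_of_le hσlt (min_le_left _ _)) T ρ θ u hE Φ (hA Φ) t ht x) (not_lt.2 hx)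

/-- `¬ DiluteSelfConsistency → DenseExcursion`: pushing the negation through DSC yields profiles, a sequence
`σ → 0`, classical solutions tied through ONE flow family and a point of packing `≥ η`; the tie through one family
is admissibility (`admissible_of_tiedThrough`, flow-independence of the `t = 0` tie). -/
theorem denseExcursion_of_not_diluteSelfConsistency (h : ¬ DiluteSelfConsistency) : DenseExcursion := by
  unfold DiluteSelfConsistency at h
  push Not at h
  obtain ⟨η, hη, a₀, θ₀, u₀, ha, hθ, hu, ha0, hθ0, H⟩ := h
  refine ⟨η, hη, a₀, θ₀, u₀, ha, hθ, hu, ha0, hθ0, fun σ₀ hσ₀ => ?_⟩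
  obtain ⟨σ, hσ, hσlt, T, ρ, θ, u, hE, Φ, hΦ, t, ht, x, hx⟩ := H σ₀ hσ₀
  exact ⟨σ, hσ, hσlt, T, ρ, θ, u, hE, admissible_of_tiedThrough Φ hΦ, t, ht, x, hx⟩

/-- **THE DICHOTOMY.** `DenseExcursion ↔ ¬ DiluteSelfConsistency`: the rank-2 and rank-3 cruxes of the route are
ONE decision problem (exactly one of them is a theorem). A disproof of this crux IS a proof of stmt-3091, the
"hidden PDE crux shared by 13 routes" — a σ-uniform packing bound at the first singularity of 3-D compressible
Euler for every continuous positive profile. (Re-derivation of rattack-12586-0's `Glue.lean`.) -/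
theorem denseExcursion_iff_not_diluteSelfConsistency : DenseExcursion ↔ ¬ DiluteSelfConsistency :=
  ⟨not_diluteSelfConsistency_of_denseExcursion, fun h => denseExcursion_of_not_diluteSelfConsistency h⟩

/-- Contrapositive bookkeeping: `¬ DenseExcursion ↔ DiluteSelfConsistency`. -/
theorem not_denseExcursion_iff : ¬ DenseExcursion ↔ DiluteSelfConsistency := by
  rw [denseExcursion_iff_not_diluteSelfConsistency, not_not]

/-- `ReachesPacking` is ANTITONE in the level: reaching `η` reaches every `η' ≤ η`. -/
theorem ReachesPacking.anti {η η' : ℝ} (hle : η' ≤ η) (h : ReachesPacking η) : ReachesPacking η' := by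
  obtain ⟨a₀, θ₀, u₀, ha, hθ, hu, ha0, hθ0, H⟩ := h
  refine ⟨a₀, θ₀, u₀, ha, hθ, hu, ha0, hθ0, fun σ₀ hσ₀ => ?_⟩
  obtain ⟨σ, hσ, hσlt, T, ρ, θ, u, hE, hA, t, ht, x, hx⟩ := H σ₀ hσ₀
  exact ⟨σ, hσ, hσlt, T, ρ, θ, u, hE, hA, t, ht, x, hle.trans hx⟩

/-- **DE is its own `η → 0⁺` germ**: `DenseExcursion ↔ ∃ η₀ > 0, ∀ η ∈ (0, η₀], ReachesPacking η`. Only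
arbitrarily SMALL positive packings matter (in particular `η` may be taken inside the analyticity range of the
virial series, and below any nonlinear-stability radius a line needs). -/
theorem denseExcursion_iff_germ :
    DenseExcursion ↔ ∃ η₀ : ℝ, 0 < η₀ ∧ ∀ η ∈ Ioc 0 η₀, ReachesPacking η := by
  constructor
  · rintro ⟨η₀, hη₀, h⟩
    exact ⟨η₀, hη₀, fun η hη => ReachesPacking.anti hη.2 h⟩
  · rintro ⟨η₀, hη₀, h⟩
    exact ⟨η₀, hη₀, h η₀ ⟨hη₀, le_rfl⟩⟩

/-! ## §5 LADDER: the crux implies the rank-4 crux `PolynomialCompression` -/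

/-- **`DenseExcursion → PolynomialCompression`** (with `κ = 2`; any `κ < 3` works the same way): packing `η` at
`σ ≤ η` means density `≥ η σ⁻³ ≥ σ⁻²`. So the filed rank-4 crux is WEAKER than this one; a refutation of
`PolynomialCompression` would refute `DenseExcursion` (and prove `DiluteSelfConsistency`). -/
theorem polynomialCompression_of_denseExcursion (h : DenseExcursion) : PolynomialCompression := by
  obtain ⟨η, hη, a₀, θ₀, u₀, ha, hθ, hu, ha0, hθ0, H⟩ := h
  refine ⟨2, two_pos, a₀, θ₀, u₀, ha, hθ, hu, ha0, hθ0, fun σ₀ hσ₀ => ?_⟩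
  obtain ⟨σ, hσ, hσlt, T, ρ, θ, u, hE, hA, t, ht, x, hx⟩ := H (min σ₀ η) (lt_min hσ₀ hη)
  refine ⟨σ, hσ, lt_of_lt_of_le hσlt (min_le_left _ _), T, ρ, θ, u, hE, hA, t, ht, x, ?_⟩
  have hση : σ ≤ η := (lt_of_lt_of_le hσlt (min_le_right _ _)).le
  have hσ3 : 0 < σ ^ 3 := pow_pos hσ 3
  have hrpow : σ ^ (-(2 : ℝ)) = (σ ^ 2)⁻¹ := by
    rw [Real.rpow_neg hσ.le, Real.rpow_two]
  rw [hrpow, inv_le_iff_one_le_mul₀ (pow_pos hσ 2)]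
  -- `1 ≤ σ² ρ`: from `η ≤ ρ σ³` and `σ ≤ η`, `σ · 1 ≤ σ · (σ² ρ)`.
  have h1 : σ * 1 ≤ σ * (ρ t x * σ ^ 2) := by nlinarith
  exact le_of_mul_le_mul_left h1 hσ

/-! ## §6 LOAD-BEARING MAP: which constraints a disproof must use

For an `∃`-crux the informative mutation is: delete a CONSTRAINT on the witness and show the statement becomes
PROVABLE — then every disproof must exploit that constraint. Three deletions are decisive and cheap. -/

/-- The crux with the ADMISSIBILITY TIE deleted (everything else verbatim). -/
def DenseExcursionUntied : Prop :=
  ∃ η : ℝ, 0 < η ∧ ∃ (a₀ θ₀ : T3 → ℝ) (u₀ : T3 → V3), Continuous a₀ ∧ Continuous θ₀ ∧ Continuous u₀ ∧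
    (∀ x, 0 < a₀ x) ∧ (∀ x, 0 < θ₀ x) ∧ ∀ σ₀ : ℝ, 0 < σ₀ → ∃ σ : ℝ, 0 < σ ∧ σ < σ₀ ∧
      ∃ (T : ℝ) (ρ θ : ℝ → T3 → ℝ) (u : ℝ → T3 → V3), IsHardSphereEulerSolution σ T ρ u θ ∧
        ∃ t ∈ Ico 0 T, ∃ x, η ≤ ρ t x * σ ^ 3

/-- Constant states are classical hard-sphere-Euler solutions for EVERY `σ` and every density level (all
derivatives vanish, whatever the regularity of the equation of state). -/
theorem isHardSphereEulerSolution_const (σ T : ℝ) {ρ₀ θ₀ : ℝ} (u₀ : V3) (hρ : 0 < ρ₀) (hθ : 0 < θ₀) :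
    IsHardSphereEulerSolution σ T (fun _ _ => ρ₀) (fun _ _ => u₀) (fun _ _ => θ₀) :=
  isHardSphereEulerSolutionDim_three_iff.1 (IsHardSphereEulerSolutionDim.const σ T u₀ hρ hθ)

/-- **THE TIE IS LOAD-BEARING**: without admissibility the crux is TRUE — the constant state of density `σ⁻³`
has packing `1` at every `σ`. So any disproof works through the pinned data `(rhoLim, u₀, θ₀)` of §2. -/
theorem denseExcursionUntied_holds : DenseExcursionUntied := by
  refine ⟨1, one_pos, fun _ => 1, fun _ => 1, fun _ => 0, continuous_const, continuous_const,
    continuous_const, fun _ => one_pos, fun _ => one_pos, fun σ₀ hσ₀ => ?_⟩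
  have hσ : 0 < σ₀ / 2 := by positivity
  refine ⟨σ₀ / 2, hσ, by linarith, 1, fun _ _ => ((σ₀ / 2) ^ 3)⁻¹, fun _ _ => 1, fun _ _ => 0,
    isHardSphereEulerSolution_const _ 1 0 (inv_pos.2 (pow_pos hσ 3)) one_pos, 0,
    ⟨le_rfl, one_pos⟩, 0, ?_⟩
  rw [inv_mul_cancel₀ (pow_pos hσ 3).ne']

/-- The crux with the THREE BALANCE LAWS deleted: the tie, joint smoothness and positivity are kept. -/
def DenseExcursionNoPDE : Prop :=
  ∃ η : ℝ, 0 < η ∧ ∃ (a₀ θ₀ : T3 → ℝ) (u₀ : T3 → V3), Continuous a₀ ∧ Continuous θ₀ ∧ Continuous u₀ ∧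
    (∀ x, 0 < a₀ x) ∧ (∀ x, 0 < θ₀ x) ∧ ∀ σ₀ : ℝ, 0 < σ₀ → ∃ σ : ℝ, 0 < σ ∧ σ < σ₀ ∧
      ∃ (T : ℝ) (ρ θ : ℝ → T3 → ℝ) (u : ℝ → T3 → V3),
        (Torus.IsSmoothSpaceTimeOn (Ico 0 T) ρ ∧ Torus.IsSmoothSpaceTimeOn (Ico 0 T) u ∧
          Torus.IsSmoothSpaceTimeOn (Ico 0 T) θ ∧ (∀ t ∈ Ico 0 T, ∀ x, 0 < ρ t x) ∧
          (∀ t ∈ Ico 0 T, ∀ x, 0 < θ t x)) ∧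
        Admissible σ a₀ u₀ θ₀ ρ u θ ∧ ∃ t ∈ Ico 0 T, ∃ x, η ≤ ρ t x * σ ^ 3

/-- For the UNIFORM activity `a₀ ≡ 1` the pinned density `rhoLim` is a constant function (`β ≡ 1`). -/
theorem rhoLim_uniform_const (σ : ℝ) (x y : T3) :
    rhoLim (profileOf (fun _ : T3 => (1 : ℝ)) continuous_const (fun _ => one_pos)) σ x =
      rhoLim (profileOf (fun _ : T3 => (1 : ℝ)) continuous_const (fun _ => one_pos)) σ y := by
  simp only [rhoLim, profileOf_β]

/-- **THE BALANCE LAWS ARE LOAD-BEARING**: with the tie, smoothness and positivity kept but the Euler equations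
deleted, the crux is TRUE — `ρ(t,x) = rhoLim(x) e^{Lt}` with `a₀ ≡ 1` (so `rhoLim` is constant), `u = 0`, `θ = 1`,
`L = (rhoLim σ³)⁻¹`, reaches packing `≥ 1` at `t = 1`. So a disproof is an a-priori estimate drawn from the balance
laws (mass is the only EOS-free one, §7), not from admissibility alone. -/
theorem denseExcursionNoPDE_holds : DenseExcursionNoPDE := by
  refine ⟨1, one_pos, fun _ => 1, fun _ => 1, fun _ => 0, continuous_const, continuous_const,
    continuous_const, fun _ => one_pos, fun _ => one_pos, fun σ₀ hσ₀ => ?_⟩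
  obtain ⟨σ₁, hσ₁, -, G⟩ := admissible_iff_data (a₀ := fun _ : T3 => (1 : ℝ)) (θ₀ := fun _ => (1 : ℝ))
    (u₀ := fun _ => (0 : V3)) continuous_const continuous_const continuous_const (fun _ => one_pos)
    (fun _ => one_pos)
  set P := profileOf (fun _ : T3 => (1 : ℝ)) continuous_const (fun _ => one_pos) with hP
  set σ := min σ₀ σ₁ / 2 with hσdef
  have hσ : 0 < σ := by positivity
  have hσlt0 : σ < σ₀ := by
    have := min_le_left σ₀ σ₁; rw [hσdef]; linarith
  have hσlt1 : σ < σ₁ := by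
    have := min_le_right σ₀ σ₁; rw [hσdef]; linarith
  obtain ⟨hS, hpos, G'⟩ := G σ hσ hσlt1
  -- the pinned density is the constant `r₀ > 0`
  set r₀ := rhoLim P σ 0 with hr₀
  have hconst : rhoLim P σ = fun _ => r₀ := funext fun x => rhoLim_uniform_const σ x 0
  have hr₀pos : 0 < r₀ := hS.rhoLim_pos (hpos 0)
  -- the witness
  set L := (r₀ * σ ^ 3)⁻¹ with hL
  have hL0 : 0 < L := inv_pos.2 (mul_pos hr₀pos (pow_pos hσ 3))
  refine ⟨σ, hσ, hσlt0, 2, fun t _ => r₀ * Real.exp (L * t), fun _ _ => 1, fun _ _ => 0,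
    ⟨?_, ?_, ?_, fun t _ x => mul_pos hr₀pos (Real.exp_pos _), fun _ _ _ => one_pos⟩, ?_,
    1, ⟨zero_le_one, one_lt_two⟩, 0, ?_⟩
  · -- joint smoothness of `(t, x) ↦ r₀ e^{Lt}`
    refine Torus.isSmoothSpaceTimeOn_of_contDiff ?_ _
    change ContDiff ℝ _ (fun p : ℝ × EuclideanSpace ℝ (Fin 3) => r₀ * Real.exp (L * p.1))
    fun_prop
  · exact Torus.isSmoothSpaceTimeOn_const (Torus.isSmooth_const _) _
  · exact Torus.isSmoothSpaceTimeOn_const (Torus.isSmooth_const _) _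
  · -- admissibility: the time-0 slice is `rhoLim`, `u₀ = 0`, `θ₀ = 1`
    refine (G' (fun t _ => r₀ * Real.exp (L * t)) (fun _ _ => 1) (fun _ _ => 0) continuous_const
      continuous_const continuous_const).2 ⟨?_, rfl, rfl⟩
    rw [hconst]; funext x; simp
  · -- packing at `t = 1`: `r₀ e^{L} σ³ ≥ r₀ (1 + L) σ³ ≥ r₀ L σ³ = 1`
    have hexp : L + 1 ≤ Real.exp L := Real.add_one_le_exp L
    have hkey : r₀ * σ ^ 3 * L = 1 := by rw [hL]; exact mul_inv_cancel₀ (mul_pos hr₀pos (pow_pos hσ 3)).ne'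
    have hσ3 := pow_pos hσ 3
    calc (1 : ℝ) = r₀ * σ ^ 3 * L := hkey.symm
      _ ≤ r₀ * σ ^ 3 * Real.exp L := by gcongr; linarith
      _ = r₀ * Real.exp (L * 1) * σ ^ 3 := by rw [mul_one]; ring

/-- The crux with `a₀ > 0` WEAKENED to `a₀ ≥ 0` (everything else verbatim). -/
def DenseExcursionNonnegActivity : Prop :=
  ∃ η : ℝ, 0 < η ∧ ∃ (a₀ θ₀ : T3 → ℝ) (u₀ : T3 → V3), Continuous a₀ ∧ Continuous θ₀ ∧ Continuous u₀ ∧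
    (∀ x, 0 ≤ a₀ x) ∧ (∀ x, 0 < θ₀ x) ∧ ∀ σ₀ : ℝ, 0 < σ₀ → ∃ σ : ℝ, 0 < σ ∧ σ < σ₀ ∧
      ∃ (T : ℝ) (ρ θ : ℝ → T3 → ℝ) (u : ℝ → T3 → V3), IsHardSphereEulerSolution σ T ρ u θ ∧
        Admissible σ a₀ u₀ θ₀ ρ u θ ∧ ∃ t ∈ Ico 0 T, ∃ x, η ≤ ρ t x * σ ^ 3

/-- The crux with `θ₀ > 0` WEAKENED to `θ₀ ≥ 0` (everything else verbatim). -/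
def DenseExcursionNonnegTemperature : Prop :=
  ∃ η : ℝ, 0 < η ∧ ∃ (a₀ θ₀ : T3 → ℝ) (u₀ : T3 → V3), Continuous a₀ ∧ Continuous θ₀ ∧ Continuous u₀ ∧
    (∀ x, 0 < a₀ x) ∧ (∀ x, 0 ≤ θ₀ x) ∧ ∀ σ₀ : ℝ, 0 < σ₀ → ∃ σ : ℝ, 0 < σ ∧ σ < σ₀ ∧
      ∃ (T : ℝ) (ρ θ : ℝ → T3 → ℝ) (u : ℝ → T3 → V3), IsHardSphereEulerSolution σ T ρ u θ ∧
        Admissible σ a₀ u₀ θ₀ ρ u θ ∧ ∃ t ∈ Ico 0 T, ∃ x, η ≤ ρ t x * σ ^ 3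

/-- If the one-particle profile vanishes identically, the local Gibbs law is the ZERO measure (canonical density
`0⁻¹ · 0 = 0`), for every `σ`, `N` and flow. -/
theorem localGibbsLaw_eq_zero_of_profile {σ : ℝ} {a₀ θ₀ : T3 → ℝ} {u₀ : T3 → V3}
    (h : ∀ y, localGibbsProfile a₀ u₀ θ₀ y = 0) (N : ℕ)
    (Φ : HardSphereFlow (Torus.geometry (Fin 3)) (hsDiameter σ N) (N + 1)) :
    localGibbsLaw σ a₀ u₀ θ₀ N Φ = 0 := by
  have hprof : localGibbsProfile a₀ u₀ θ₀ = 0 := funext h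
  rw [localGibbsLaw, particleLaw_eq, hprof]
  have hdens : (fun z : Config (N + 1) (Fin 3) T3 => ENNReal.ofReal
      (canonicalDensity (Torus.geometry (Fin 3)) (hsDiameter σ N) (N + 1) 0 z)) = 0 := by
    funext z
    simp [canonicalDensity, tensorPow, Set.indicator]
  rw [hdens]
  exact withDensity_zero

/-- A vanishing profile makes EVERY field family admissible (all deviation probabilities are `0`). -/
theorem admissible_of_profile_zero {σ : ℝ} {a₀ θ₀ : T3 → ℝ} {u₀ : T3 → V3}
    (h : ∀ y, localGibbsProfile a₀ u₀ θ₀ y = 0) (ρ θ : ℝ → T3 → ℝ) (u : ℝ → T3 → V3) :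
    Admissible σ a₀ u₀ θ₀ ρ u θ := by
  intro Φ χ _ δ _
  have h0 : ∀ (N : ℕ) (A : Set (Config (N + 1) (Fin 3) T3)), localGibbsLaw σ a₀ u₀ θ₀ N (Φ N) A = 0 :=
    fun N A => by rw [localGibbsLaw_eq_zero_of_profile h N (Φ N)]; rfl
  simp only [h0]
  exact ⟨tendsto_const_nhds, tendsto_const_nhds, tendsto_const_nhds⟩

/-- **`a₀ > 0` IS LOAD-BEARING**: with `a₀ ≡ 0` allowed the local Gibbs laws vanish, the tie is vacuous and the
constant state of density `σ⁻³` is an admissible witness. -/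
theorem denseExcursionNonnegActivity_holds : DenseExcursionNonnegActivity := by
  refine ⟨1, one_pos, fun _ => 0, fun _ => 1, fun _ => 0, continuous_const, continuous_const,
    continuous_const, fun _ => le_rfl, fun _ => one_pos, fun σ₀ hσ₀ => ?_⟩
  have hσ : 0 < σ₀ / 2 := by positivity
  have hprof : ∀ y, localGibbsProfile (fun _ : T3 => (0 : ℝ)) (fun _ => (0 : V3)) (fun _ => 1) y = 0 :=
    fun y => by simp [localGibbsProfile]
  refine ⟨σ₀ / 2, hσ, by linarith, 1, fun _ _ => ((σ₀ / 2) ^ 3)⁻¹, fun _ _ => 1, fun _ _ => 0,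
    isHardSphereEulerSolution_const _ 1 0 (inv_pos.2 (pow_pos hσ 3)) one_pos,
    admissible_of_profile_zero hprof _ _ _, 0, ⟨le_rfl, one_pos⟩, 0, ?_⟩
  rw [inv_mul_cancel₀ (pow_pos hσ 3).ne']

/-- **`θ₀ > 0` IS LOAD-BEARING**: at `θ₀ ≡ 0` the local Maxwellian is the junk value `0` (`(2π·0)^(-3/2) = 0`),
the local Gibbs laws vanish and the same constant state is an admissible witness. -/
theorem denseExcursionNonnegTemperature_holds : DenseExcursionNonnegTemperature := by
  refine ⟨1, one_pos, fun _ => 1, fun _ => 0, fun _ => 0, continuous_const, continuous_const,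
    continuous_const, fun _ => one_pos, fun _ => le_rfl, fun σ₀ hσ₀ => ?_⟩
  have hσ : 0 < σ₀ / 2 := by positivity
  have hprof : ∀ y, localGibbsProfile (fun _ : T3 => (1 : ℝ)) (fun _ => (0 : V3)) (fun _ => 0) y = 0 := by
    intro y
    have hfin : (Module.finrank ℝ V3 : ℝ) = 3 := by simp
    simp only [localGibbsProfile, localMaxwellian, hfin, mul_zero, one_mul]
    rw [Real.zero_rpow (by norm_num)]
    simp
  refine ⟨σ₀ / 2, hσ, by linarith, 1, fun _ _ => ((σ₀ / 2) ^ 3)⁻¹, fun _ _ => 1, fun _ _ => 0,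
    isHardSphereEulerSolution_const _ 1 0 (inv_pos.2 (pow_pos hσ 3)) one_pos,
    admissible_of_profile_zero hprof _ _ _, 0, ⟨le_rfl, one_pos⟩, 0, ?_⟩
  rw [inv_mul_cancel₀ (pow_pos hσ 3).ne']

/-! ## §7 STRENGTHENINGS REFUTED UNCONDITIONALLY: no packing at `t = 0`; mass conservation; no bulk packing -/

/-- The crux strengthened to reach packing `η` AT TIME `0`. -/
def DenseExcursionAtTimeZero : Prop :=
  ∃ η : ℝ, 0 < η ∧ ∃ (a₀ θ₀ : T3 → ℝ) (u₀ : T3 → V3), Continuous a₀ ∧ Continuous θ₀ ∧ Continuous u₀ ∧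
    (∀ x, 0 < a₀ x) ∧ (∀ x, 0 < θ₀ x) ∧ ∀ σ₀ : ℝ, 0 < σ₀ → ∃ σ : ℝ, 0 < σ ∧ σ < σ₀ ∧
      ∃ (T : ℝ) (ρ θ : ℝ → T3 → ℝ) (u : ℝ → T3 → V3), IsHardSphereEulerSolution σ T ρ u θ ∧
        Admissible σ a₀ u₀ θ₀ ρ u θ ∧ 0 < T ∧ ∃ x, η ≤ ρ 0 x * σ ^ 3

/-- **NO PACKING AT `t = 0`** (unconditional): admissible data are pinned to `rhoLim < (2e+1)M`, so their packing
is `< (2e+1)M σ³ → 0`. Every witness of the crux must MANUFACTURE the density `η σ⁻³` dynamically. -/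
theorem not_denseExcursionAtTimeZero : ¬ DenseExcursionAtTimeZero := by
  rintro ⟨η, hη, a₀, θ₀, u₀, ha, hθ, hu, ha0, hθ0, H⟩
  obtain ⟨σ₁, hσ₁, -, G⟩ := admissible_iff_data ha hθ hu ha0 hθ0
  set P := profileOf a₀ ha ha0 with hP
  set K := (2 * Real.exp 1 + 1) * P.M with hK
  have hK0 : 0 < K := by have := P.M_pos; positivity
  -- choose `σ₀` with `σ₀ ≤ σ₁`, `σ₀ ≤ 1`, `K σ₀ ≤ η`
  obtain ⟨σ, hσ, hσlt, T, ρ, θ, u, hE, hA, hT, x, hx⟩ :=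
    H (min σ₁ (min 1 (η / K))) (lt_min hσ₁ (lt_min one_pos (div_pos hη hK0)))
  have hσ1 : σ < σ₁ := lt_of_lt_of_le hσlt (min_le_left _ _)
  have hσone : σ < 1 := lt_of_lt_of_le hσlt ((min_le_right _ _).trans (min_le_left _ _))
  have hσK : σ < η / K := lt_of_lt_of_le hσlt ((min_le_right _ _).trans (min_le_right _ _))
  obtain ⟨hS, -, G'⟩ := G σ hσ hσ1
  obtain ⟨hρc, huc, hθc⟩ := continuous_slices_zero hE hT
  obtain ⟨hρ0, -, -⟩ := (G' ρ θ u hρc huc hθc).1 hA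
  have hlt : ρ 0 x < K := by rw [hρ0]; exact rhoLim_lt hS x
  have hσ3 : σ ^ 3 ≤ σ := by
    have : σ ^ 3 = σ * (σ * σ) := by ring
    rw [this]
    refine mul_le_of_le_one_right hσ.le ?_
    nlinarith
  have hρpos : 0 < ρ 0 x := hE.density_pos 0 ⟨le_rfl, hT⟩ x
  have : ρ 0 x * σ ^ 3 < η :=
    calc ρ 0 x * σ ^ 3 ≤ ρ 0 x * σ := by gcongr
      _ < K * (η / K) := mul_lt_mul'' hlt hσK hρpos.le hσ.le
      _ = η := mul_div_cancel₀ η hK0.ne'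
  exact absurd hx (not_le.2 this)

/-- **MASS IS CONSERVED** along every classical hard-sphere-Euler solution, for every `σ` and WITHOUT any
regularity of the equation of state: `∫ ρ(t) = ∫ ρ(0)` for `t ∈ [0,T)` (continuity equation, divergence theorem
on `𝕋³` `Torus.integral_divergence_eq_zero_holds`, differentiation under `∫`, one-sided mean value theorem). The
momentum and energy balances have NO such EOS-free integral form in the tree (their fluxes go through
`hsPressure`, whose regularity on `(0, 512)` is unknown to Lean) — see §8. -/
theorem integral_density_eq {σ T : ℝ} {ρ θ : ℝ → T3 → ℝ} {u : ℝ → T3 → V3}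
    (hE : IsHardSphereEulerSolution σ T ρ u θ) {t : ℝ} (ht : t ∈ Ico 0 T) :
    ∫ x, ρ t x = ∫ x, ρ 0 x := by
  have hderiv : ∀ s ∈ Ico 0 T, HasDerivWithinAt (fun s => ∫ x, ρ s x) 0 (Ico 0 T) s := by
    intro s hs
    have h1 := hE.smooth_density.hasDerivWithinAt_integral (convex_Ico 0 T) hs
    have h2 : ∫ x, Torus.timeDerivWithin (Ico 0 T) ρ s x = 0 := by
      have hpt : (fun x => Torus.timeDerivWithin (Ico 0 T) ρ s x) =
          fun x => -Torus.divergence (fun y => ρ s y • u s y) x := by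
        funext x; have := hE.mass s hs x; linarith
      rw [hpt, integral_neg, neg_eq_zero]
      exact Torus.integral_divergence_eq_zero_holds
        ((hE.smooth_density.smul hE.smooth_velocity).isSmooth_slice hs)
    rwa [h2] at h1
  have hcont : ContinuousOn (fun s => ∫ x, ρ s x) (Icc 0 t) := fun s hs =>
    ((hderiv s ⟨hs.1, hs.2.trans_lt ht.2⟩).continuousWithinAt).mono (Icc_subset_Ico_right ht.2)
  have hright : ∀ s ∈ Ico 0 t, HasDerivWithinAt (fun s => ∫ x, ρ s x) 0 (Ici s) s := by
    intro s hs
    have hsT : s ∈ Ico 0 T := ⟨hs.1, hs.2.trans ht.2⟩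
    refine (hderiv s hsT).mono_of_mem_nhdsWithin ?_
    exact Filter.mem_of_superset (Ico_mem_nhdsGE hsT.2) (Ico_subset_Ico_left hsT.1)
  exact constant_of_has_deriv_right_zero hcont hright t (right_mem_Icc.2 ht.1)

/-- **ADMISSIBLE MASS IS ONE** at every time of classical existence (below the statics threshold `σ₁`). -/
theorem integral_density_eq_one {a₀ θ₀ : T3 → ℝ} {u₀ : T3 → V3} (ha : Continuous a₀) (hθ : Continuous θ₀)
    (hu : Continuous u₀) (ha0 : ∀ x, 0 < a₀ x) (hθ0 : ∀ x, 0 < θ₀ x) :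
    ∃ σ₁ : ℝ, 0 < σ₁ ∧ ∀ σ : ℝ, 0 < σ → σ < σ₁ →
      ∀ (T : ℝ) (ρ θ : ℝ → T3 → ℝ) (u : ℝ → T3 → V3), IsHardSphereEulerSolution σ T ρ u θ →
        Admissible σ a₀ u₀ θ₀ ρ u θ → ∀ t ∈ Ico 0 T, ∫ x, ρ t x = 1 := by
  obtain ⟨σ₁, hσ₁, -, G⟩ := admissible_iff_data ha hθ hu ha0 hθ0
  refine ⟨σ₁, hσ₁, fun σ hσ hσlt T ρ θ u hE hA t ht => ?_⟩
  have hT : 0 < T := ht.1.trans_lt ht.2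
  obtain ⟨hS, -, G'⟩ := G σ hσ hσlt
  obtain ⟨hρc, huc, hθc⟩ := continuous_slices_zero hE hT
  obtain ⟨hρ0, -, -⟩ := (G' ρ θ u hρc huc hθc).1 hA
  rw [integral_density_eq hE ht, hρ0]
  exact integral_rhoLim_eq_one hS

/-- **THE DENSE SET IS SMALL** (tightness information for every line): along an admissible classical solution,
`vol {x | η ≤ ρ_t(x) σ³} ≤ σ³/η` for every `t ∈ [0,T)` (Markov on the conserved unit mass). A dense excursion is a
point-like concentration of volume `O(σ³)`; nothing macroscopic reaches packing `η`. -/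
theorem volume_denseSet_le {a₀ θ₀ : T3 → ℝ} {u₀ : T3 → V3} (ha : Continuous a₀) (hθ : Continuous θ₀)
    (hu : Continuous u₀) (ha0 : ∀ x, 0 < a₀ x) (hθ0 : ∀ x, 0 < θ₀ x) :
    ∃ σ₁ : ℝ, 0 < σ₁ ∧ ∀ σ : ℝ, 0 < σ → σ < σ₁ →
      ∀ (T : ℝ) (ρ θ : ℝ → T3 → ℝ) (u : ℝ → T3 → V3), IsHardSphereEulerSolution σ T ρ u θ →
        Admissible σ a₀ u₀ θ₀ ρ u θ → ∀ t ∈ Ico 0 T, ∀ η : ℝ, 0 < η →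
          volume.real {x | η ≤ ρ t x * σ ^ 3} ≤ σ ^ 3 / η := by
  obtain ⟨σ₁, hσ₁, G⟩ := integral_density_eq_one ha hθ hu ha0 hθ0
  refine ⟨σ₁, hσ₁, fun σ hσ hσlt T ρ θ u hE hA t ht η hη => ?_⟩
  have hmass := G σ hσ hσlt T ρ θ u hE hA t ht
  have hσ3 : 0 < σ ^ 3 := pow_pos hσ 3
  have hset : {x | η ≤ ρ t x * σ ^ 3} = {x | η / σ ^ 3 ≤ ρ t x} := by
    ext x; simp only [Set.mem_setOf_eq]; rw [div_le_iff₀ hσ3]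
  have hint : Integrable (ρ t) volume :=
    integrable_of_continuous_T3 (hE.smooth_density.isSmooth_slice ht).continuous
  have hnn : 0 ≤ᵐ[volume] ρ t := Eventually.of_forall fun x => (hE.density_pos t ht x).le
  have hM := mul_meas_ge_le_integral_of_nonneg hnn hint (η / σ ^ 3)
  rw [hmass] at hM
  rw [hset, le_div_iff₀ hη]
  have e : volume.real {x | η / σ ^ 3 ≤ ρ t x} * η = (η / σ ^ 3 * volume.real {x | η / σ ^ 3 ≤ ρ t x}) * σ ^ 3 := by
    field_simp
  rw [e]
  calc η / σ ^ 3 * volume.real {x | η / σ ^ 3 ≤ ρ t x} * σ ^ 3 ≤ 1 * σ ^ 3 := by gcongr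
    _ = σ ^ 3 := one_mul _

/-- The crux strengthened to reach packing `η` EVERYWHERE at some time. -/
def DenseExcursionEverywhere : Prop :=
  ∃ η : ℝ, 0 < η ∧ ∃ (a₀ θ₀ : T3 → ℝ) (u₀ : T3 → V3), Continuous a₀ ∧ Continuous θ₀ ∧ Continuous u₀ ∧
    (∀ x, 0 < a₀ x) ∧ (∀ x, 0 < θ₀ x) ∧ ∀ σ₀ : ℝ, 0 < σ₀ → ∃ σ : ℝ, 0 < σ ∧ σ < σ₀ ∧
      ∃ (T : ℝ) (ρ θ : ℝ → T3 → ℝ) (u : ℝ → T3 → V3), IsHardSphereEulerSolution σ T ρ u θ ∧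
        Admissible σ a₀ u₀ θ₀ ρ u θ ∧ ∃ t ∈ Ico 0 T, ∀ x, η ≤ ρ t x * σ ^ 3

/-- **NO BULK PACKING** (unconditional): packing `η` everywhere at some time would give mass `≥ η σ⁻³ > 1`,
against the conserved unit mass. -/
theorem not_denseExcursionEverywhere : ¬ DenseExcursionEverywhere := by
  rintro ⟨η, hη, a₀, θ₀, u₀, ha, hθ, hu, ha0, hθ0, H⟩
  obtain ⟨σ₁, hσ₁, G⟩ := integral_density_eq_one ha hθ hu ha0 hθ0
  obtain ⟨σ, hσ, hσlt, T, ρ, θ, u, hE, hA, t, ht, hx⟩ :=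
    H (min σ₁ (min 1 η)) (lt_min hσ₁ (lt_min one_pos hη))
  have hσ1 : σ < σ₁ := lt_of_lt_of_le hσlt (min_le_left _ _)
  have hσone : σ < 1 := lt_of_lt_of_le hσlt ((min_le_right _ _).trans (min_le_left _ _))
  have hση : σ < η := lt_of_lt_of_le hσlt ((min_le_right _ _).trans (min_le_right _ _))
  have hmass := G σ hσ hσ1 T ρ θ u hE hA t ht
  have hσ3 : 0 < σ ^ 3 := pow_pos hσ 3
  have hσ3lt : σ ^ 3 < η := by
    have : σ ^ 3 ≤ σ := by
      have e : σ ^ 3 = σ * (σ * σ) := by ring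
      rw [e]; exact mul_le_of_le_one_right hσ.le (by nlinarith)
    exact this.trans_lt hση
  have hint : Integrable (ρ t) volume :=
    integrable_of_continuous_T3 (hE.smooth_density.isSmooth_slice ht).continuous
  have hge : ∫ x : T3, η / σ ^ 3 ≤ ∫ x, ρ t x :=
    integral_mono (integrable_const _) hint fun x => (div_le_iff₀ hσ3).2 (hx x)
  rw [hmass, integral_const, smul_eq_mul] at hge
  simp only [probReal_univ, one_mul] at hge
  rw [div_le_iff₀ hσ3, one_mul] at hge
  exact absurd hge (not_le.2 hσ3lt)

/-! ## §8 WHY IT RESISTS — census for provers, planners and the next disprover -/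

/-- **WHY `DenseExcursion` RESISTS a cheap kill AND a cheap proof** (census, v5).

1. LOGICAL POSITION. `DenseExcursion ↔ ¬DiluteSelfConsistency` (§4) and `↔ DenseExcursionPDE` (§3): deciding the
   crux is deciding, for the explicit pinned data `(rhoLim (profileOf a₀) σ, u₀, θ₀) = (a₀/∫a₀ + O(σ³), u₀, θ₀)`,
   whether `limsup_{σ→0} σ³ · sup_{t < T*_σ} ‖ρ_σ(t)‖_∞ > 0` for SOME continuous positive profile. A disproof is a
   σ-uniform packing bound at the FIRST singularity of 3-D compressible Euler for EVERY such profile (the open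
   rank-3 crux, "classification strength", beyond Sideris1985 / LukSpeck2024 open-set theory); a proof is forced
   finite-codimension stability of a smooth self-similar γ = 5/3 implosion under the O(packing) real-gas forcing.
   Neither is cheap; no small/finite model exists (the statement quantifies over classical PDE solutions).
2. THE EOS WALL (blocks junk kills and junk proofs alike). `hsPressure σ ρ θ = ρθ·Z(ρσ³)` with
   `Z η = 1 + η · deriv (limsup_N −N⁻¹ log hsFreeVolume η N) η`. The tree proves NOTHING about `Z` on `(0, 512)`
   (the junk branch `Z = 1` is proved only for `η ≥ 512`; analyticity near `0` is the open support item
   HsEosLowDensity, stmt-0768). Consequences: (a) no classical solution with SPATIALLY NON-CONSTANT DENSITY can be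
   CERTIFIED in Lean at any `σ > 0` today — the momentum flux needs `Torus.gradient` of `y ↦ ρθ·Z(ρσ³)`, junk `0`
   wherever the composite is not differentiable, and which case holds is undecidable in the tree; constant-density
   states (rest states, steady shears) are certifiable for every pressure law (§6) but compression needs `∇ρ ≠ 0`
   (density constant in space is constant in time by `∫ div u = 0`), and admissible constant states have packing
   `σ³ → 0` (§7); (b) no a-priori estimate using the momentum or energy balance can be certified either
   (their fluxes contain `hsPressure ∘ (ρ, θ)`, of unknown smoothness, so neither the divergence theorem nor the
   Gibbs relation / entropy transport is available); only MASS is EOS-free (§7). Hence every Lean-level decision of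
   the crux factors through HsEosLowDensity (or an equivalent regularity theorem for `hsExcessFreeEnergy`).
3. WHAT A WITNESS MUST LOOK LIKE (necessary conditions proved here): data pinned (§2), packing manufactured
   dynamically from `O(σ³)` (§7 `not_denseExcursionAtTimeZero`), on a set of volume `≤ σ³/η` (§7
   `volume_denseSet_le`) — a point concentration; with `T` free (the conjunct quantifies over every classical
   existence time, so nothing bounds `T` or the packing a priori: this is exactly the loophole the route exploits).
   Physically (NOT certified, EOS wall): entropy transport forces the dense core to be HOT, `θ ≳ (η/σ³)^{2/3}`,
   and energy conservation then bounds the dense MASS by `O(σ²)` — consistent with self-similar implosion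
   (core energy `∝ (T*−t)^{8/r−5} → 0` for `1 < r < r* = 1.268`), so no conservation law forbids the excursion.
4. NUMERICS ON RECORD (crux dir `RaceResults.md`, ideator-2, double precision, reproduced Biasi2021's structure;
   gen-1 `RACE_RESULTS.md` evidence agrees: profiles r = 1.112816, 1.164093, 1.190088): first smooth γ = 5/3
   spherical profile `r₂ = 1.1128162`, ONE genuine unstable smooth radial mode `Λ₁ = 0.79711` against the packing
   clock `3(r₂−1) = 0.33845`, ratio `2.355` ⇒ the UNTUNED construction exits at density `∝ σ^{−1.274}` (so it
   proves `PolynomialCompression` at best, not this crux) and the TUNED construction needs `J = 2` scalar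
   conditions on a one-codimension stable manifold; `r₄`: 3 unstable modes, `J = 4`. These numbers neither prove
   nor refute an `∃`-over-profiles statement: a fixed sign of the first Melnikov number `K₁` at ONE profile kills one
   line, not the crux (the profile ranges over an infinite-dimensional stable manifold, `u₀`, `θ₀` are free and
   non-isentropic data are allowed).
5. LITERATURE (negative side; this seat 2026-08-15: `lit search --source zbmath "smooth self-similar imploding
   solutions compressible Euler"` 2019+ → 10 rows: BCG arXiv:2208.09445 / 2301.10101, Shao–Wei–Zhang relativistic
   2403.11471, Jang–Liu–Schrecker converging/diverging shocks 2403.12247, Chen–Cialdea–Shkoller–Vicol 2606.18152,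
   Luong et al. 1-D far-field cutoff 2606.12758, Huang–Gu NSK 2608.10554, Hadžić review 2306.02445, SWWZ NS
   2501.15701; `… "implosion compressible Euler equation of state"` → 1 irrelevant row; searchd/galaxy legs rc 75 at
   session time): no printed theorem gives σ-uniform (or EOS-uniform) `L∞` density control at the first singularity
   of multi-D compressible Euler for general smooth data; no printed theorem constructs smooth implosion for a
   NON-polytropic real-gas law either (all rows above are polytropic or post-shock; ChenShkollerVicol2026's stable
   implosions have `p(0) = 0`, inadmissible here). Biasi2021 (arXiv:2104.05728, read pp. 10–11): §4.1 Numerical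
   Claim — generic `ε > 0` kicks of a profile form a SHOCK at `Z > Z₂` before collapse; Remark 3 — "no evidence of
   loss of regularity in finite τ" for `ε < 0` (within the simulated window); §4.2 — the first unstable SLM `Λ₁` of a
   smooth profile also ends in a shock; nothing printed on whether the `ε < 0` side still collapses. The decision is
   open in print in both directions. GEN-3 ADDENDA (2026-08-16; searchd local index rc 75, remote legs arXiv/OpenAlex
   up, S2 429): Boyd–Ramsey–Baty arXiv:1707.03792 (materialised, abstract p. 2): self-similar converging flows for an
   ARBITRARY equation of state require the adiabatic bulk modulus to factor as `K_S = p·f(ρ)` — the ATHERMAL hard-sphere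
   law `p = ρθZ(ρσ³)`, `e = 3θ/2` satisfies it (`(∂ log θ/∂ log ρ)_s = (2/3)Z`, so `K_S = p[1 + (2/3)Z + ηZ'/Z]`, a
   function of `η = ρσ³` alone): at fixed `σ > 0` the system keeps the exact scaling `(ρ, u, θ)(t,x) ↦ (ρ, μu, μ²θ)(μt, x)`
   (density UNSCALED) and loses the density-scaling symmetry of the polytropic ideal gas that the MRRS/BCG profiles use
   (`ρ ∝ (T-t)^{-β}`). Hence exact self-similar hard-sphere implosions exist only in the Guderley class (unscaled,
   bounded density — they cannot witness the crux), and density-imploding self-similarity is broken exactly at relative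
   order `ρσ³` = packing: the route's FORCED-tracking picture is the only one available, as assumed. Cialdea–Shkoller–Vicol
   arXiv:2510.19688 (classical Euler flows generating the Guderley imploding SHOCK) and Guo–Hadžić–Jang–Schrecker
   arXiv:2509.12435 (nonlinear stability of Larson–Penston) are the 2025 additions to the implosion literature; neither
   treats a non-scale-invariant pressure law or gives σ-uniform density control. Nothing found on an a-priori bound for
   `|Im Λ|` of smooth radial modes (stub 2 of the r2 line).
6. ATTACKS TRIED THIS GENERATION (all recorded as theorems above unless marked): junk-EOS kill (blocked, item 2);
   vacuity of the tie (no: LLN proved, data pinned, §2); vacuous flows (no: Alexander, §1); degenerate profiles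
   (`a₀ ≡ 0`, `θ₀ ≡ 0` make the WEAKENED statements true, §6 — the positivity clauses are load-bearing, not
   loopholes); `t = 0` witness (refuted, §7); bulk witness (refuted, §7); conservation-law contradiction (none:
   item 3); small-`σ` vs `∃σ` slack (void: DE is a statement along a sequence, and `ReachesPacking` is antitone in
   `η`, §4). VERDICT: resists; the honest residual is the PDE dichotomy of item 1 behind the EOS wall of item 2.
7. ATTACKS, GENERATION 3 (2026-08-16): (a) JUNK-PRESSURE WITNESS HUNT (informal audit, not formalised) — can a "classical solution" be certified for an
   ARBITRARY (possibly nowhere-continuous) `Z` on `(0,512)`? With `Z` wild, `y ↦ p(t,y)` is differentiable exactly on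
   the open set where `ρ(t,·)` is locally constant, so the junk `Torus.gradient` is `ρZ∇θ·𝟙_U` and the junk energy
   flux divergence vanishes off `U`; off `U` the typed system degenerates to pressureless Euler WITH FROZEN ENERGY
   DENSITY (`∂ₜE = 0`), whose Burgers collapse from FIXED `u₀` violates `θ > 0` before packing `η` unless the linear
   compression zone has width `≲ σ^{3/2}` — impossible for σ-independent data; on `U` (density locally constant in
   space) homologous collapse needs `t ↦ Z(ρ(t)σ³)` smooth. Either way a certified witness needs REGULARITY OF `Z` on an
   interval — the EOS wall holds from the proof side too (no junk proof of the crux). (b) THE COMPRESSION BUDGET (§11):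
   second EOS-free estimate, maximum principle for the continuity equation ⇒ two natural strengthenings refuted
   (`not_denseExcursionBoundedCompression`, `not_denseExcursionLipschitzVelocity`). (c) TARGETS (§12): the four stubs of
   the registered line audited — conventions correct (certified symmetry modes), stub 1 reduced to `EosIdentity`, no
   cheap kill of stubs 2–4. (d) Conservation/entropy contradictions re-examined with §11 in hand: mass + compression
   budget + volume `≤ σ³/η` are all CONSISTENT with self-similar implosion (`div u ∼ -(T*-t)⁻¹` integrates to
   `β log`, core volume `(T*-t)^{3/r}`), so no EOS-free obstruction exists at this level; the next EOS-free quantity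
   would be the vorticity/irrotationality structure (radial data stay irrotational), which constrains nothing here. -/
theorem why_it_resists : True := trivial


/-! ## §9 The `∀σ` form, and the disprover's notes on the round-1 idea cards -/

/-- The crux in the STRONGER "every small `σ`" form (what a continuous-in-`σ` construction delivers, and what the
route's kill criterion informally says: "packing `≥ η` at every small `σ`"). -/
def DenseExcursionAllSmallSigma : Prop :=
  ∃ η : ℝ, 0 < η ∧ ∃ (a₀ θ₀ : T3 → ℝ) (u₀ : T3 → V3), Continuous a₀ ∧ Continuous θ₀ ∧ Continuous u₀ ∧
    (∀ x, 0 < a₀ x) ∧ (∀ x, 0 < θ₀ x) ∧ ∃ σ₀ : ℝ, 0 < σ₀ ∧ ∀ σ : ℝ, 0 < σ → σ < σ₀ →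
      ∃ (T : ℝ) (ρ θ : ℝ → T3 → ℝ) (u : ℝ → T3 → V3), IsHardSphereEulerSolution σ T ρ u θ ∧
        Admissible σ a₀ u₀ θ₀ ρ u θ ∧ ∃ t ∈ Ico 0 T, ∃ x, η ≤ ρ t x * σ ^ 3

/-- The `∀σ` form implies the filed `∃σ < σ₀` (sequence) form; the converse is not claimed. A refutation of the
crux therefore also refutes every continuous-in-`σ` construction, and `DiluteSelfConsistency` is equivalent to
the failure of the WEAK (sequence) form — the strongest possible reading of the dilute bound. -/
theorem denseExcursion_of_allSmallSigma (h : DenseExcursionAllSmallSigma) : DenseExcursion := by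
  obtain ⟨η, hη, a₀, θ₀, u₀, ha, hθ, hu, ha0, hθ0, σ₁, hσ₁, H⟩ := h
  refine ⟨η, hη, a₀, θ₀, u₀, ha, hθ, hu, ha0, hθ0, fun σ₀ hσ₀ => ?_⟩
  have hσ : 0 < min σ₀ σ₁ / 2 := by positivity
  have h0 : min σ₀ σ₁ / 2 < σ₀ := by have := min_le_left σ₀ σ₁; linarith
  have h1 : min σ₀ σ₁ / 2 < σ₁ := by have := min_le_right σ₀ σ₁; linarith
  obtain ⟨T, ρ, θ, u, hE, hA, t, ht, x, hx⟩ := H _ hσ h1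
  exact ⟨_, hσ, h0, T, ρ, θ, u, hE, hA, t, ht, x, hx⟩

/-- **DISPROVER'S NOTES ON THE ROUND-1 CARDS** (crux dir `Ideas/`; numbers from `RaceResults.md`). Nothing here is a
Lean refutation — the cards are proof strategies, and the EOS wall (§8.2) blocks formal tests of their PDE content —
but each note is a cheap falsifier outcome or a misstatement the triage/lead should weigh.

* `compression-rate-slaving` (lever: certify "no non-gauge point spectrum in `Re Ω ≥ μ(r) − δ`" at one profile, then
  slave everything): NUMERICALLY DEAD at every computed profile. `r₂`: `Λ₁ = 0.79711 > μ = 0.33845` (ratio 2.355);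
  `r₄`: top genuine mode `0.99628 > μ = 0.49228`; the clock saturates at `3(r* − 1) = 0.804` while the top genuine mode
  stays `≈ r_n − 0.17 → 1.10`. Unless a certified computation reverses double precision by a factor > 2, RACE(r_n)
  fails for all `n`; the card survives only as the slaving LEMMA inside the tuned lines (orders `k ≥ 3` are slaved at
  `r₂` because `3μ > Λ₁`).
* `r2-one-mode-two-conditions` ((m, J) = (1, 2) at `r₂`): consistent with everything on record; it is the honest
  shape of the crux, not a proof. Disprover's caveat: the count assumes the forcing enters at relative size
  `= local packing`; the DATA defect also carries an `O(σ³)` ENTROPY perturbation (the pinned `rhoLim ≠ β` makes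
  `θ₀ = Kβ^{2/3}` non-isentropic for the true density, and the hard-sphere entropy has the extra `−f_ex(ρσ³)`), which is
  transported into the cone and sources the momentum equation through `p_s ∇s`; it belongs to `K₁` at the same order
  `σ³` and must be in the Melnikov quadrature.
* `kidder-knob-melnikov`: (i) the projective (pseudo-conformal, γ = 1 + 2/d) map is a symmetry on `ℝ³` (Serre 1997),
  NOT on `𝕋³` (`x ↦ λx`, `u − bx` are not periodic); the card's cutoff outside the cone makes the `σ = 0` evolution
  exact only inside the backward acoustic cone, so the line silently uses `ConeLocality` (domain of dependence for the
  REAL-gas system — true given EOS regularity, unprovable in the tree today, §8.2). (ii) Its ladder rung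
  `DenseExcursionMovingProfile` (profiles allowed to depend on `σ₀`) is NOT a meaningful target: it holds for the
  trivial reason that a `σ`-dependent activity bump of width `≍ σ η^{-1/3}` already has packing `η` in equilibrium, so
  (granting local well-posedness and the LLN at packing `η`, both physical but beyond the tree) it is witnessed at
  `t = 0⁺` with no implosion at all. Only the fixed-profile crux carries content — exactly what
  `not_denseExcursionAtTimeZero` (§7) formalises: for FIXED profiles the initial packing is `O(σ³)`.
* `soft-side-offset` (ride the rarefactive side of `W^u(SS)` with an `O(1)` offset): rests on the global claim K1
  (the soft branch keeps imploding). If the rarefactive kick makes the core BOUNCE (density stays bounded, no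
  singularity) — the generic alternative to "shock before collapse" for a saddle-type self-similar profile — the card
  is dead; Biasi2021 §4.1 Remark 3 (p. 10) reports only "no evidence of loss of regularity in finite τ" for `ε < 0`
  0-mode kicks, within the simulated window, and §4.2 (p. 11) is silent on the `ε < 0` side of the SLM: compatible
  with a bounce as much as with continued collapse. Cheapest falsifier unchanged (one radial run in self-similar
  variables); not runnable here without a certified profile solver. -/
theorem notes_on_cards : True := trivial


/-! ## §10 Conditional infrastructure behind the EOS wall: energy conservation given a smooth energy flux -/

/-- **ENERGY IS CONSERVED — conditionally.** If the energy FLUX slices `y ↦ (E + p) u` are smooth (which is what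
`HsEosLowDensity` + packing below the analyticity radius will give, and which is automatic at `σ = 0`), then
`∫ E(t) = ∫ E(0)` on `[0,T)` for every classical hard-sphere-Euler solution (same proof as mass, §7). Stated with the
weakest usable hypothesis so that provers can discharge it once `Z` is known to be smooth on `[0, η]`; with it,
`(3/2) ∫ ρθ(t) ≤ ∫ E(0)` bounds the thermal energy of any dense core (physically `θ ≳ (η/σ³)^{2/3}` there, so the
dense MASS is `O(σ²)` — the entropy half of that statement is NOT formalised: it needs the Gibbs relation, i.e. the
chain rule through `hsExcessFreeEnergy`, the EOS wall again). -/
theorem integral_totalEnergy_eq {σ T : ℝ} {ρ θ : ℝ → T3 → ℝ} {u : ℝ → T3 → V3}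
    (hE : IsHardSphereEulerSolution σ T ρ u θ)
    (hflux : ∀ s ∈ Ico 0 T, Torus.IsSmooth fun y =>
      (totalEnergyDensity (ρ s y) (u s y) (θ s y) + hsPressure σ (ρ s y) (θ s y)) • u s y)
    {t : ℝ} (ht : t ∈ Ico 0 T) :
    ∫ x, totalEnergyDensity (ρ t x) (u t x) (θ t x) = ∫ x, totalEnergyDensity (ρ 0 x) (u 0 x) (θ 0 x) := by
  -- joint smoothness of the energy density `ρ(|u|²/2 + 3θ/2)`
  have hEn : Torus.IsSmoothSpaceTimeOn (Ico 0 T) fun s y => totalEnergyDensity (ρ s y) (u s y) (θ s y) := by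
    have h1 : Torus.IsSmoothSpaceTimeOn (Ico 0 T) fun s y => ⟪u s y, u s y⟫_ℝ :=
      hE.smooth_velocity.inner hE.smooth_velocity
    have h2 : Torus.IsSmoothSpaceTimeOn (Ico 0 T) fun s y => ‖u s y‖ ^ 2 / 2 + 3 / 2 * θ s y := by
      have e : (fun s y => ‖u s y‖ ^ 2 / 2 + 3 / 2 * θ s y) =
          fun s y => (1 / 2 : ℝ) • ⟪u s y, u s y⟫_ℝ + (3 / 2 : ℝ) • θ s y := by
        funext s y
        rw [real_inner_self_eq_norm_sq]
        simp only [smul_eq_mul]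
        ring
      rw [e]
      exact (h1.const_smul _).add (hE.smooth_temperature.const_smul _)
    exact hE.smooth_density.mul h2
  have hderiv : ∀ s ∈ Ico 0 T, HasDerivWithinAt
      (fun s => ∫ x, totalEnergyDensity (ρ s x) (u s x) (θ s x)) 0 (Ico 0 T) s := by
    intro s hs
    have h1 := hEn.hasDerivWithinAt_integral (convex_Ico 0 T) hs
    have h2 : ∫ x, Torus.timeDerivWithin (Ico 0 T)
        (fun s y => totalEnergyDensity (ρ s y) (u s y) (θ s y)) s x = 0 := by
      have hpt : (fun x => Torus.timeDerivWithin (Ico 0 T)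
          (fun s y => totalEnergyDensity (ρ s y) (u s y) (θ s y)) s x) =
          fun x => -Torus.divergence (fun y =>
            (totalEnergyDensity (ρ s y) (u s y) (θ s y) + hsPressure σ (ρ s y) (θ s y)) • u s y) x := by
        funext x; have := hE.energy s hs x; linarith
      rw [hpt, integral_neg, neg_eq_zero]
      exact Torus.integral_divergence_eq_zero_holds (hflux s hs)
    rwa [h2] at h1
  have hcont : ContinuousOn (fun s => ∫ x, totalEnergyDensity (ρ s x) (u s x) (θ s x)) (Icc 0 t) :=
    fun s hs => ((hderiv s ⟨hs.1, hs.2.trans_lt ht.2⟩).continuousWithinAt).mono (Icc_subset_Ico_right ht.2)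
  have hright : ∀ s ∈ Ico 0 t, HasDerivWithinAt
      (fun s => ∫ x, totalEnergyDensity (ρ s x) (u s x) (θ s x)) 0 (Ici s) s := by
    intro s hs
    have hsT : s ∈ Ico 0 T := ⟨hs.1, hs.2.trans ht.2⟩
    refine (hderiv s hsT).mono_of_mem_nhdsWithin ?_
    exact Filter.mem_of_superset (Ico_mem_nhdsGE hsT.2) (Ico_subset_Ico_left hsT.1)
  exact constant_of_has_deriv_right_zero hcont hright t (right_mem_Icc.2 ht.1)

/-- At `σ = 0` (the monatomic IDEAL gas, `hsPressure 0 ρ θ = ρθ`) the flux hypothesis of `integral_totalEnergy_eq` is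
automatic, so energy is conserved unconditionally along `IsHardSphereEulerSolution 0` — the reference dynamics of every
line (IdealGasImplosion, EosContinuity). -/
theorem integral_totalEnergy_eq_ideal {T : ℝ} {ρ θ : ℝ → T3 → ℝ} {u : ℝ → T3 → V3}
    (hE : IsHardSphereEulerSolution 0 T ρ u θ) {t : ℝ} (ht : t ∈ Ico 0 T) :
    ∫ x, totalEnergyDensity (ρ t x) (u t x) (θ t x) = ∫ x, totalEnergyDensity (ρ 0 x) (u 0 x) (θ 0 x) := by
  refine integral_totalEnergy_eq hE (fun s hs => ?_) ht
  have hp : (fun y => (totalEnergyDensity (ρ s y) (u s y) (θ s y) + hsPressure 0 (ρ s y) (θ s y)) • u s y) =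
      fun y => (ρ s y * (‖u s y‖ ^ 2 / 2 + 3 / 2 * θ s y) + ρ s y * θ s y) • u s y := by
    funext y
    simp [totalEnergyDensity, hsPressure, hsCompressibility]
  rw [hp]
  have hρ := hE.smooth_density.isSmooth_slice hs
  have hu := hE.smooth_velocity.isSmooth_slice hs
  have hθ := hE.smooth_temperature.isSmooth_slice hs
  have hn : Torus.IsSmooth fun y => ‖u s y‖ ^ 2 := by
    have e : (fun y => ‖u s y‖ ^ 2) = fun y => ⟪u s y, u s y⟫_ℝ := by
      funext y; rw [real_inner_self_eq_norm_sq]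
    rw [e]
    exact hu.inner hu
  have hc : Torus.IsSmooth fun y => ρ s y * (‖u s y‖ ^ 2 / 2 + 3 / 2 * θ s y) + ρ s y * θ s y := by
    unfold Torus.IsSmooth at *
    simp only [Torus.lift] at *
    change ContDiff ℝ _ (fun z => ρ s (Torus.proj z) * (‖u s (Torus.proj z)‖ ^ 2 / 2 + 3 / 2 * θ s (Torus.proj z))
      + ρ s (Torus.proj z) * θ s (Torus.proj z))
    have hρ' : ContDiff ℝ (⊤ : ℕ∞) (fun z => ρ s (Torus.proj z)) := hρ
    have hθ' : ContDiff ℝ (⊤ : ℕ∞) (fun z => θ s (Torus.proj z)) := hθ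
    have hn' : ContDiff ℝ (⊤ : ℕ∞) (fun z => ‖u s (Torus.proj z)‖ ^ 2) := hn
    exact (hρ'.mul ((hn'.div_const 2).add (contDiff_const.mul hθ'))).add (hρ'.mul hθ')
  exact hc.smul' hu


/-! ## §11 THE COMPRESSION BUDGET: an EOS-free maximum principle for the continuity equation

The second EOS-free a-priori estimate (after mass, §7). Along ANY classical hard-sphere-Euler solution, for every
`σ` and every pressure law, `max_x ρ(t, ·) ≤ max_x ρ(0, ·) · exp(∫₀ᵗ ‖(div u)₋‖_∞)`; here in the form
"`-K ≤ div u` on `[0, t] × 𝕋³` ⇒ `ρ(t, x) ≤ max ρ(0, ·) e^{K t}`". With the pinned data of §2 (`ρ(0) < (2e+1)M`):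
a witness of the crux at level `η` must have `K t ≥ log (η / ((2e+1) M σ³)) = 3 log σ⁻¹ + O(1)` — the velocity
GRADIENT must blow up (logarithmically in `σ`, from `σ`-independent data `u₀`) BEFORE packing `η` is reached; in
particular the excursion happens outside every `σ`-uniform `C¹` regime, e.g. outside the continuation regime
`‖D u‖ ≤ M` of the line's well-posedness stub (`HsEulerWellPosedness` (ii)). Consistent with implosion
(`div u ∼ -(T* - t)⁻¹`, `∫ = β log`), so it is a necessary condition, not a kill. -/

/-- **Fermat on the torus**: at a spatial maximum point every partial derivative vanishes (no differentiability
needed — the `deriv` junk value is `0` too). -/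
theorem partialDeriv_eq_zero_of_isMaxOn {f : T3 → ℝ} {x : T3} (hx : IsMaxOn f univ x) (i : Fin 3) :
    Torus.partialDeriv i f x = 0 := by
  unfold Torus.partialDeriv Torus.lineDeriv
  apply IsLocalMax.deriv_eq_zero
  refine Filter.Eventually.of_forall fun s => ?_
  have h := hx (mem_univ (x + Torus.proj (s • EuclideanSpace.single i (1 : ℝ))))
  simpa using h

/-- Leibniz at a maximum point: `div (f v)(x) = f(x) · div v(x)` when `x` is a spatial maximum point of `f`
(`∑ᵢ ∂ᵢf vᵢ = 0` there). -/
theorem divergence_smul_of_isMaxOn {f : T3 → ℝ} {v : T3 → V3} (hf : Torus.IsSmooth f)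
    (hv : Torus.IsSmooth v) {x : T3} (hx : IsMaxOn f univ x) :
    Torus.divergence (fun y => f y • v y) x = f x * Torus.divergence v x := by
  unfold Torus.divergence
  have h1 : Torus.IsContDiff 1 f := hf.isContDiff (by simp)
  have hsum : ∀ i : Fin 3, Torus.partialDeriv i (fun y => (f y • v y) i) x =
      f x * Torus.partialDeriv i (fun y => v y i) x := by
    intro i
    have h2 : Torus.IsContDiff 1 (fun y => v y i) := (hv.apply i).isContDiff (by simp)
    have e : (fun y => (f y • v y) i) = fun y => f y * v y i := by
      funext y; simp [PiLp.smul_apply]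
    rw [e, Torus.partialDeriv_mul h1 h2 i x, partialDeriv_eq_zero_of_isMaxOn hx i]
    ring
  rw [Finset.mul_sum]
  exact Finset.sum_congr rfl fun i _ => hsum i

/-- A maximum from the left forces a non-negative derivative (left difference quotients are `≥ 0`). -/
theorem deriv_nonneg_of_left_max {φ : ℝ → ℝ} {φ' t : ℝ} (hφ : HasDerivAt φ φ' t)
    (hmax : ∀ᶠ s in 𝓝[<] t, φ s ≤ φ t) : 0 ≤ φ' := by
  have hslope : Tendsto (slope φ t) (𝓝[<] t) (𝓝 φ') :=
    (hasDerivAt_iff_tendsto_slope_left_right.1 hφ).1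
  refine ge_of_tendsto hslope ?_
  filter_upwards [self_mem_nhdsWithin, hmax] with s hs hφs
  rw [slope_def_field]
  have h1 : φ s - φ t ≤ 0 := sub_nonpos.2 hφs
  have h2 : s - t < 0 := sub_neg.2 hs
  exact div_nonneg_of_nonpos h1 h2.le

/-- **MAXIMUM PRINCIPLE FOR THE CONTINUITY EQUATION (EOS-free, every `σ`).** Along any classical
hard-sphere-Euler solution, if `-K ≤ div u` on `[0, t₁] × 𝕋³` then `ρ(t₁, x) ≤ ρ(0, y) e^{K t₁}` for the initial
maximum point `y`: compression by a factor `A` costs `∫ ‖(div u)₋‖_∞ ≥ log A`. Only the mass equation, joint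
smoothness and positivity of `ρ` are used (first-touch argument on `ρ e^{-Lt}`, `L > K`, at the first bad time and
a spatial maximum point, where `∂ₜρ = -ρ div u ≤ Kρ` by Fermat; then `L ↓ K`). -/
theorem density_le_max_mul_exp {σ T : ℝ} {ρ θ : ℝ → T3 → ℝ} {u : ℝ → T3 → V3}
    (hE : IsHardSphereEulerSolution σ T ρ u θ) {t₁ : ℝ} (ht₁ : t₁ ∈ Ico 0 T) {K : ℝ}
    (hK : ∀ s ∈ Icc 0 t₁, ∀ x, -K ≤ Torus.divergence (u s) x) :
    ∃ y, ∀ x, ρ t₁ x ≤ ρ 0 y * Real.exp (K * t₁) := by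
  have hT : 0 < T := ht₁.1.trans_lt ht₁.2
  have h0 : (0 : ℝ) ∈ Ico 0 T := ⟨le_rfl, hT⟩
  -- the initial maximum point `y`
  have hc0 : Continuous (ρ 0) := (hE.smooth_density.isSmooth_slice h0).continuous
  obtain ⟨y, -, hy⟩ := isCompact_univ.exists_isMaxOn univ_nonempty hc0.continuousOn
  refine ⟨y, ?_⟩
  set M₀ := ρ 0 y with hM₀
  have hM₀pos : 0 < M₀ := hE.density_pos 0 h0 y
  have hyle : ∀ x, ρ 0 x ≤ M₀ := fun x => hy (mem_univ x)
  -- it suffices to prove the bound with every `L > K`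
  suffices hL : ∀ L, K < L → ∀ t ∈ Icc 0 t₁, ∀ x, ρ t x ≤ M₀ * Real.exp (L * t) by
    intro x
    have hcont : Continuous fun L : ℝ => M₀ * Real.exp (L * t₁) := by fun_prop
    have hlim : Tendsto (fun L : ℝ => M₀ * Real.exp (L * t₁)) (𝓝[>] K)
        (𝓝 (M₀ * Real.exp (K * t₁))) :=
      (hcont.tendsto K).mono_left nhdsWithin_le_nhds
    refine ge_of_tendsto hlim ?_
    filter_upwards [self_mem_nhdsWithin] with L hL'
    exact hL L hL' t₁ ⟨ht₁.1, le_rfl⟩ x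
  intro L hKL
  by_contra hbad
  push Not at hbad
  obtain ⟨t', ht', x', hx'⟩ := hbad
  have hIcc : Icc 0 t₁ ⊆ Ico 0 T := fun s hs => ⟨hs.1, hs.2.trans_lt ht₁.2⟩
  -- the rescaled density `g(t, x) = ρ(t, x) e^{-L t}`
  set g : ℝ → T3 → ℝ := fun t x => ρ t x * Real.exp (-(L * t)) with hg
  have hg_le : ∀ {t : ℝ} {x z : T3}, ρ t x ≤ ρ t z → g t x ≤ g t z := fun h =>
    mul_le_mul_of_nonneg_right h (Real.exp_pos _).le
  have hgt' : M₀ < g t' x' := by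
    have hexp : 0 < Real.exp (L * t') := Real.exp_pos _
    show M₀ < ρ t' x' * Real.exp (-(L * t'))
    rw [Real.exp_neg, ← div_eq_mul_inv, lt_div_iff₀ hexp]
    exact hx'
  set c := g t' x' with hc
  -- the bad set of times
  set A : Set ℝ := {t | t ∈ Icc 0 t₁ ∧ ∃ x, c ≤ g t x} with hA
  have ht'A : t' ∈ A := ⟨ht', x', le_rfl⟩
  have hAne : A.Nonempty := ⟨t', ht'A⟩
  have hAbdd : BddBelow A := ⟨0, fun t ht => ht.1.1⟩
  have h0A : (0 : ℝ) ∉ A := by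
    rintro ⟨-, x, hx⟩
    have : g 0 x ≤ M₀ := by
      show ρ 0 x * Real.exp (-(L * 0)) ≤ M₀
      rw [mul_zero, neg_zero, Real.exp_zero, mul_one]; exact hyle x
    linarith
  -- `A` is closed: it is the projection of a compact superlevel set of the continuous space–time lift
  have hAclosed : IsClosed A := by
    set Q : Set (EuclideanSpace ℝ (Fin 3)) :=
      (WithLp.toLp 2) '' (Set.pi univ fun _ : Fin 3 => Icc (0 : ℝ) 1) with hQ
    have hQc : IsCompact Q := Torus.isCompact_toLp_image_pi_Icc
    set G : ℝ × EuclideanSpace ℝ (Fin 3) → ℝ := fun p => Torus.stLift ρ p * Real.exp (-(L * p.1))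
      with hG
    have hGc : ContinuousOn G (Icc 0 t₁ ×ˢ Q) := by
      have h1 : ContinuousOn (Torus.stLift ρ) (Icc 0 t₁ ×ˢ Q) :=
        hE.smooth_density.continuousOn_stLift.mono (prod_mono hIcc (subset_univ _))
      have h2 : Continuous fun p : ℝ × EuclideanSpace ℝ (Fin 3) => Real.exp (-(L * p.1)) := by
        fun_prop
      exact h1.mul h2.continuousOn
    have hSclosed : IsClosed ((Icc 0 t₁ ×ˢ Q) ∩ G ⁻¹' Ici c) :=
      hGc.preimage_isClosed_of_isClosed (isClosed_Icc.prod hQc.isClosed) isClosed_Ici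
    have hSc : IsCompact ((Icc 0 t₁ ×ˢ Q) ∩ G ⁻¹' Ici c) :=
      (isCompact_Icc.prod hQc).of_isClosed_subset hSclosed inter_subset_left
    have hAeq : A = Prod.fst '' ((Icc 0 t₁ ×ˢ Q) ∩ G ⁻¹' Ici c) := by
      ext t
      constructor
      · rintro ⟨ht, x, hx⟩
        refine ⟨(t, Torus.repr x), ⟨mk_mem_prod ht (Torus.repr_mem_toLp_image_pi_Icc x), ?_⟩, rfl⟩
        show c ≤ Torus.stLift ρ (t, Torus.repr x) * Real.exp (-(L * t))
        simpa [Torus.stLift_apply, Torus.proj_repr] using hx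
      · rintro ⟨⟨s, y'⟩, ⟨hsy, hGy⟩, rfl⟩
        refine ⟨(mem_prod.1 hsy).1, Torus.proj y', ?_⟩
        have : c ≤ Torus.stLift ρ (s, y') * Real.exp (-(L * s)) := hGy
        simpa [Torus.stLift_apply] using this
    rw [hAeq]
    exact (hSc.image continuous_fst).isClosed
  -- the first bad time `ts > 0`
  set ts := sInf A with hts
  have htsA : ts ∈ A := hAclosed.csInf_mem hAne hAbdd
  obtain ⟨htsI, x₀, hx₀⟩ := htsA
  have hts0 : 0 < ts := lt_of_le_of_ne htsI.1 fun h => h0A (h ▸ ⟨htsI, x₀, hx₀⟩)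
  have htsT : ts ∈ Ico 0 T := hIcc htsI
  -- the spatial maximum point `xs` of `ρ(ts, ·)`
  have hcts : Continuous (ρ ts) := (hE.smooth_density.isSmooth_slice htsT).continuous
  obtain ⟨xs, -, hxs⟩ := isCompact_univ.exists_isMaxOn univ_nonempty hcts.continuousOn
  have hcxs : c ≤ g ts xs := hx₀.trans (hg_le (hxs (mem_univ x₀)))
  -- before `ts` nothing is bad
  have hbefore : ∀ s ∈ Ico 0 ts, g s xs < c := by
    intro s hs
    have hsA : s ∉ A := notMem_of_lt_csInf hs.2 hAbdd
    by_contra hle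
    exact hsA ⟨⟨hs.1, hs.2.le.trans htsI.2⟩, xs, not_lt.1 hle⟩
  -- the time derivative of `s ↦ g s xs` at `ts` is `≥ 0`
  set D := Torus.timeDerivWithin (Ico 0 T) ρ ts xs with hD
  have hslice : HasDerivAt (fun s => ρ s xs) D ts :=
    (hE.smooth_density.hasDerivWithinAt_slice htsT xs).hasDerivAt (Ico_mem_nhds hts0 htsT.2)
  have hexpd : HasDerivAt (fun s => Real.exp (-(L * s))) (Real.exp (-(L * ts)) * (-(L * 1))) ts :=
    (((hasDerivAt_id ts).const_mul L).neg).exp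
  have hφ : HasDerivAt (fun s => g s xs)
      (D * Real.exp (-(L * ts)) + ρ ts xs * (Real.exp (-(L * ts)) * (-(L * 1)))) ts :=
    hslice.mul hexpd
  have hφ' : 0 ≤ D * Real.exp (-(L * ts)) + ρ ts xs * (Real.exp (-(L * ts)) * (-(L * 1))) := by
    refine deriv_nonneg_of_left_max hφ ?_
    filter_upwards [Ico_mem_nhdsLT hts0] with s hs
    exact ((hbefore s hs).trans_le hcxs).le
  have hexp0 : 0 < Real.exp (-(L * ts)) := Real.exp_pos _
  have hDge : L * ρ ts xs ≤ D := by
    have : 0 ≤ Real.exp (-(L * ts)) * (D - L * ρ ts xs) := by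
      have e : D * Real.exp (-(L * ts)) + ρ ts xs * (Real.exp (-(L * ts)) * (-(L * 1))) =
          Real.exp (-(L * ts)) * (D - L * ρ ts xs) := by ring
      rwa [e] at hφ'
    nlinarith
  -- the mass equation at `(ts, xs)`: `D = -ρ div u ≤ K ρ`
  have hmass := hE.mass ts htsT xs
  have hdiv : Torus.divergence (fun z => ρ ts z • u ts z) xs = ρ ts xs * Torus.divergence (u ts) xs :=
    divergence_smul_of_isMaxOn (hE.smooth_density.isSmooth_slice htsT)
      (hE.smooth_velocity.isSmooth_slice htsT) hxs
  have hDle : D ≤ K * ρ ts xs := by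
    have hK' := hK ts htsI xs
    have hρ := hE.density_pos ts htsT xs
    have : D = -(ρ ts xs * Torus.divergence (u ts) xs) := by rw [← hdiv]; linarith
    rw [this]; nlinarith
  have hρpos := hE.density_pos ts htsT xs
  nlinarith

/-- `|div v(x)| ≤ 3 ‖Dv(x)‖` for a `C¹` vector field on `𝕋³` (`div = trace D`, orthonormal basis). -/
theorem abs_divergence_le {v : T3 → V3} (hv : Torus.IsContDiff 1 v) (x : T3) :
    |Torus.divergence v x| ≤ 3 * ‖Torus.fderiv v x‖ := by
  rw [Torus.divergence_eq_trace_fderiv hv,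
    LinearMap.trace_eq_sum_inner _ (EuclideanSpace.basisFun (Fin 3) ℝ)]
  set Lv := Torus.fderiv v x with hLv
  have hterm : ∀ i : Fin 3, |⟪(EuclideanSpace.basisFun (Fin 3) ℝ) i,
      (Lv : V3 →ₗ[ℝ] V3) ((EuclideanSpace.basisFun (Fin 3) ℝ) i)⟫_ℝ| ≤ ‖Lv‖ := by
    intro i
    have hn : ‖(EuclideanSpace.basisFun (Fin 3) ℝ) i‖ = 1 := (EuclideanSpace.basisFun (Fin 3) ℝ).norm_eq_one i
    refine (abs_real_inner_le_norm _ _).trans ?_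
    rw [hn, one_mul, ContinuousLinearMap.coe_coe]
    calc ‖Lv ((EuclideanSpace.basisFun (Fin 3) ℝ) i)‖ ≤ ‖Lv‖ * ‖(EuclideanSpace.basisFun (Fin 3) ℝ) i‖ :=
          Lv.le_opNorm _
      _ = ‖Lv‖ := by rw [hn, mul_one]
  calc |∑ i, ⟪(EuclideanSpace.basisFun (Fin 3) ℝ) i, (Lv : V3 →ₗ[ℝ] V3) ((EuclideanSpace.basisFun (Fin 3) ℝ) i)⟫_ℝ|
      ≤ ∑ i, |⟪(EuclideanSpace.basisFun (Fin 3) ℝ) i, (Lv : V3 →ₗ[ℝ] V3) ((EuclideanSpace.basisFun (Fin 3) ℝ) i)⟫_ℝ| :=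
        Finset.abs_sum_le_sum_abs _ _
    _ ≤ ∑ _i : Fin 3, ‖Lv‖ := Finset.sum_le_sum fun i _ => hterm i
    _ = 3 * ‖Lv‖ := by simp

/-- **THE COMPRESSION BUDGET (tightness, quantitative).** Below the statics threshold, along every ADMISSIBLE
classical hard-sphere-Euler solution with `-K ≤ div u` on `[0, t] × 𝕋³`:
`ρ(t, x) < (2e+1) M e^{K t}` (`M = sup a₀/∫a₀`), i.e. packing `< (2e+1) M σ³ e^{K t}`. A witness of the crux at
level `η` therefore has `sup_{[0,t]} ‖(div u)₋‖_∞ · t ≥ log (η / ((2e+1) M σ³)) → ∞`. -/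
theorem density_lt_of_divergence_ge {a₀ θ₀ : T3 → ℝ} {u₀ : T3 → V3} (ha : Continuous a₀) (hθ : Continuous θ₀)
    (hu : Continuous u₀) (ha0 : ∀ x, 0 < a₀ x) (hθ0 : ∀ x, 0 < θ₀ x) :
    ∃ σ₁ : ℝ, 0 < σ₁ ∧ ∀ σ : ℝ, 0 < σ → σ < σ₁ →
      ∀ (T : ℝ) (ρ θ : ℝ → T3 → ℝ) (u : ℝ → T3 → V3), IsHardSphereEulerSolution σ T ρ u θ →
        Admissible σ a₀ u₀ θ₀ ρ u θ → ∀ t ∈ Ico 0 T, ∀ K : ℝ,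
          (∀ s ∈ Icc 0 t, ∀ x, -K ≤ Torus.divergence (u s) x) →
          ∀ x, ρ t x < (2 * Real.exp 1 + 1) * (profileOf a₀ ha ha0).M * Real.exp (K * t) := by
  obtain ⟨σ₁, hσ₁, -, G⟩ := admissible_iff_data ha hθ hu ha0 hθ0
  refine ⟨σ₁, hσ₁, fun σ hσ hσlt T ρ θ u hE hA t ht K hK x => ?_⟩
  have hT : 0 < T := ht.1.trans_lt ht.2
  obtain ⟨hS, -, G'⟩ := G σ hσ hσlt
  obtain ⟨hρc, huc, hθc⟩ := continuous_slices_zero hE hT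
  obtain ⟨hρ0, -, -⟩ := (G' ρ θ u hρc huc hθc).1 hA
  obtain ⟨y, hy⟩ := density_le_max_mul_exp hE ht hK
  have hlt : ρ 0 y < (2 * Real.exp 1 + 1) * (profileOf a₀ ha ha0).M := by rw [hρ0]; exact rhoLim_lt hS y
  have hexp : 0 < Real.exp (K * t) := Real.exp_pos _
  calc ρ t x ≤ ρ 0 y * Real.exp (K * t) := hy x
    _ < (2 * Real.exp 1 + 1) * (profileOf a₀ ha ha0).M * Real.exp (K * t) := by gcongr

/-- The crux strengthened by a `σ`-UNIFORM COMPRESSION BUDGET: the witnesses reach packing `η` at a time `t ≤ T₀`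
with `-K ≤ div u` on `[0, t] × 𝕋³`, the constants `K, T₀` NOT depending on `σ` (everything else verbatim). -/
def DenseExcursionBoundedCompression : Prop :=
  ∃ K T₀ : ℝ, ∃ η : ℝ, 0 < η ∧ ∃ (a₀ θ₀ : T3 → ℝ) (u₀ : T3 → V3), Continuous a₀ ∧ Continuous θ₀ ∧
    Continuous u₀ ∧ (∀ x, 0 < a₀ x) ∧ (∀ x, 0 < θ₀ x) ∧ ∀ σ₀ : ℝ, 0 < σ₀ → ∃ σ : ℝ, 0 < σ ∧ σ < σ₀ ∧
      ∃ (T : ℝ) (ρ θ : ℝ → T3 → ℝ) (u : ℝ → T3 → V3), IsHardSphereEulerSolution σ T ρ u θ ∧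
        Admissible σ a₀ u₀ θ₀ ρ u θ ∧ ∃ t ∈ Ico 0 T, t ≤ T₀ ∧
          (∀ s ∈ Icc 0 t, ∀ x, -K ≤ Torus.divergence (u s) x) ∧ ∃ x, η ≤ ρ t x * σ ^ 3

/-- **NO EXCURSION ON A BOUNDED COMPRESSION BUDGET** (unconditional, EOS-free): with `-K ≤ div u` up to the
excursion time `t ≤ T₀`, `K, T₀` independent of `σ`, the packing is `< (2e+1) M σ³ e^{|K| T₀} → 0`. Any witness
family of the crux has `sup_{s ≤ t} ‖(div u_σ(s))₋‖_∞ · t → ∞` like `3 log σ⁻¹`: the velocity gradient blows up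
(from the FIXED datum `u₀`) before the packing is reached. -/
theorem not_denseExcursionBoundedCompression : ¬ DenseExcursionBoundedCompression := by
  rintro ⟨K, T₀, η, hη, a₀, θ₀, u₀, ha, hθ, hu, ha0, hθ0, H⟩
  obtain ⟨σ₁, hσ₁, G⟩ := density_lt_of_divergence_ge ha hθ hu ha0 hθ0
  set P := profileOf a₀ ha ha0 with hP
  set B := (2 * Real.exp 1 + 1) * P.M * Real.exp (|K| * T₀) with hB
  have hB0 : 0 < B := by have := P.M_pos; positivity
  obtain ⟨σ, hσ, hσlt, T, ρ, θ, u, hE, hA, t, ht, htT₀, hK, x, hx⟩ :=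
    H (min σ₁ (min 1 (η / B))) (lt_min hσ₁ (lt_min one_pos (div_pos hη hB0)))
  have hσ1 : σ < σ₁ := lt_of_lt_of_le hσlt (min_le_left _ _)
  have hσone : σ < 1 := lt_of_lt_of_le hσlt ((min_le_right _ _).trans (min_le_left _ _))
  have hσB : σ < η / B := lt_of_lt_of_le hσlt ((min_le_right _ _).trans (min_le_right _ _))
  have hlt := G σ hσ hσ1 T ρ θ u hE hA t ht K hK x
  have hKt : K * t ≤ |K| * T₀ :=
    (mul_le_mul_of_nonneg_right (le_abs_self K) ht.1).trans (mul_le_mul_of_nonneg_left htT₀ (abs_nonneg K))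
  have hρB : ρ t x < B := by
    refine hlt.trans_le ?_
    rw [hB]
    have := P.M_pos
    gcongr
  have hσ3 : σ ^ 3 ≤ σ := by
    have e : σ ^ 3 = σ * (σ * σ) := by ring
    rw [e]
    exact mul_le_of_le_one_right hσ.le (by nlinarith)
  have hρpos : 0 < ρ t x := hE.density_pos t ht x
  have : ρ t x * σ ^ 3 < η :=
    calc ρ t x * σ ^ 3 ≤ ρ t x * σ := by gcongr
      _ < B * (η / B) := mul_lt_mul'' hρB hσB hρpos.le hσ.le
      _ = η := mul_div_cancel₀ η hB0.ne'
  exact absurd hx (not_le.2 this)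

/-- The crux strengthened by a `σ`-UNIFORM VELOCITY-GRADIENT BOUND up to the excursion time — the shape of the
continuation hypothesis of the line's `HsEulerWellPosedness` (ii): `‖D u(s, x)‖ ≤ M` on `[0, t] × 𝕋³`, `t ≤ T₀`. -/
def DenseExcursionLipschitzVelocity : Prop :=
  ∃ M T₀ : ℝ, ∃ η : ℝ, 0 < η ∧ ∃ (a₀ θ₀ : T3 → ℝ) (u₀ : T3 → V3), Continuous a₀ ∧ Continuous θ₀ ∧
    Continuous u₀ ∧ (∀ x, 0 < a₀ x) ∧ (∀ x, 0 < θ₀ x) ∧ ∀ σ₀ : ℝ, 0 < σ₀ → ∃ σ : ℝ, 0 < σ ∧ σ < σ₀ ∧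
      ∃ (T : ℝ) (ρ θ : ℝ → T3 → ℝ) (u : ℝ → T3 → V3), IsHardSphereEulerSolution σ T ρ u θ ∧
        Admissible σ a₀ u₀ θ₀ ρ u θ ∧ ∃ t ∈ Ico 0 T, t ≤ T₀ ∧
          (∀ s ∈ Icc 0 t, ∀ x, ‖Torus.fderiv (u s) x‖ ≤ M) ∧ ∃ x, η ≤ ρ t x * σ ^ 3

/-- **NO EXCURSION INSIDE A `σ`-UNIFORM `C¹` REGIME OF THE VELOCITY** (unconditional): `‖Du‖ ≤ M` gives
`-3M ≤ div u`, and `not_denseExcursionBoundedCompression` applies. -/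
theorem not_denseExcursionLipschitzVelocity : ¬ DenseExcursionLipschitzVelocity := by
  rintro ⟨M, T₀, η, hη, a₀, θ₀, u₀, ha, hθ, hu, ha0, hθ0, H⟩
  refine not_denseExcursionBoundedCompression ⟨3 * M, T₀, η, hη, a₀, θ₀, u₀, ha, hθ, hu, ha0, hθ0,
    fun σ₀ hσ₀ => ?_⟩
  obtain ⟨σ, hσ, hσlt, T, ρ, θ, u, hE, hA, t, ht, htT₀, hM, x, hx⟩ := H σ₀ hσ₀
  refine ⟨σ, hσ, hσlt, T, ρ, θ, u, hE, hA, t, ht, htT₀, fun s hs z => ?_, x, hx⟩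
  have hsT : s ∈ Ico 0 T := ⟨hs.1, hs.2.trans_lt ht.2⟩
  have h1 : Torus.IsContDiff 1 (u s) := (hE.smooth_velocity.isSmooth_slice hsT).isContDiff (by simp)
  have h := abs_divergence_le h1 z
  have h' := hM s hs z
  have := neg_abs_le (Torus.divergence (u s) z)
  linarith


/-! ## §12 TARGETS — the four stubs of the registered skeleton `Lines/r2-one-mode-two-conditions.lean`

The lead's skeleton (sha d312ac19…, registered 2026-08-16T00:01Z; stubs `stub_admissibleData`, `stub_oneModeProfile`,
`stub_wellPosedness`, `stub_tunedForcedImplosion`) is attacked here stub by stub. Definitions of the skeleton used in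
statements below are COPIED VERBATIM (namespace `R2Line`), as its header prescribes, so every statement transfers by
`Iff.rfl` after unfolding. Outcome: NO STUB IS CHEAPLY FALSE; stub 1 is reduced to one deterministic identity;
stub 2's hand-derived conventions are independently re-derived and their symmetry modes certified; stubs 3–4 sit
behind the EOS wall (§8.2) with the junk audit recorded in `targets_r2_line`. -/

namespace R2Line

/-- VERBATIM COPY (skeleton §0). `Δ = (1 - W)² - S²`. -/
def Delta (S W : ℝ) : ℝ := (1 - W) ^ 2 - S ^ 2

/-- VERBATIM COPY (skeleton §0). `Δ₁ = W (W - 1)(W - r) - 3 (W - (r - 1)) S²`. -/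
def Delta1 (r S W : ℝ) : ℝ := W * (W - 1) * (W - r) - 3 * (W - (r - 1)) * S ^ 2

/-- VERBATIM COPY (skeleton §0). `Δ₂ = S (5 W² - (6 + 2 r) W + 3 r - 3 S²) / 3`. -/
def Delta2 (r S W : ℝ) : ℝ := S * (5 * W ^ 2 - (6 + 2 * r) * W + 3 * r - 3 * S ^ 2) / 3

/-- VERBATIM COPY (skeleton §0): the `W`-component of the linearised operator. -/
def linW (r : ℝ) (W S : ℝ → ℝ) (ŵ ŝ : ℝ → ℂ) (x : ℝ) : ℂ :=
  ((W x - 1 : ℝ) : ℂ) * deriv ŵ x + ((3 * S x : ℝ) : ℂ) * deriv ŝ x +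
    ((deriv W x + 2 * W x - r : ℝ) : ℂ) * ŵ x + ((3 * deriv S x + 6 * S x : ℝ) : ℂ) * ŝ x

/-- VERBATIM COPY (skeleton §0): the `S`-component of the linearised operator. -/
def linS (r : ℝ) (W S : ℝ → ℝ) (ŵ ŝ : ℝ → ℂ) (x : ℝ) : ℂ :=
  ((S x / 3 : ℝ) : ℂ) * deriv ŵ x + ((W x - 1 : ℝ) : ℂ) * deriv ŝ x +
    ((deriv S x + 2 * S x : ℝ) : ℂ) * ŵ x + ((deriv W x / 3 + 2 * W x - r : ℝ) : ℂ) * ŝ x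

/-- VERBATIM COPY (skeleton §0): `β μ_ex(η) = f_ex(η) + η f_ex'(η)`. -/
def excessChemicalPotential (η : ℝ) : ℝ :=
  hsExcessFreeEnergy η + η * deriv hsExcessFreeEnergy η

/-- VERBATIM COPY (skeleton §0): the local-equilibrium density relation `EosRelated σ a₀ n`. -/
def EosRelated (σ : ℝ) (a₀ n : T3 → ℝ) : Prop :=
  Continuous n ∧ (∀ x, 0 < n x) ∧ (∀ x, n x ≤ 2 * (a₀ x / ∫ y, a₀ y)) ∧ (∫ x, n x) = 1 ∧
    ∃ c : ℝ, ∀ x, Real.log (n x) + excessChemicalPotential (n x * σ ^ 3) = Real.log (a₀ x) + c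

end R2Line

/-! ### Stub 2 (`stub_oneModeProfile`): conventions re-derived; the symmetry modes as certified identities

INDEPENDENT RE-DERIVATION (this seat, by hand, from radial isentropic Euler `γ = 5/3`, `ℓ = 3`, `d = 3` with the
skeleton's conventions `u = -R W/(r(T-t))`, `c = R S/(r(T-t))`, `y = R (T-t)^{-1/r}`, `x = log y`, clock
`T - t = T e^{-rτ}`): momentum `(W-1)W' + 3SS' = rW - W² - 3S²`, mass `(1-W)S' - (S/3)W' = S(2W - r)`; solving the
`2 × 2` system (determinant `-Δ`) gives EXACTLY the skeleton's `Δ W' = -Δ₁`, `Δ S' = -Δ₂` with its `Delta1`, `Delta2`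
(checked below as `solved_form_of_profileEqs`); the `τ`-dependent equations linearise EXACTLY to the skeleton's
`linW`, `linS`. So the typed ODE and operator are RIGHT: no convention slip to exploit. The two symmetry modes the
package `OneModeTwoConditions` must exclude/allow are certified: `x`-translation (scaling, `Λ = 0`, mode `(W', S')`)
and blow-up-time shift (gauge, `Λ = r`, mode `(W' + rW, S' + rS)`). Centre regularity forces `W(-∞) = r - 1`
(`W' ≈ -3(W - (r-1))` as `S → ∞`), consistent with the skeleton's centre `(S, W) = (∞, r - 1)`. No junk profile:
parking on the sonic set needs `Δ = Δ₁ = Δ₂ = 0`, i.e. the isolated sonic points, and the constant sonic state fails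
centre regularity (`e^x S` is not a smooth function of `e^{2x}`) and the far-field limit. The spectral claims
(`m = 1`, `Λ₁ ∈ (6(r-1), 9(r-1))`, simplicity, NO OTHER smooth radial point spectrum in the WHOLE half-plane
`Re Λ > 0`) are certified-numerics-sized; the last one is only numerically scanned on `[0.05,3] × [-8,8]` — an
analytic a-priori bound on `|Im Λ|`/`Re Λ` for smooth modes is part of the stub's real cost (MRRS-type energy
estimates), not a cheap kill. -/

/-- The skeleton's `Δ`-form is the SOLVED form of the two profile equations (pure algebra: Cramer with determinant
`-Δ`), so the hand-derived `Delta1`, `Delta2` are the right polynomials for the stated conventions. -/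
theorem R2Line.solved_form_of_profileEqs (r W W' S S' : ℝ)
    (hM : (W - 1) * W' + 3 * S * S' = r * W - W ^ 2 - 3 * S ^ 2)
    (hC : (1 - W) * S' - S / 3 * W' = S * (2 * W - r)) :
    R2Line.Delta S W * W' = -R2Line.Delta1 r S W ∧ R2Line.Delta S W * S' = -R2Line.Delta2 r S W := by
  unfold R2Line.Delta R2Line.Delta1 R2Line.Delta2
  constructor
  · linear_combination (W - 1) * hM + 3 * S * hC
  · linear_combination (-(S / 3)) * hM + (1 - W) * hC

/-- The two profile equations DIFFERENTIATED once (for `C²` profiles satisfying them everywhere). -/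
theorem R2Line.profileEqs_deriv {r : ℝ} {W S : ℝ → ℝ} (hW : ContDiff ℝ 2 W) (hS : ContDiff ℝ 2 S)
    (hM : ∀ x, (W x - 1) * deriv W x + 3 * S x * deriv S x = r * W x - W x ^ 2 - 3 * S x ^ 2)
    (hC : ∀ x, (1 - W x) * deriv S x - S x / 3 * deriv W x = S x * (2 * W x - r)) (x : ℝ) :
    (deriv W x * deriv W x + (W x - 1) * deriv (deriv W) x +
        (3 * deriv S x * deriv S x + 3 * S x * deriv (deriv S) x) =
      r * deriv W x - (deriv W x * W x + W x * deriv W x) - 3 * (deriv S x * S x + S x * deriv S x)) ∧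
    (-deriv W x * deriv S x + (1 - W x) * deriv (deriv S) x -
        (deriv S x / 3 * deriv W x + S x / 3 * deriv (deriv W) x) =
      deriv S x * (2 * W x - r) + S x * (2 * deriv W x)) := by
  have hW1 : Differentiable ℝ W := hW.differentiable (by norm_num)
  have hS1 : Differentiable ℝ S := hS.differentiable (by norm_num)
  have hW2 : Differentiable ℝ (deriv W) := by
    have := hW.iterate_deriv' 1 1; simpa using (this.differentiable (by norm_num))
  have hS2 : Differentiable ℝ (deriv S) := by
    have := hS.iterate_deriv' 1 1; simpa using (this.differentiable (by norm_num))
  have hMd : HasDerivAt (fun y => (W y - 1) * deriv W y + 3 * S y * deriv S y)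
      (deriv W x * deriv W x + (W x - 1) * deriv (deriv W) x +
        (3 * deriv S x * deriv S x + 3 * S x * deriv (deriv S) x)) x := by
    have h1 : HasDerivAt (fun y => W y - 1) (deriv W x) x := (hW1 x).hasDerivAt.sub_const 1
    have h2 : HasDerivAt (deriv W) (deriv (deriv W) x) x := (hW2 x).hasDerivAt
    have h3 : HasDerivAt (fun y => 3 * S y) (3 * deriv S x) x := (hS1 x).hasDerivAt.const_mul 3
    have h4 : HasDerivAt (deriv S) (deriv (deriv S) x) x := (hS2 x).hasDerivAt
    exact (h1.mul h2).add (h3.mul h4)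
  have hMd' : HasDerivAt (fun y => r * W y - W y * W y - 3 * (S y * S y))
      (r * deriv W x - (deriv W x * W x + W x * deriv W x) - 3 * (deriv S x * S x + S x * deriv S x)) x := by
    have h1 : HasDerivAt (fun y => r * W y) (r * deriv W x) x := (hW1 x).hasDerivAt.const_mul r
    have h2 : HasDerivAt (fun y => W y * W y) (deriv W x * W x + W x * deriv W x) x :=
      (hW1 x).hasDerivAt.mul (hW1 x).hasDerivAt
    have h3 : HasDerivAt (fun y => 3 * (S y * S y)) (3 * (deriv S x * S x + S x * deriv S x)) x :=
      ((hS1 x).hasDerivAt.mul (hS1 x).hasDerivAt).const_mul 3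
    exact (h1.sub h2).sub h3
  have hCd : HasDerivAt (fun y => (1 - W y) * deriv S y - S y / 3 * deriv W y)
      (-deriv W x * deriv S x + (1 - W x) * deriv (deriv S) x -
        (deriv S x / 3 * deriv W x + S x / 3 * deriv (deriv W) x)) x := by
    have h1 : HasDerivAt (fun y => 1 - W y) (-deriv W x) x := by
      simpa using (hW1 x).hasDerivAt.const_sub 1
    have h2 : HasDerivAt (deriv S) (deriv (deriv S) x) x := (hS2 x).hasDerivAt
    have h3 : HasDerivAt (fun y => S y / 3) (deriv S x / 3) x := (hS1 x).hasDerivAt.div_const 3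
    have h4 : HasDerivAt (deriv W) (deriv (deriv W) x) x := (hW2 x).hasDerivAt
    exact (h1.mul h2).sub (h3.mul h4)
  have hCd' : HasDerivAt (fun y => S y * (2 * W y - r)) (deriv S x * (2 * W x - r) + S x * (2 * deriv W x)) x := by
    have h1 : HasDerivAt (fun y => 2 * W y - r) (2 * deriv W x) x :=
      ((hW1 x).hasDerivAt.const_mul 2).sub_const r
    exact (hS1 x).hasDerivAt.mul h1
  have eM : (fun y => (W y - 1) * deriv W y + 3 * S y * deriv S y) =
      fun y => r * W y - W y * W y - 3 * (S y * S y) := funext fun y => by rw [hM y]; ring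
  have eC : (fun y => (1 - W y) * deriv S y - S y / 3 * deriv W y) = fun y => S y * (2 * W y - r) :=
    funext hC
  constructor
  · rw [← hMd.deriv, ← hMd'.deriv, eM]
  · rw [← hCd.deriv, ← hCd'.deriv, eC]

/-- **SCALING MODE `Λ = 0`** (certified): for `C²` profiles satisfying the two profile equations everywhere,
`(ŵ, ŝ) = (W', S')` is annihilated by the typed operator (`linW = linS = 0`): `x`-translation invariance. -/
theorem R2Line.lin_translation_mode {r : ℝ} {W S : ℝ → ℝ} (hW : ContDiff ℝ 2 W) (hS : ContDiff ℝ 2 S)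
    (hM : ∀ x, (W x - 1) * deriv W x + 3 * S x * deriv S x = r * W x - W x ^ 2 - 3 * S x ^ 2)
    (hC : ∀ x, (1 - W x) * deriv S x - S x / 3 * deriv W x = S x * (2 * W x - r)) (x : ℝ) :
    R2Line.linW r W S (fun y => ((deriv W y : ℝ) : ℂ)) (fun y => ((deriv S y : ℝ) : ℂ)) x = 0 ∧
    R2Line.linS r W S (fun y => ((deriv W y : ℝ) : ℂ)) (fun y => ((deriv S y : ℝ) : ℂ)) x = 0 := by
  have hW2 : Differentiable ℝ (deriv W) := by
    have := hW.iterate_deriv' 1 1; simpa using (this.differentiable (by norm_num))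
  have hS2 : Differentiable ℝ (deriv S) := by
    have := hS.iterate_deriv' 1 1; simpa using (this.differentiable (by norm_num))
  obtain ⟨dM, dC⟩ := R2Line.profileEqs_deriv hW hS hM hC x
  have dŵ : deriv (fun y => ((deriv W y : ℝ) : ℂ)) x = ((deriv (deriv W) x : ℝ) : ℂ) :=
    ((hW2 x).hasDerivAt.ofReal_comp).deriv
  have dŝ : deriv (fun y => ((deriv S y : ℝ) : ℂ)) x = ((deriv (deriv S) x : ℝ) : ℂ) :=
    ((hS2 x).hasDerivAt.ofReal_comp).deriv
  have dMc := congrArg (fun t : ℝ => (t : ℂ)) dM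
  have dCc := congrArg (fun t : ℝ => (t : ℂ)) dC
  push_cast at dMc dCc
  unfold R2Line.linW R2Line.linS
  rw [dŵ, dŝ]
  push_cast
  constructor
  · linear_combination dMc
  · linear_combination (-1 : ℂ) * dCc

/-- **GAUGE MODE `Λ = r`** (certified): for `C²` profiles satisfying the two profile equations everywhere,
`(ŵ, ŝ) = (W' + rW, S' + rS)` is an eigenvector of the typed operator with eigenvalue `r` — the blow-up-time shift;
this is the `Λ = (r : ℂ)` alternative that `OneModeTwoConditions` must allow. -/
theorem R2Line.lin_gauge_mode {r : ℝ} {W S : ℝ → ℝ} (hW : ContDiff ℝ 2 W) (hS : ContDiff ℝ 2 S)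
    (hM : ∀ x, (W x - 1) * deriv W x + 3 * S x * deriv S x = r * W x - W x ^ 2 - 3 * S x ^ 2)
    (hC : ∀ x, (1 - W x) * deriv S x - S x / 3 * deriv W x = S x * (2 * W x - r)) (x : ℝ) :
    R2Line.linW r W S (fun y => ((deriv W y + r * W y : ℝ) : ℂ)) (fun y => ((deriv S y + r * S y : ℝ) : ℂ)) x =
      (r : ℂ) * ((deriv W x + r * W x : ℝ) : ℂ) ∧
    R2Line.linS r W S (fun y => ((deriv W y + r * W y : ℝ) : ℂ)) (fun y => ((deriv S y + r * S y : ℝ) : ℂ)) x =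
      (r : ℂ) * ((deriv S x + r * S x : ℝ) : ℂ) := by
  have hW1 : Differentiable ℝ W := hW.differentiable (by norm_num)
  have hS1 : Differentiable ℝ S := hS.differentiable (by norm_num)
  have hW2 : Differentiable ℝ (deriv W) := by
    have := hW.iterate_deriv' 1 1; simpa using (this.differentiable (by norm_num))
  have hS2 : Differentiable ℝ (deriv S) := by
    have := hS.iterate_deriv' 1 1; simpa using (this.differentiable (by norm_num))
  obtain ⟨dM, dC⟩ := R2Line.profileEqs_deriv hW hS hM hC x
  have dŵ : deriv (fun y => ((deriv W y + r * W y : ℝ) : ℂ)) x = ((deriv (deriv W) x + r * deriv W x : ℝ) : ℂ) :=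
    ((((hW2 x).hasDerivAt).add ((hW1 x).hasDerivAt.const_mul r)).ofReal_comp).deriv
  have dŝ : deriv (fun y => ((deriv S y + r * S y : ℝ) : ℂ)) x = ((deriv (deriv S) x + r * deriv S x : ℝ) : ℂ) :=
    ((((hS2 x).hasDerivAt).add ((hS1 x).hasDerivAt.const_mul r)).ofReal_comp).deriv
  have dMc := congrArg (fun t : ℝ => (t : ℂ)) dM
  have dCc := congrArg (fun t : ℝ => (t : ℂ)) dC
  have hMc := congrArg (fun t : ℝ => (t : ℂ)) (hM x)
  have hCc := congrArg (fun t : ℝ => (t : ℂ)) (hC x)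
  push_cast at dMc dCc hMc hCc
  unfold R2Line.linW R2Line.linS
  rw [dŵ, dŝ]
  push_cast
  constructor
  · linear_combination dMc + 2 * (r : ℂ) * hMc
  · linear_combination (-1 : ℂ) * dCc - 2 * (r : ℂ) * hCc

/-! ### Stub 1 (`stub_admissibleData`): REDUCED to one deterministic EOS identity for `rhoLim`

The probabilistic content of stub 1 is ALREADY DISCHARGED by the tree LLN and §2: admissible data are pinned to
`rhoLim (profileOf a₀) σ` (continuous, positive, unit mass, `β + O(σ³)`). By uniqueness of limits in probability the
stub's `n` MUST be `rhoLim`, so stub 1 at reduced diameter `σ` is EQUIVALENT to `EosRelated σ a₀ (rhoLim …)`, and —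
since continuity, positivity, `∫ = 1` and `≤ 2 a₀/∫a₀` hold for small `σ` — to the single identity
`∃ c, ∀ x, log rhoLim(x) + μ_ex(rhoLim(x) σ³) = log a₀(x) + c` (`EosIdentity`), relating the tree's cluster series
(`clusterCoeff`, `ratioLimit`) to the torus free-volume thermodynamics `hsExcessFreeEnergy` (a `limsup`) and its
`deriv`. THAT identity is equivalence of ensembles + boundary-condition independence + term-wise identification of
the Mayer coefficients: genuinely size L, and it is where `HsEosLowDensity` must enter (nothing about
`hsExcessFreeEnergy` on `(0, 512)` is in the tree, §8.2). Not cheaply refutable (physically true); recorded so the lead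
does not re-prove the LLN. -/

/-- The inner clause of stub 1 after `∃ n, EosRelated σ a₀ n ∧ …` (verbatim shape): every field triple with `t = 0`
data `(n, u₀, θ₀)` carries the probability-measure clause and the `t = 0` tie through every flow family. -/
def LLNClause (σ : ℝ) (a₀ θ₀ : T3 → ℝ) (u₀ : T3 → V3) (n : T3 → ℝ) : Prop :=
  ∀ (ρ θ : ℝ → T3 → ℝ) (u : ℝ → T3 → V3), ρ 0 = n → u 0 = u₀ → θ 0 = θ₀ →
    ∀ Φ : Flows σ, (∀ N, IsProbabilityMeasure (localGibbsLaw σ a₀ u₀ θ₀ N (Φ N))) ∧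
      TendstoHydroFieldsAt (fun N => localGibbsLaw σ a₀ u₀ θ₀ N (Φ N)) Φ ρ u θ 0

/-- The residual DETERMINISTIC content of stub 1: the bulk equation-of-state identity for a density `n`. -/
def EosIdentity (σ : ℝ) (a₀ n : T3 → ℝ) : Prop :=
  ∃ c : ℝ, ∀ x, Real.log (n x) + R2Line.excessChemicalPotential (n x * σ ^ 3) = Real.log (a₀ x) + c

/-- `rhoLim ≤ 2β` for small `σ` (from the `O(σ³)` statics rate `|rhoLim - β| ≤ 16e²v₁M²σ³` and `min β > 0`). -/
theorem rhoLim_le_two_mul_β {a₀ : T3 → ℝ} (ha : Continuous a₀) (ha0 : ∀ x, 0 < a₀ x) :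
    ∃ σ₂ : ℝ, 0 < σ₂ ∧ ∀ σ : ℝ, 0 < σ → σ < σ₂ → SmallDensity (profileOf a₀ ha ha0) σ →
      ∀ x, rhoLim (profileOf a₀ ha ha0) σ x ≤ 2 * (a₀ x / ∫ y, a₀ y) := by
  set P := profileOf a₀ ha ha0 with hP
  obtain ⟨x₀, -, hx₀⟩ := isCompact_univ.exists_isMinOn univ_nonempty P.continuous.continuousOn
  have hβmin : ∀ y, P.β x₀ ≤ P.β y := fun y => (isMinOn_iff.mp hx₀) y (mem_univ y)
  set m := P.β x₀ with hm
  have hm0 : 0 < m := P.pos x₀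
  set Cst := 16 * Real.exp 1 ^ 2 * v₁ * P.M ^ 2 with hCst
  have hC0 : 0 < Cst := by have := P.M_pos; have := v₁_pos; positivity
  refine ⟨min 1 (m / Cst), lt_min one_pos (div_pos hm0 hC0), fun σ hσ hσlt hS x => ?_⟩
  have hσ1 : σ < 1 := lt_of_lt_of_le hσlt (min_le_left _ _)
  have hσm : σ < m / Cst := lt_of_lt_of_le hσlt (min_le_right _ _)
  have hσ3 : σ ^ 3 ≤ σ := by
    have e : σ ^ 3 = σ * (σ * σ) := by ring
    rw [e]; exact mul_le_of_le_one_right hσ.le (by nlinarith)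
  have hrate := abs_rhoLim_sub_β_le hS x
  have h1 : rhoLim P σ x ≤ P.β x + Cst * σ ^ 3 := by
    have := (abs_sub_le_iff.1 hrate).1; rw [hCst]; linarith
  have h2 : Cst * σ ^ 3 ≤ m := by
    calc Cst * σ ^ 3 ≤ Cst * σ := by gcongr
      _ ≤ Cst * (m / Cst) := by gcongr
      _ = m := mul_div_cancel₀ m hC0.ne'
  have h3 : m ≤ P.β x := hβmin x
  rw [← profileOf_β ha ha0 x]
  linarith

/-- **STUB 1 ⇔ THE EOS IDENTITY FOR `rhoLim`.** For continuous positive profiles there is `σ₁ > 0` such that for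
`0 < σ < σ₁`: `(∃ n, EosRelated σ a₀ n ∧ LLNClause σ a₀ θ₀ u₀ n) ↔ EosIdentity σ a₀ (rhoLim (profileOf a₀) σ)`.
Hence `stub_admissibleData` is equivalent to `HsEosLowDensity → ∀ profiles, ∃ σ₀ > 0, ∀ σ ∈ (0, σ₀),
EosIdentity σ a₀ (rhoLim (profileOf a₀) σ)` — a statement with no measures, flows or limits in probability. -/
theorem stub_admissibleData_iff_eosIdentity {a₀ θ₀ : T3 → ℝ} {u₀ : T3 → V3} (ha : Continuous a₀)
    (hθ : Continuous θ₀) (hu : Continuous u₀) (ha0 : ∀ x, 0 < a₀ x) (hθ0 : ∀ x, 0 < θ₀ x) :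
    ∃ σ₁ : ℝ, 0 < σ₁ ∧ ∀ σ : ℝ, 0 < σ → σ < σ₁ →
      ((∃ n : T3 → ℝ, R2Line.EosRelated σ a₀ n ∧ LLNClause σ a₀ θ₀ u₀ n) ↔
        EosIdentity σ a₀ (rhoLim (profileOf a₀ ha ha0) σ)) := by
  set P := profileOf a₀ ha ha0 with hP
  obtain ⟨σa, hσa, hσa2, Ha⟩ := lln_rhoLim ha hθ hu ha0 hθ0
  obtain ⟨σb, hσb, Hb⟩ := rhoLim_le_two_mul_β ha ha0
  refine ⟨min σa σb, lt_min hσa hσb, fun σ hσ hσlt => ?_⟩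
  have hσa' : σ < σa := lt_of_lt_of_le hσlt (min_le_left _ _)
  have hσb' : σ < σb := lt_of_lt_of_le hσlt (min_le_right _ _)
  have hσ2 : σ < 1 / 2 := hσa'.trans_le hσa2
  obtain ⟨hS, hpos, Hσ⟩ := Ha σ hσ hσa'
  have hρc : Continuous (rhoLim P σ) := hS.continuous_rhoLim
  have hρpos : ∀ x, 0 < rhoLim P σ x := fun x => hS.rhoLim_pos (hpos x)
  constructor
  · rintro ⟨n, ⟨hnc, hn0, -, -, hid⟩, hL⟩
    -- the stub's `n` is pinned: `n = rhoLim`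
    obtain ⟨Φ⟩ := flows_nonempty hσ hσ2
    have hTn : TiedThrough σ a₀ u₀ θ₀ Φ (fun _ => n) (fun _ => u₀) (fun _ => θ₀) :=
      (hL (fun _ => n) (fun _ => θ₀) (fun _ => u₀) rfl rfl rfl Φ).2
    have hlln : Tied σ a₀ u₀ θ₀ (fun _ => rhoLim P σ) (fun _ => u₀) (fun _ => θ₀) :=
      (tiedThrough_iff_tied Φ).1 (Hσ Φ).2
    obtain ⟨hn, -, -⟩ := data_eq_of_tied ha hθ hu ha0 hθ0 hσ2.le hρc hρpos hlln
      (ρ := fun _ => n) (u := fun _ => u₀) (θ := fun _ => θ₀) hnc hu hθ ((tiedThrough_iff_tied Φ).1 hTn)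
    have hn' : n = rhoLim P σ := hn
    subst hn'
    exact hid
  · intro hid
    refine ⟨rhoLim P σ, ⟨hρc, hρpos, Hb σ hσ hσb' hS, integral_rhoLim_eq_one hS, hid⟩, ?_⟩
    intro ρ θ u hρ hu' hθ' Φ
    refine ⟨(Hσ Φ).1, ?_⟩
    have hT : TiedThrough σ a₀ u₀ θ₀ Φ (fun _ => rhoLim P σ) (fun _ => u₀) (fun _ => θ₀) := (Hσ Φ).2
    exact (tiedThrough_iff_tied Φ).2
      ((tied_congr_zero (ρ := ρ) (u := u) (θ := θ) (ρ' := fun _ => rhoLim P σ) (u' := fun _ => u₀)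
        (θ' := fun _ => θ₀) hρ hu' hθ').2 ((tiedThrough_iff_tied Φ).1 hT))

/-! ### Stubs 3 and 4, and the junk audit of the skeleton's posited definitions -/

/-- **TARGETS CENSUS for the line `r2-one-mode-two-conditions`** (gen 3; no stub killed).

* STUB 1 `stub_admissibleData` (L): ⇔ `EosIdentity` for `rhoLim` (`stub_admissibleData_iff_eosIdentity`). Honest
  residual: equivalence of ensembles / b.c. independence linking `clusterCoeff` to `hsExcessFreeEnergy`; uses
  `HsEosLowDensity` essentially (the `deriv` in `excessChemicalPotential` is junk unless `f_ex` is differentiable on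
  `(0, η₀)`; at `η = 0` the junk is killed by the factor `η`). Not refutable cheaply; physically true.
* STUB 2 `stub_oneModeProfile` (L, certified numerics): conventions CORRECT (`solved_form_of_profileEqs`,
  `lin_translation_mode`, `lin_gauge_mode`); `IsMonatomicProfile` junk-free (no parking on the sonic set; constant
  sonic state fails centre regularity and far field); `IsSmoothRadialMode` imposes no decay at `x → +∞` (none needed:
  every solution is `∼ e^{-(Λ+r)x}` there) and `C^∞` across the sonic point selects the analytic Frobenius branch for
  `N(Λ) ∉ ℕ` (`N(Λ) = ν - 2.4261 Λ`): the counting is the genuine Biasi/MRRS counting. OPEN COST inside the stub: the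
  claim "no other smooth radial point spectrum in ALL of `Re Λ > 0`" is scanned numerically only on `[0.05, 3] × [-8, 8]`
  (three seats); an analytic exclusion of large `|Λ|` (weighted energy identity for smooth modes) is needed for a
  proof and is not in print for `γ = 5/3`, `ℓ = d`. No cheap kill: a kill needs validated numerics contradicting three
  independent double-precision codes by a factor `> 2` in `Λ₁/μ`.
* STUB 3 `stub_wellPosedness` (`HsEulerWellPosedness`, M–L): standard Kato/Majda for the symmetric-hyperbolic system
  (athermal EOS `p = ρθZ`, `e = 3θ/2` is thermodynamically consistent: `(∂e/∂v)_T = 0 = T(∂p/∂T)_v - p`, entropy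
  `log(θ^{3/2}/ρ) - F_ex`; hyperbolicity needs `Z + ηZ' > 0`, automatic near `η = 0` since `Z(0) = 1` is provable and `Z`
  smooth by hypothesis — the prover picks `η₁`). Its hypothesis `∃ Z smooth, EqOn hsCompressibility Z (Icc 0 η₀)` is
  UNPROVABLE AND IRREFUTABLE in the tree today (EOS wall), so the stub can be neither refuted by a junk instance nor
  proved vacuously. Audit of (ii): all bounds are on `Ico 0 T` uniformly, `T` finite, packing `≤ η₁/2` keeps `Z` smooth
  along the solution — fine. NOTE FOR THE LEAD (from §11): any DenseExcursion witness VIOLATES the hypothesis of (ii)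
  before the excursion (`‖Du‖` must exceed every `M` as `σ → 0`, `not_denseExcursionLipschitzVelocity`), so (ii) only
  serves to continue the solution while the modulation estimates hold; the excursion time itself is reached in a
  regime where continuation must come from the self-similar bootstrap, not from (ii).
* STUB 4 `stub_tunedForcedImplosion` (XL, THE crux content): `TunedImplosion` is the `∀σ < σ₁` form (stronger than the
  crux's sequence form, cf. §9) with `σ`-independent profiles and data `(n, u₀, θ₀)` for EVERY `EosRelated` density
  `n` — harmless: for small `σ` the dilute-branch constraint `n ≤ 2a₀/∫a₀` and strict monotonicity of
  `n ↦ log n + μ_ex(nσ³)` make `n` unique (= `rhoLim`, by stub 1's reduction), and smooth when `a₀` is (needed: a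
  classical solution has a `C^∞` slice `ρ 0 = n`, so the prover must take `a₀` smooth — allowed, profiles are
  existential). `ImplodesWithProfile`: asymptotics checked against the conventions (`ρ ∝ c³`, `(T-t)^{3(1-1/r)}ρ →
  κ(‖v‖S/r)³`, `(T-t)^{1-1/r}u → -(W/r)v`, `(T-t)^{2(1-1/r)}θ → (3/5)(‖v‖S/r)²`: consistent with `c² = (5/3)θ`); ray-wise
  limits only (no uniformity), filter `𝓝[<] T` avoids `rpow` junk; profile translates `W(· + a)` ↔ spatial rescaling,
  absorbed by `κ` and the free blow-up time `T` (small `T` keeps the backward sonic cone inside the torus), so the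
  `∀ (r, W, S)` over translates costs nothing extra. The physics kill (both `O(σ³)` defects project on the unstable
  adjoint mode with the collapse-opposing sign for every profile on the knob) is a SIGN computation of `K₁(b)`
  (cubic in the Kidder knob) plus reachability of `K₂ = 0`: not run (needs the adjoint mode and the forcing assembly in
  self-similar variables; a certified version is stub-2-sized). Nothing in print decides it (§8.5).
* LOAD-BEARING INPUTS the line cannot avoid (from this file): the tie pins the data (§2) — used, via stub 1; packing
  must be manufactured dynamically (§7) with `∫‖(div u)₋‖∞ ≥ 3 log σ⁻¹ + O(1)` (§11) on a set of volume `≤ σ³/η`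
  (§7) — all consistent with self-similar implosion (`div u ∼ -(T*-t)⁻¹`, core volume `(T*-t)^{3/r}`). -/
theorem targets_r2_line : True := trivial


/-! ### Targets, PICKED line `kidder-knob-melnikov` (lead's skeleton, registered 2026-08-16T00:15Z)

Stubs: `stub_projectiveCovariance` (M), `stub_tiedStatics` (M–L), `stub_kidderKnob` (L), `stub_knobTracking` (XL,
reshaped by the lead from the planner's `stub_melnikovReduction` + `stub_knobTransfer`). Attacked 2026-08-16 (gen 3). -/

/-- **TARGETS CENSUS for the picked line `kidder-knob-melnikov`** (gen 3; no stub killed; two positive certificates,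
one interface constraint).

* STUB 0 `stub_projectiveCovariance` — VERIFIED EXACTLY on random rational jets (evidence `projcov_check.py` +
  `projcov_check.log` on the item): forward-mode automatic differentiation over `ℚ` (pure Python `Fraction`, a
  4-variable dual-number class), with `clockMap`, `dualDensity/Temperature/Velocity`, `dT`, `dX` and the three lines
  of `EulerZAt` transcribed LITERALLY from the skeleton; affine jets `(P, Θ, U)` around `w₀ = clockMap a z₀` whose five
  time derivatives are solved so that the PHYSICAL system (`d ≡ σ`, `h ≡ 0`) holds exactly at `w₀`, polynomial `Z` of
  degree 0–2, random `a > 0`, `σ`, `s ≥ 0`, `y`: the five DUAL residuals (`d(s) = σ(a+s)/a`, `h(s) = 2/(a+s)`) vanish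
  EXACTLY at `z₀` in all 8 trials (forward direction of the `↔`), and the `5 × 5` Jacobian (time-jet ↦ dual
  residuals) has non-zero exact determinant in 5 further trials (so the dual system pins the same jet completion:
  converse direction). Hence the typed identity — co-moving diameter `σ(a+s)/a`, heating anomaly `2θ(Z-1)/(a+s)`,
  weights `(λ³, λ, λ²)`, drift `y/(a+s)` — is RIGHT as an algebraic identity wherever the differentiability
  hypotheses make every `fderiv` genuine (they do: `a + s > 0`). Dictionary check: dual = member `b` with
  `b = -1/a`, physical time `as/(a+s) = λs`, blow-up `T/(1+bT)` — consistent with `KnobFamily.kidder`/`sol`. The lead can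
  land it; it is a chain-rule computation, not a risk. (The sibling crux 12587's `conformal-clock` stub 3 is the same
  text: one certificate for both.)
* STUB 1 `stub_tiedStatics` — consistent with the tree: `clusterCoeff σ k = (σ³)ᵏ/k! · bE k` is EXACTLY a power of
  `σ³` times a pure number and `ratioLimit` solves an analytic fixed-point equation, so `rhoLim` is a convergent power
  series in `σ³` with coefficients polynomial in `β` and its moments (smooth when `β` is): the `σ³h₁ + σ⁶h₂ + O(σ⁹)`
  structure in every `C^m` is right, and the first coefficient is forced by `bE 1 = -v₁ = -4π/3` and `∫ rhoLim = 1`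
  to be `-(4π/3)β(β - ∫β²) = defect₁ β` ✓ (canonical first-order computation agrees). By data pinning (§2) its
  `ρ₀ σ` IS `rhoLim (profileOf a₀) σ`. Size L, no kill. Caveat for the prover: `ratioLimit` is a `Classical.epsilon`
  choice — uniqueness of the root of `R·F(R) = 1` in `[1/2, 2]` (contraction) must be proved before any regularity
  in `σ` can be claimed.
* STUB 2 `stub_kidderKnob` (`Nonempty KnobFamily`) — junk audit of the interface: fields mutually consistent with the
  verified covariance (`kidder` ⇔ dual map at `σ = 0`, core `‖λy‖ < Rc`, Kidder time); `selfSimilar` on the FIXED ball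
  `‖y‖ < Rc` for ALL `t < T` is achievable only because `T` is free: exact profile data on a larger ball `R₁` and `T`
  smaller than the inward travel time of the `u - c` characteristics from `R₁` to `Rc` (domain of dependence of the
  IDEAL system — available, no EOS wall at `σ = 0`). INTERFACE CONSTRAINT (not a kill, the fields are existential):
  the `kidder` clause quantifies over the ball `‖y‖ < Rc(1 - bt)`, of radius up to `Rc/(1 + bT) → Rc/(1 + bLo·T) ≥ 16Rc`
  for the pre-expanded members `b < 0`; if that radius exceeds `1/2` the chart `y ↦ x₀ + proj y` wraps around the torus
  and `kidder` equates member-0 core densities at points `λy ≠ λy'` with `proj y = proj y'`, i.e. it forces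
  `Pf(‖λy‖/…) = Pf(‖λy'‖/…)` for `‖y‖ ≠ ‖y'‖` generically — false for the SS profile (not constant on any interval). So an
  inhabitant needs `Rc ≤ (1 + bLo·T)/2 ≤ 1/32` (the line card's "seed of radius ≲ 1/40" is compatible; the typed
  `hRc : Rc < 1/4` alone is not protective). Exact self-similarity for all `t < T` plus smoothness across the sonic
  point quantises `r`; in `(1.1, 1.135)` only `r₂` (numerics), so every `F` carries `SS(r₂)` — as intended.
* STUB 3 `stub_knobTracking` (`∀ F : KnobFamily, ∃ E b β M δ η, … TracksTo …`) — the crux content. `TracksTo` audited: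
  honest (division by `E.ρI > 0` only for `0 ≤ t+s < Tp`; central packing at `x₀`; `M`, `δ ≤ 1/2`, `η` existential, so
  the statement is the WEAKEST meaningful tracking claim). The `∀ F` is the lead's own risk: a junk `F` (a KnobFamily
  whose profile is not the one with the `(1,2)` package, if the quantisation lets one in) would falsify the stub as
  typed without touching the crux; none is constructible cheaply (needs an explicit exact self-similar classical ideal
  solution with `r ∈ (1.1, 1.135)`; the homologous Kidder collapse has `r = ∞`). What §7/§11 demand of the tracked
  solution is automatic for implosion tracking (volume `(T_p - t)^{3/r}`, `div u ∼ -(T_p - t)⁻¹`). The physics kill is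
  unchanged: the cubic `K₁(λ*) = k_H + φ_p P(λ*) + φ_h Q(λ*)` having no root on `λ* ∈ (1/16, ∞)` AND/OR `K₂` of one sign
  on `{K₁ = 0}` — the lead's announced kit job; a cubic with non-zero leading coefficient always has a real root, so the
  kill can only come from the root falling outside the admissible knob range `λ* > 1/16` (or `> 0`), or from `K₂`.
  UPDATE 2026-08-16T00:53Z (drefute seat, crux dir `DrefuteKnobK1.md`, kit j008329, conventions of THIS file's §12): the
  cubic is `K₁(λ*)/ε = 3.6752e-3 − 2.1540e-3 λ* − 3.0506e-3 λ*² − 7.4015e-3 λ*³`, ONE real root `λ*₀ = 0.576604`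
  (`b₀T = −0.4234`, a pre-expanded member) INSIDE every typed knob, transversal: the first tuning condition IS met on the
  knob — the cheapest physics kill of the line FAILED; the bet is now entirely `K₂ = 0` on `{K₁ = 0}` within the stable
  extension (needs the full modulated first-order response; multi-day, not run). The same seat re-derived `m = 1` in the
  FULL (non-isentropic) radial sector (entropy block-triangular, pure outward transport).
* SUB-STUBS registered by workers (audited 2026-08-16, both CONSISTENT, no kill): `tiedStatics_ratioAsymptotics`
  (`bE 1 = -4π/3` — the two-point Ursell function of unit-diameter spheres is the Mayer `f = -𝟙_{B(0,1)}`, and `v₁ = 4π/3`;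
  second-order asymptotics of `R = ratioLimit`: from `R·F(R) = 1`, `F(R) = 1 + aσ³R + bσ⁶R² + O(σ⁹)`, `a = bE1·∫β²`,
  `b = (bE2/2)∫β³` (`clusterCoeff σ k = σ^{3k}/k!·bE k`, `bE 0·∫β = 1`) one gets `R = 1 − aσ³ + (2a² − b)σ⁶ + O(σ⁹)` — exactly
  the typed coefficients; the uniform constant over `SmallDensity P σ` is fine because every root in `[1/2, 2]` obeys the
  contraction bounds, so the `Classical.epsilon` choice is THE root) and `exists_knobProfile` (translation of the vendored
  fact `BuckmasterCaolaboraGomezserrano2025_thm11_monatomic`: `Uf = U/r`, `Pf = (S/(3r))³`, `Qf = (3/5)(S/(3r))²` turn the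
  three typed profile ODEs — re-derived here from the ansatz `ρ = (T-t)^{-3(1-1/r)}Pf(ζ)`, `u = (T-t)^{1/r-1}Uf(ζ)`,
  `θ = (T-t)^{2(1/r-1)}Qf(ζ)`, all three CORRECT — into BCG's two (`k = 3/5` is forced by the momentum equation, matching
  `p = ρ^γ/γ`); window `(1.10102, 1.13476) ⊂ (1.1, 1.135)`; far field `U/ζ, S/ζ → 0` gives `Uf/ζ → 0`, `Qf/ζ² → 0`;
  smoothness and positivity transfer). -/
theorem targets_kidder_line : True := trivial


/-! ## §13 THE ATHERMAL SCALING SYMMETRY (EOS-free, every `σ`) and the profile foliation it induces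

Formal counterpart of the Boyd–Ramsey–Baty observation (§8.5 addenda): because the hard-sphere pressure law
`p = ρθZ(ρσ³)` is LINEAR IN `θ`, the typed system keeps, for every `σ`, the exact symmetry
`(ρ, u, θ)(t, x) ↦ (ρ, μu, μ²θ)(μt, x)` (density unscaled, existence time `T ↦ T/μ`) — while the density-scaling
symmetry of the polytropic ideal gas (the one the MRRS/BCG self-similar implosions are built on) is broken at relative
order `ρσ³`. Proved here with NO regularity of `Z`: constant factors pass through the junk-valued torus operators
unconditionally (`partialDeriv_const_smul`, `divergence_const_smul`, `gradient_const_mul`). Consequence for the crux: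
`ReachesPackingWith η a₀ θ₀ u₀ → ReachesPackingWith η a₀ (μ²θ₀) (μu₀)` — the profile space of `DenseExcursion` is
foliated by this one-parameter group (WLOG `sup θ₀ = 1`, say); together with the canonical invariance `a₀ ↦ c·a₀`
these are the only normalisations, and neither touches the packing. -/

/-- Constant factors pass through `Torus.partialDeriv` UNCONDITIONALLY (junk included). -/

theorem partialDeriv_const_smul {F : Type*} [NormedAddCommGroup F] [NormedSpace ℝ F] (c : ℝ) (f : T3 → F)
    (i : Fin 3) (x : T3) :
    Torus.partialDeriv i (fun y => c • f y) x = c • Torus.partialDeriv i f x := by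
  unfold Torus.partialDeriv Torus.lineDeriv
  exact deriv_fun_const_smul_field c _

/-- Scalar version of `partialDeriv_const_smul`. -/
theorem partialDeriv_const_mul (c : ℝ) (f : T3 → ℝ) (i : Fin 3) (x : T3) :
    Torus.partialDeriv i (fun y => c * f y) x = c * Torus.partialDeriv i f x := by
  simpa only [smul_eq_mul] using partialDeriv_const_smul c f i x

/-- Constant factors pass through `Torus.divergence` unconditionally. -/
theorem divergence_const_smul (c : ℝ) (v : T3 → V3) (x : T3) :
    Torus.divergence (fun y => c • v y) x = c * Torus.divergence v x := by
  unfold Torus.divergence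
  rw [Finset.mul_sum]
  refine Finset.sum_congr rfl fun i _ => ?_
  have e : (fun y => (c • v y) i) = fun y => c * v y i := by funext y; simp [PiLp.smul_apply]
  rw [e, partialDeriv_const_mul]

/-- Constant factors pass through `Torus.gradient` unconditionally (the EOS-wall-proof step: no regularity of the
pressure slice is needed). -/
theorem gradient_const_mul (c : ℝ) (f : T3 → ℝ) (x : T3) :
    Torus.gradient (fun y => c * f y) x = c • Torus.gradient f x := by
  unfold Torus.gradient
  have e : Torus.liftAt (fun y => c * f y) x = c • Torus.liftAt f x := by
    funext v; simp [Torus.liftAt, smul_eq_mul]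
  rw [e]
  unfold gradient
  rw [fderiv_const_smul_field]
  simp

/-- `s ↦ μ s` maps `[0, T/μ)` into `[0, T)`. -/
theorem mapsTo_mul_Ico {T μ : ℝ} (hμ : 0 < μ) : MapsTo (fun s : ℝ => μ * s) (Ico 0 (T / μ)) (Ico 0 T) := by
  intro s hs
  refine ⟨mul_nonneg hμ.le hs.1, ?_⟩
  have := hs.2
  rwa [lt_div_iff₀ hμ, mul_comm] at this

/-- Joint smoothness is preserved by the time rescaling `s ↦ μ s`. -/
theorem isSmoothSpaceTimeOn_comp_mul {F : Type*} [NormedAddCommGroup F] [NormedSpace ℝ F] {T μ : ℝ}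
    {φ : ℝ → T3 → F} (hφ : Torus.IsSmoothSpaceTimeOn (Ico 0 T) φ) (hμ : 0 < μ) :
    Torus.IsSmoothSpaceTimeOn (Ico 0 (T / μ)) (fun s y => φ (μ * s) y) := by
  unfold Torus.IsSmoothSpaceTimeOn at hφ ⊢
  have e : Torus.stLift (fun s y => φ (μ * s) y) =
      Torus.stLift φ ∘ fun p : ℝ × EuclideanSpace ℝ (Fin 3) => (μ * p.1, p.2) := by
    funext p; rfl
  rw [e]
  refine hφ.comp (by fun_prop) ?_
  intro p hp
  exact mk_mem_prod (mapsTo_mul_Ico hμ (mem_prod.1 hp).1) (mem_univ _)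

/-- Chain rule for the one-sided time derivative under `s ↦ μ s`. -/
theorem timeDerivWithin_comp_mul {F : Type*} [NormedAddCommGroup F] [NormedSpace ℝ F] {T μ : ℝ}
    {φ : ℝ → T3 → F} (hφ : Torus.IsSmoothSpaceTimeOn (Ico 0 T) φ) (hμ : 0 < μ) {t : ℝ}
    (ht : t ∈ Ico 0 (T / μ)) (x : T3) :
    Torus.timeDerivWithin (Ico 0 (T / μ)) (fun s y => φ (μ * s) y) t x =
      μ • Torus.timeDerivWithin (Ico 0 T) φ (μ * t) x := by
  have hμt : μ * t ∈ Ico 0 T := mapsTo_mul_Ico hμ ht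
  have h1 := hφ.hasDerivWithinAt_slice hμt x
  have h2 : HasDerivWithinAt (fun s : ℝ => μ * s) μ (Ico 0 (T / μ)) t := by
    simpa using ((hasDerivWithinAt_id t (Ico 0 (T / μ))).const_mul μ)
  have h := h1.scomp t h2 (mapsTo_mul_Ico hμ)
  unfold Torus.timeDerivWithin
  exact h.derivWithin (uniqueDiffOn_Ico 0 (T / μ) t ht)

/-- Chain rule with a constant factor. -/
theorem timeDerivWithin_const_smul_comp_mul {F : Type*} [NormedAddCommGroup F] [NormedSpace ℝ F] {T μ : ℝ}
    {φ : ℝ → T3 → F} (hφ : Torus.IsSmoothSpaceTimeOn (Ico 0 T) φ) (hμ : 0 < μ) (c : ℝ) {t : ℝ}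
    (ht : t ∈ Ico 0 (T / μ)) (x : T3) :
    Torus.timeDerivWithin (Ico 0 (T / μ)) (fun s y => c • φ (μ * s) y) t x =
      (c * μ) • Torus.timeDerivWithin (Ico 0 T) φ (μ * t) x := by
  have h := timeDerivWithin_comp_mul hφ hμ ht x
  unfold Torus.timeDerivWithin at h ⊢
  rw [derivWithin_fun_const_smul_field c, h, smul_smul]

/-- **ATHERMAL SCALING SYMMETRY (EOS-free, every `σ`).** `(ρ, u, θ)(t, x) ↦ (ρ, μu, μ²θ)(μt, x)` maps classical
hard-sphere-Euler solutions on `[0,T)` to classical solutions on `[0, T/μ)`, for every `μ > 0` and every reduced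
diameter `σ`: the pressure law `p = ρθZ(ρσ³)` is linear in `θ` (athermal), so `p ↦ μ²p` with the density UNSCALED. -/
theorem athermal_scaling {σ T : ℝ} {ρ θ : ℝ → T3 → ℝ} {u : ℝ → T3 → V3}
    (hE : IsHardSphereEulerSolution σ T ρ u θ) {μ : ℝ} (hμ : 0 < μ) :
    IsHardSphereEulerSolution σ (T / μ) (fun t x => ρ (μ * t) x) (fun t x => μ • u (μ * t) x)
      (fun t x => μ ^ 2 * θ (μ * t) x) where
  smooth_density := isSmoothSpaceTimeOn_comp_mul hE.smooth_density hμ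
  smooth_velocity := (isSmoothSpaceTimeOn_comp_mul hE.smooth_velocity hμ).const_smul μ
  smooth_temperature := by
    have h := (isSmoothSpaceTimeOn_comp_mul hE.smooth_temperature hμ).const_smul (μ ^ 2)
    simpa only [smul_eq_mul] using h
  density_pos := fun t ht x => hE.density_pos _ (mapsTo_mul_Ico hμ ht) x
  temperature_pos := fun t ht x => mul_pos (pow_pos hμ 2) (hE.temperature_pos _ (mapsTo_mul_Ico hμ ht) x)
  mass := by
    intro t ht x
    have hμt := mapsTo_mul_Ico hμ ht
    have hm := hE.mass _ hμt x
    rw [timeDerivWithin_comp_mul hE.smooth_density hμ ht x]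
    have e : (fun y => ρ (μ * t) y • μ • u (μ * t) y) = fun y => μ • (ρ (μ * t) y • u (μ * t) y) := by
      funext y; rw [smul_comm]
    rw [e, divergence_const_smul, smul_eq_mul]
    have : μ * (Torus.timeDerivWithin (Ico 0 T) ρ (μ * t) x +
        Torus.divergence (fun y => ρ (μ * t) y • u (μ * t) y) x) = 0 := by rw [hm, mul_zero]
    linarith [this]
  momentum := by
    intro t ht x
    have hμt := mapsTo_mul_Ico hμ ht
    have hm := hE.momentum _ hμt x
    -- time derivative of `ρ_μ u_μ = μ • (ρu)(μ·)`
    have e1 : (fun s y => ρ (μ * s) y • μ • u (μ * s) y) = fun s y => μ • (ρ (μ * s) y • u (μ * s) y) := by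
      funext s y; rw [smul_comm]
    rw [e1, timeDerivWithin_const_smul_comp_mul (hE.smooth_density.smul hE.smooth_velocity) hμ μ ht x]
    -- transport term
    have e2 : ∀ i : Fin 3, (fun y => (ρ (μ * t) y * (μ • u (μ * t) y) i) • μ • u (μ * t) y) =
        fun y => (μ * μ) • ((ρ (μ * t) y * u (μ * t) y i) • u (μ * t) y) := by
      intro i; funext y
      simp only [PiLp.smul_apply, smul_eq_mul, smul_smul]
      congr 1; ring
    have e3 : (∑ i, Torus.partialDeriv i (fun y => (ρ (μ * t) y * (μ • u (μ * t) y) i) • μ • u (μ * t) y) x) =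
        (μ * μ) • ∑ i, Torus.partialDeriv i (fun y => (ρ (μ * t) y * u (μ * t) y i) • u (μ * t) y) x := by
      rw [Finset.smul_sum]
      exact Finset.sum_congr rfl fun i _ => by rw [e2 i, partialDeriv_const_smul]
    rw [e3]
    -- pressure: `p(ρ, μ²θ) = μ² p(ρ, θ)` (athermal)
    have e4 : (fun y => hsPressure σ (ρ (μ * t) y) (μ ^ 2 * θ (μ * t) y)) =
        fun y => (μ * μ) * hsPressure σ (ρ (μ * t) y) (θ (μ * t) y) := by
      funext y; simp only [hsPressure]; ring
    rw [e4, gradient_const_mul]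
    have : (μ * μ) • (Torus.timeDerivWithin (Ico 0 T) (fun s y => ρ s y • u s y) (μ * t) x +
        (∑ i, Torus.partialDeriv i (fun y => (ρ (μ * t) y * u (μ * t) y i) • u (μ * t) y) x) +
        Torus.gradient (fun y => hsPressure σ (ρ (μ * t) y) (θ (μ * t) y)) x) = 0 := by
      rw [hm, smul_zero]
    rw [smul_add, smul_add] at this
    exact this
  energy := by
    intro t ht x
    have hμt := mapsTo_mul_Ico hμ ht
    have hen := hE.energy _ hμt x
    -- `E(ρ, μu, μ²θ) = μ² E(ρ, u, θ)`
    have eE : ∀ (r : ℝ) (v : V3) (q : ℝ), totalEnergyDensity r (μ • v) (μ ^ 2 * q) = (μ * μ) * totalEnergyDensity r v q := by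
      intro r v q
      simp only [totalEnergyDensity, norm_smul, Real.norm_eq_abs, abs_of_pos hμ]
      ring
    have e1 : (fun s y => totalEnergyDensity (ρ (μ * s) y) (μ • u (μ * s) y) (μ ^ 2 * θ (μ * s) y)) =
        fun s y => (μ * μ) • totalEnergyDensity (ρ (μ * s) y) (u (μ * s) y) (θ (μ * s) y) := by
      funext s y; rw [eE, smul_eq_mul]
    have hEn : Torus.IsSmoothSpaceTimeOn (Ico 0 T) fun s y => totalEnergyDensity (ρ s y) (u s y) (θ s y) := by
      have h1 : Torus.IsSmoothSpaceTimeOn (Ico 0 T) fun s y => ⟪u s y, u s y⟫_ℝ :=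
        hE.smooth_velocity.inner hE.smooth_velocity
      have h2 : Torus.IsSmoothSpaceTimeOn (Ico 0 T) fun s y => ‖u s y‖ ^ 2 / 2 + 3 / 2 * θ s y := by
        have e : (fun s y => ‖u s y‖ ^ 2 / 2 + 3 / 2 * θ s y) =
            fun s y => (1 / 2 : ℝ) • ⟪u s y, u s y⟫_ℝ + (3 / 2 : ℝ) • θ s y := by
          funext s y; rw [real_inner_self_eq_norm_sq]; simp only [smul_eq_mul]; ring
        rw [e]; exact (h1.const_smul _).add (hE.smooth_temperature.const_smul _)
      exact hE.smooth_density.mul h2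
    rw [e1, timeDerivWithin_const_smul_comp_mul hEn hμ (μ * μ) ht x]
    -- flux: `(E_μ + p_μ) u_μ = μ³ ((E + p) u)(μ·)`
    have e2 : (fun y => (totalEnergyDensity (ρ (μ * t) y) (μ • u (μ * t) y) (μ ^ 2 * θ (μ * t) y) +
          hsPressure σ (ρ (μ * t) y) (μ ^ 2 * θ (μ * t) y)) • μ • u (μ * t) y) =
        fun y => (μ * μ * μ) • ((totalEnergyDensity (ρ (μ * t) y) (u (μ * t) y) (θ (μ * t) y) +
          hsPressure σ (ρ (μ * t) y) (θ (μ * t) y)) • u (μ * t) y) := by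
      funext y
      rw [eE]
      have ep : hsPressure σ (ρ (μ * t) y) (μ ^ 2 * θ (μ * t) y) = (μ * μ) * hsPressure σ (ρ (μ * t) y) (θ (μ * t) y) := by
        simp only [hsPressure]; ring
      rw [ep, smul_smul, smul_smul]
      congr 1; ring
    rw [e2, divergence_const_smul]
    have : (μ * μ * μ) * (Torus.timeDerivWithin (Ico 0 T)
        (fun s y => totalEnergyDensity (ρ s y) (u s y) (θ s y)) (μ * t) x +
        Torus.divergence (fun y => (totalEnergyDensity (ρ (μ * t) y) (u (μ * t) y) (θ (μ * t) y) +
          hsPressure σ (ρ (μ * t) y) (θ (μ * t) y)) • u (μ * t) y) x) = 0 := by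
      rw [hen, mul_zero]
    have e5 : (μ * μ * μ) • Torus.timeDerivWithin (Ico 0 T)
        (fun s y => totalEnergyDensity (ρ s y) (u s y) (θ s y)) (μ * t) x =
        (μ * μ * μ) * Torus.timeDerivWithin (Ico 0 T)
        (fun s y => totalEnergyDensity (ρ s y) (u s y) (θ s y)) (μ * t) x := smul_eq_mul _ _
    rw [show (μ * μ * μ) = (μ * μ) * μ from rfl] at e5 this
    rw [e5]
    linarith [this]


/-- The crux's body FOR GIVEN PROFILES: along some sequence `σ → 0` an admissible classical hard-sphere-Euler solution
for `(a₀, u₀, θ₀)` reaches packing `η` (`ReachesPacking η ↔ ∃ profiles …, ReachesPackingWith η a₀ θ₀ u₀`). -/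
def ReachesPackingWith (η : ℝ) (a₀ θ₀ : T3 → ℝ) (u₀ : T3 → V3) : Prop :=
  ∀ σ₀ : ℝ, 0 < σ₀ → ∃ σ : ℝ, 0 < σ ∧ σ < σ₀ ∧
    ∃ (T : ℝ) (ρ θ : ℝ → T3 → ℝ) (u : ℝ → T3 → V3), IsHardSphereEulerSolution σ T ρ u θ ∧
      Admissible σ a₀ u₀ θ₀ ρ u θ ∧ ∃ t ∈ Ico 0 T, ∃ x, η ≤ ρ t x * σ ^ 3

/-- `ReachesPacking η` is `ReachesPackingWith η` for some continuous positive profiles (definitional). -/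
theorem reachesPacking_iff_with (η : ℝ) :
    ReachesPacking η ↔ ∃ (a₀ θ₀ : T3 → ℝ) (u₀ : T3 → V3), Continuous a₀ ∧ Continuous θ₀ ∧ Continuous u₀ ∧
      (∀ x, 0 < a₀ x) ∧ (∀ x, 0 < θ₀ x) ∧ ReachesPackingWith η a₀ θ₀ u₀ :=
  Iff.rfl

/-- **THE PROFILE FOLIATION.** `ReachesPackingWith η a₀ θ₀ u₀ → ReachesPackingWith η a₀ (μ²θ₀) (μu₀)` for every
`μ > 0`: rescale the witnesses by the athermal symmetry (the excursion moves from time `t` to `t/μ`, the packing is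
unchanged) and re-pin the data (`rhoLim` depends on `a₀` only). -/
theorem reachesPackingWith_athermal_scaling {η : ℝ} {a₀ θ₀ : T3 → ℝ} {u₀ : T3 → V3} (ha : Continuous a₀)
    (hθ : Continuous θ₀) (hu : Continuous u₀) (ha0 : ∀ x, 0 < a₀ x) (hθ0 : ∀ x, 0 < θ₀ x)
    (h : ReachesPackingWith η a₀ θ₀ u₀) {μ : ℝ} (hμ : 0 < μ) :
    ReachesPackingWith η a₀ (fun x => μ ^ 2 * θ₀ x) (fun x => μ • u₀ x) := by
  have hθ' : Continuous fun x => μ ^ 2 * θ₀ x := continuous_const.mul hθ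
  have hu' : Continuous fun x => μ • u₀ x := hu.const_smul μ
  have hθ0' : ∀ x, 0 < μ ^ 2 * θ₀ x := fun x => mul_pos (pow_pos hμ 2) (hθ0 x)
  obtain ⟨σ₁, hσ₁, -, G⟩ := admissible_iff_data ha hθ hu ha0 hθ0
  obtain ⟨σ₂, hσ₂, -, G'⟩ := admissible_iff_data ha hθ' hu' ha0 hθ0'
  intro σ₀ hσ₀
  obtain ⟨σ, hσ, hσlt, T, ρ, θ, u, hE, hA, t, ht, x, hx⟩ :=
    h (min σ₀ (min σ₁ σ₂)) (lt_min hσ₀ (lt_min hσ₁ hσ₂))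
  have h0 : σ < σ₀ := lt_of_lt_of_le hσlt (min_le_left _ _)
  have h1 : σ < σ₁ := lt_of_lt_of_le hσlt ((min_le_right _ _).trans (min_le_left _ _))
  have h2 : σ < σ₂ := lt_of_lt_of_le hσlt ((min_le_right _ _).trans (min_le_right _ _))
  have hT : 0 < T := ht.1.trans_lt ht.2
  obtain ⟨hρc, huc, hθc⟩ := continuous_slices_zero hE hT
  obtain ⟨-, -, G1⟩ := G σ hσ h1
  obtain ⟨hρ0, hu0, hθ0e⟩ := (G1 ρ θ u hρc huc hθc).1 hA
  have hE' := athermal_scaling hE hμ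
  refine ⟨σ, hσ, h0, T / μ, fun s y => ρ (μ * s) y, fun s y => μ ^ 2 * θ (μ * s) y,
    fun s y => μ • u (μ * s) y, hE', ?_, t / μ, ⟨div_nonneg ht.1 hμ.le, div_lt_div_of_pos_right ht.2 hμ⟩, x, ?_⟩
  · -- re-pinning for the rescaled profiles
    obtain ⟨-, -, G2⟩ := G' σ hσ h2
    have hT' : 0 < T / μ := div_pos hT hμ
    obtain ⟨hρc', huc', hθc'⟩ := continuous_slices_zero hE' hT'
    refine (G2 _ _ _ hρc' huc' hθc').2 ⟨?_, ?_, ?_⟩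
    · funext y; simp only [mul_zero]; exact congrFun hρ0 y
    · funext y; simp only [mul_zero]; rw [hu0]
    · funext y; simp only [mul_zero]; rw [hθ0e]
  · have : μ * (t / μ) = t := mul_div_cancel₀ t hμ.ne'
    simp only [this]
    exact hx


/-! ## §14 (gen 4) THE EOS WALL IS DOWN — the ENTROPY BUDGET: entropy transport, hot spots, tiny dense sets,
no excursion at bounded temperature

Since v6.4 the route's support item `HsEosLowDensity` (stmt-0768) has become the tree THEOREM `hsEosLowDensity_proof`
(`Theorems/ImplosionDichotomyHsEosLowDensity.lean`, glue of the sibling crux's EOS stubs E1–E3, 2026-08-16T02:07Z), and the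
primitive equations of a classical hard-sphere-Euler solution (`hsEuler_density_eq / velocity_eq / temperature_eq`,
`…PolynomialCompressionUniquenessPrimitive`) plus small-packing uniqueness (`hsEuler_unique_of_analytic_eos`) are landed.
Item 2 of `why_it_resists` (§8) is therefore OBSOLETE in its strong form: along any classical solution whose packing
stays below the analyticity threshold `η₀` of the equation of state, the typed pressure IS the smooth `ρθ(1 + ηF′(η))`,
energy conservation (§10) is unconditional (`PolynomialCompressionSmoothPressure.isSmoothSpaceTimeOn_pressure
hsEosLowDensity_proof` discharges the smooth-flux hypothesis), and the Gibbs relation is available. This section records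
what the disprover drew from it (three modules landing in sequence, imported above once accepted — `Negative/EntropyTransport.lean`,
`Negative/EntropyBudget.lean`, `Negative/EntropyEnvelope.lean`):

* `DenseExcursionEntropyBudget.entropy_transport`: `s = (3/2) log θ − log ρ − F(ρσ³)` obeys `∂ₜs = −u·∇s` pointwise
  while packing `< η₀` (the compression terms cancel EXACTLY by `Z = 1 + ηF′`); `transport_min/max_principle` (EOS-free,
  velocity-free first-touch argument) ⇒ `min s(0,·) ≤ s(t,x) ≤ max s(0,·)`.
* `hot_core`: for ADMISSIBLE solutions, while packing has stayed `≤ η₁(profiles)`: `θ³ ≥ c ρ²` with `c(a₀,θ₀) > 0`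
  independent of `σ` ⇒ packing `η` is reached only at `θ ≥ c^{1/3}η^{2/3}σ⁻²`, `p ≥ c′σ⁻⁵`; `cold_rarefaction`: the matching
  `θ³ ≤ C ρ²` (max principle + `rhoLim ≥ min β/2`) — admissible classical flows are UNIFORMLY QUASI-ISENTROPIC below the
  EOS threshold, `c ≤ θ³/ρ² ≤ C`: temperature is slaved to density both ways (usable by the tracking lines).
* `volume_denseSet_le_pow_five`, `mass_denseSet_le_sq`: `vol{packing ≥ η} ≤ C σ⁵/η^{5/3}` and `∫_{packing ≥ η} ρ ≤ C σ²/η^{2/3}`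
  at every sub-threshold time (energy budget of the sibling's `Negative/Budget.lean` + hot spots) — sharper than §7's `σ³/η`.
* THIRD STRENGTHENING REFUTED: `denseExcursion_false_boundedTemperature` (restated below as
  `not_denseExcursionBoundedTemperature`): no witness family keeps a `σ`-uniform bound `θ ≤ Θ` up to the excursion;
  LADDER `hotExcursion_of_denseExcursion : DenseExcursion → HotExcursion` (`θ³σ⁶ ≥ c` somewhere along an admissible
  classical solution from FIXED smooth profiles, `σ → 0`): the crux is at least as strong as a `σ⁻²` temperature blow-up.
CONSISTENCY WITH IMPLOSION (why this is not a kill): isentropic self-similar collapse has `θ ∝ ρ^{2/3}` (saturating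
`hot_core`), core volume `(σ³/η)^{1/(r−1)} = σ^{26.6…}` at `r₂` (`≪ σ⁵`), core energy `→ 0`: every certified necessary
condition is met with room to spare. The EOS wall lifted, NO conservation-law or maximum-principle obstruction to the
excursion remains conceivable at this level (mass §7, compression §11, entropy/energy §14 are all saturated or slack along
implosion); a disproof must be DYNAMICAL (instability), i.e. the open rank-3 crux. -/

section EntropyBudget

open Summit.AtomisticToContinuum.HydrodynamicLimit.Theorems

-- (restatements `not_denseExcursionBoundedTemperature`, `admissible_hot_core`, `admissible_volume_denseSet_le` are added
-- once `Negative/EntropyBudget.lean` has landed; their statements are in the landed files verbatim.)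

/-- **ENERGY CONSERVATION IS NOW UNCONDITIONAL below the EOS threshold** (discharging §10's smooth-flux hypothesis):
there is `η₀ > 0` such that every classical solution with `σ > 0` and packing `< η₀` on `[0, T)` conserves `∫ E`. -/
theorem integral_totalEnergy_eq_of_packing_lt :
    ∃ η₀ : ℝ, 0 < η₀ ∧ ∀ {σ T : ℝ} {ρ θ : ℝ → T3 → ℝ} {u : ℝ → T3 → V3}, 0 < σ →
      IsHardSphereEulerSolution σ T ρ u θ → (∀ t ∈ Ico 0 T, ∀ x, ρ t x * σ ^ 3 < η₀) →
        ∀ {t : ℝ}, t ∈ Ico 0 T →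
          ∫ x, totalEnergyDensity (ρ t x) (u t x) (θ t x) = ∫ x, totalEnergyDensity (ρ 0 x) (u 0 x) (θ 0 x) := by
  obtain ⟨η₀, hη₀, Hp⟩ := PolynomialCompressionSmoothPressure.isSmoothSpaceTimeOn_pressure hsEosLowDensity_proof
  refine ⟨η₀, hη₀, fun {σ T ρ θ u} hσ hE hpack t ht => ?_⟩
  exact PolynomialCompressionEnergy.integral_energy_eq hE (Hp σ T ρ θ u hσ hE hpack) ht

end EntropyBudget

/-- **GEN-4 CENSUS (2026-08-16): attacks, readings, and what would still kill.**

1. EOS WALL LIFTED (above). Newly certifiable and certified: entropy transport + min/max principle, hot spots, dense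
   volume `O(σ⁵)`, energy conservation below `η₀`, THIRD refuted strengthening (bounded temperature). Still NOT in the
   tree: local well-posedness / continuation for the hard-sphere system (Kato–Majda; the r2 line's `stub_wellPosedness`,
   whose hypothesis `∃ Z, ContDiff ℝ ∞ Z ∧ hsCompressibility = Z on [0, η₀]` is now SATISFIABLE — provable from
   `hsEosLowDensity_proof` for every `η₀` below the analyticity threshold by a smooth-cutoff extension of `1 + ηF′(η)` — so
   for such `η₀` the stub has content and is a genuine theorem-to-vendor, no longer conditional folklore), cone locality for the real gas (now meaningful: finite propagation speed for a smooth symmetric-hyperbolic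
   system), and anything about `Z` beyond `η₀` (existential, not quantitative: no certified lower bound on `η₀`, so "packing
   `η` inside the analyticity range" in the crux's intended construction is automatic for the `∃ η` but invisible in size).
2. THE LEAD'S NUMBERS (crux NOTES Result 1–3; kidder line): `K₁` has a transversal zero on the Kidder knob
   (`λ*₀ = 0.5766`, three seats, two methods) and `K₂(b₀)/k_H = −0.380 ± 0.005 ≠ 0`. DISPROVER'S READING — why this kills
   NEITHER line NOR crux: the twice-tuned set is `{p ∈ W^s(SS(r₂)) : K₁(p) = K₂(p) = 0}`, the common zero set of two smooth
   real functionals on the INFINITE-dimensional stable set (data are `σ`-independent, so the zeroth-order datum ranges over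
   all of `W^s`, at any distance from `SS` along it — not over a small chart); the knob is ONE curve in `W^s`, on which `K₁`
   changes sign; `{K₁ = 0}` is then a hypersurface `Z₁` through `p₀ = knob(b₀)` and the question is whether the `O(1)`
   function `K₂|_{Z₁}` changes sign — generically yes (codimension 2 in infinite dimensions), and a NO needs a sign-rigidity
   nobody has a mechanism for. A one-signed `G₂` over every certified direction (the gen-1 lead's planned direct nonlinear
   experiment) would be numerical line-death AT `SS(r₂)` for both lines (next: `SS(r₄)`, `J = 4`), still not `¬DenseExcursion`.
   The perturbative coefficients certify nothing either way for the `∃`-over-profiles statement (§8 item 4 stands).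
3. TARGETS (payload `targets = []`, `stuck_stubs = []` at arming). Second lead's r2 skeleton (sha 89376ea6, registered
   03:09Z; readable here only through its registered signatures): `stub_spectralPackage :
   ∀ r W S, 11/10 < r → r < 227/200 → IsMonatomicProfile r W S → OneModeTwoConditions r W S` is a `∀` over ALL globally
   smooth centre-regular profiles in the window. Every such profile crosses the sonic line at a common zero of `(Δ, Δ₁, Δ₂)`
   with `S > 0`, i.e. at `P₂ = ((r − √(r²−6r+6))/2, 1 − W)` or at `P₃ = ((r + √(r²−6r+6))/2, 1 − W) = (0.931, 0.069)` at
   `r₂` (on `S = 1 − W`, `Δ₁ = 0 ⇔ 2W² − 2rW + 3(r−1) = 0`). Linearising the desingularised field `(W, S)′ = −(Δ₁, Δ₂)`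
   at `r₂` (`p3_lin.py`): `P₂` eigenvalues `2.2292, 0.6745`, `P₃` eigenvalues `0.1878, 0.0568` — BOTH nodes with the SAME
   ratio `ν = 3.30488`, so a `C^∞` crossing at `P₃` is structurally as possible as at `P₂`; both repel into the subsonic
   side (`dx/dξ = Δ`), so each profile crosses once, at the node absorbing the centre solution (unique up to scaling,
   `W(−∞) = r−1`, outward integration transversally stable). CHECKED (`centre_hit.py`, RK4 from `(r−1, 400)`, 12-point grid
   `r ∈ [1.1005, 1.1345]`): the centre solution meets the sonic line AT `P₂(r)` to `≤ 1.2·10⁻⁹` (tolerance), distance to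
   `P₃(r) ≥ 0.98` — no `P₃`-profiles in the window, the `∀`-stub is SAFE (no stub-false/misstated claim). Residual burden
   is formal only: `IsMonatomicProfile` does not name the crossing point, so a Lean proof of `stub_spectralPackage` must
   carry this phase-portrait lemma for every `r` in the window — avoidable by adding the clause or by the ∃-form (package
   for the profile of `stub_profile`); note prepared for the lead (`Negative-notes/stub_spectralPackage-P3.md`). `stub_wellPosedness`/`HsEulerWellPosedness`:
   re-audited with the EOS wall down — its EOS hypothesis is now dischargeable, the conclusion is textbook Kato/Majda; no
   junk found (data smooth, `σ > 0`, packing `< η₁`, continuation under `C¹` bounds): TRUE in substance, XL to vendor.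
4. ATTACKS TRIED, GEN 4: (a) entropy/energy obstruction hunt with the real Gibbs relation — none (all saturated by
   implosion, above); (b) junk re-audit of the EOS after 0768: `hsCompressibility` is junk only at packing `≥ η₀`, which a
   witness never needs to visit before its FIRST crossing of level `min η (η₀/2)` (the first-crossing-time device of
   `denseExcursion_false_boundedTemperature` makes this rigorous and reusable: every necessary condition proved below
   `η₀` applies to every witness up to its first dense time); (c) literature refresh (Sandine arXiv:2508.05817 = Hunter-type
   profiles for gravitational Euler–Poisson, `γ < 6/5`: irrelevant to pure Euler `γ = 5/3`; OpenAlex/S2 legs 429 at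
   session time, local FTS unavailable — degraded, logged); (d) r2-stub signature audit (item 3).
5. VERDICT: RESISTS. The certified envelope of a witness is now: data pinned (§2); packing built dynamically from
   `O(σ³)` (§7) through a velocity-gradient blow-up `∫‖(div u)₋‖∞ ≥ 3 log σ⁻¹` (§11) to a HOT point `θ ≳ σ⁻²`, `p ≳ σ⁻⁵`
   (§14) on a set of volume `O(σ⁵)` and mass `O(σ²)` (§7, §14), at bounded total energy — the portrait of a self-similar
   implosion core and of nothing milder. -/
theorem gen4_census : True := trivial


end Summit.AtomisticToContinuum.HydrodynamicLimit.Cruxes.DenseExcursion.Disproof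

end
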